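import Literature.AlgebraicGeometry.Motives.HodgeThetaSubalgebraUnitaryOrthogonalChain
import Literature.AlgebraicGeometry.Motives.HodgeThetaSubalgebraUnitaryFortyOneFortyThreeGoodRankCores
import Literature.AlgebraicGeometry.Motives.HodgeThetaSubalgebraUnitaryEighteenFortyNineCorePart1
import Literature.AlgebraicGeometry.Motives.HodgeThetaSubalgebraUnitaryEighteenTwentyFiveCore
import HarnessLib
import Literature.AlgebraicGeometry.Motives.HodgeThetaSubalgebraUnitaryEightNineCore
import Literature.AlgebraicGeometry.Motives.HodgeThetaSubalgebraUnitaryFiveCoreAll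
import Literature.AlgebraicGeometry.Motives.HodgeThetaSubalgebraUnitaryFourOddCore
import Literature.AlgebraicGeometry.Motives.HodgeThetaSubalgebraUnitaryLowerNonVanishing
import Literature.AlgebraicGeometry.Motives.HodgeThetaSubalgebraUnitaryNineElevenCore
import Literature.AlgebraicGeometry.Motives.HodgeThetaSubalgebraUnitaryRankOneRaise
import Literature.AlgebraicGeometry.Motives.HodgeThetaSubalgebraUnitaryRankOneRaiseTwo
import Literature.AlgebraicGeometry.Motives.HodgeThetaSubalgebraUnitarySeventeenCore
import Literature.AlgebraicGeometry.Motives.HodgeThetaSubalgebraUnitarySixSevenCoreAll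
import Literature.AlgebraicGeometry.Motives.HodgeThetaSubalgebraUnitaryThreeCoprimeCore
import Literature.AlgebraicGeometry.Motives.HodgeThetaSubalgebraUnitaryTwelveThirteenCore
import Literature.AlgebraicGeometry.Motives.HodgeThetaSubalgebraUnitaryTwoOddCore

/-!
# (Part 1 of 2 — lemmas) The `Θ`-subalgebra theorem for unitary multiplicities `(18, 65)` — a `p = 83` cell by minimal-rank base points
# and sub-Levi recursion (Ribet 1983 Thm. 3, Lie step; abelian 83-folds of type `(18, 65)`)

Family `hodge`, layer `Literature/AlgebraicGeometry/Motives` (pure linear algebra over `ℂ`; no geometry). Research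
context: cell `pub-hodge-ring2` (HONEST FRAMING: research route conditional on HC_CM; not a corollary; Q11.4-sentence-2
already refuted in dim ≥ 3), Literature lane gen 89. UNCONDITIONAL; theorems only, no definition, no named fact
(D-0026), no `sorry`.

THE PRINT. K. A. Ribet, Amer. J. Math. 105 (1983), Thm. 3 = Gordon's survey Thm. 6.3 (3) [held
`paper:arxiv-alg-geom_9709030` p. 18]. THE METHOD: `HodgeThetaSubalgebraUnitarySixteenTwentyOneCore` (a raising operator
`B` of MINIMAL non-zero rank `m`, the profile dichotomy `i + j ≤ m` or `i, j ≥ m`, tree cores making a Levi algebra full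
or killing a Levi rank, lifts `UnitaryRaisingSpace.exists_raise_finrank_range_eq` + `UnitaryLeviSetup.exists_lift`, two
pencils `UnitaryGenericRank.exists_finrank_le_and_finrank_le`, the non-vanishing lemma
`UnitaryLeviFull.exists_raise_commute_apply_ne_zero`, TOOL C `UnitaryConstantRank.exists_raise_rank_ne_two`, TOOL F
`UnitaryConstantRank.false_of_le_rank`), the full-rank chain `UnitaryConstantRank.dvd_of_rank_eq_finrank`
(`HodgeThetaSubalgebraUnitaryNineTwentyEightCore`) and TOOL G `UnitaryOrthogonalChain.false_of_constProfile`.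

THIS PART FILE holds sub-Levi/pruned/peeled configurations and minimal-rank lemmas of the cell (the gate caps a proposal at 200 kB); the core theorem `UnitaryEighteenSixtyFive.eq_top_of_smul` is assembled in `HodgeThetaSubalgebraUnitaryEighteenSixtyFiveCore`.

THE CELL `(18 | 65)`. Good ranks 1, 2, 3, 4, 6, 7, 11 (Levi types `(1|64)`, `(2|63)`, `(3|62)`, `(4|61)`, `(6|59)`, `(7|58)`, `(11|54)` are tree cores); a proper `𝔊` has
raising ranks in `{0, 5, 8, 9, 10, 12, 13, 14, 15, 16, 17, 18}`; `m` minimal non-zero, `B` of rank `m`; a commuting raising `X` has profile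
`(i, j)` (`i + j` a raising rank, `i + j ≤ m` or `i, j ≥ m`). SUB-LEVI RECURSION: when the non-zero profiles are constantly
`(i, j)`, the Levi algebra `L⁺` (resp. `L⁻`) is a `Θ`-algebra whose non-zero raising ranks are all `i` (resp. `j`), and the
same minimal-rank analysis applies to it (the `sub…` lemmas of §1).
* `m = 5` (`U⁺` of type `(13 | 5)`, `U⁻` of type `(5 | 60)`): `L⁺` of type `(13 | 5)` is full and a lift with `i = 4` has `j ∈ {1}`, killed in `L⁻` (type `(5 | 60)`).
* `m = 8` (`U⁺` of type `(10 | 8)`, `U⁻` of type `(8 | 57)`): after the Levi kills the profiles are [(0, 0), (0, 8), (2, 6), (5, 3), (8, 0), (8, 8)], so `L⁺` (type `(10 | 8)`) is a `Θ`-algebra with non-zero raising ranks in `{2, 5, 8}` — impossible by the sub-Levi lemmas.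
* `m = 9` (`U⁺` of type `(9 | 9)`, `U⁻` of type `(9 | 56)`): after the Levi kills the profiles are [(0, 0), (0, 9), (1, 8), (2, 7), (3, 6), (5, 4), (7, 2), (9, 0), (9, 9)], so `L⁻` (type `(9 | 56)`) is a `Θ`-algebra with non-zero raising ranks in `{2, 4, 6, 7, 8, 9}` — impossible by the sub-Levi lemmas.
* `m = 10` (`U⁺` of type `(8 | 10)`, `U⁻` of type `(10 | 55)`): the non-zero profiles [(0, 10), (2, 8), (5, 5)] are pairwise exclusive, so constant; `(2, 8)`: TOOL C on `L⁺`; `(5, 5)`: `L⁺` (type `(8 | 10)`) has constant rank `5`.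
* `m = 12` (`U⁺` of type `(6 | 12)`, `U⁻` of type `(12 | 53)`): after the Levi kills every profile has `i = 0` (profiles [(0, 0)]), against the non-vanishing lemma.
* `m = 13` (`U⁺` of type `(5 | 13)`, `U⁻` of type `(13 | 52)`): `L⁺` of type `(5 | 13)` is full and a lift with `i = 2` has `j ∈ {11}`, killed in `L⁻` (type `(13 | 52)`).
* `m = 14` (`U⁺` of type `(4 | 14)`, `U⁻` of type `(14 | 51)`): the non-zero profiles [(0, 14), (2, 12), (4, 10)] are pairwise exclusive, so constant; `(2, 12)`: TOOL C on `L⁺`; `(4, 10)`: TOOL G.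
* `m = 15` (`U⁺` of type `(3 | 15)`, `U⁻` of type `(15 | 50)`): the non-zero profiles [(0, 15), (3, 12)] are pairwise exclusive, so constant; `(3, 12)`: `L⁻` (type `(15 | 50)`) has constant rank `12`.
* `m = 16` (`U⁺` of type `(2 | 16)`, `U⁻` of type `(16 | 49)`): the non-zero profiles [(0, 16), (1, 15), (2, 14)] are pairwise exclusive, so constant; `(1, 15)`: `L⁺` (type `(2 | 16)`) has constant rank `1`; `(2, 14)`: `L⁻` (type `(16 | 49)`) has constant rank `14`.
* `m = 17` (`U⁺` of type `(1 | 17)`, `U⁻` of type `(17 | 48)`): the non-zero profiles [(0, 17), (1, 16)] are pairwise exclusive, so constant; `(1, 16)`: `L⁻` (type `(17 | 48)`) has constant rank `16`.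
* `m = 18 = dim P`: the full-rank chain would give `18 ∣ 65`.

## References
* [Ribet1983] K. A. Ribet, *Hodge classes on certain types of abelian varieties*, Amer. J. Math. 105 (1983), Thm. 3.
* [Gordon1997] B. B. Gordon, *A survey of the Hodge conjecture for abelian varieties*, Thm. 6.3 (3), pp. 18–19.
* [Deligne1982HodgeCycles] P. Deligne, *Hodge cycles on abelian varieties*, LNM 900 (1982), I §3 Prop. 3.4, 3.6.
* [GoodmanWallachGTM255] R. Goodman, N. R. Wallach, GTM 255 (2009), §2.3.1, §4.1.1.
* [HoffmanKunze1971LinearAlgebra] K. Hoffman, R. Kunze, *Linear Algebra* (1971), §3.1 Thm. 2, §6.7, §8.5.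
-/

noncomputable section

open Module

namespace Literature.AlgebraicGeometry.Motives

namespace HodgeStructure

universe u

variable {W : Type u} [AddCommGroup W] [Module ℂ W]

/-! ### §1 Sub-Levi configurations -/

/-- Sub-Levi configuration for the `(18 | 65)` cell: a `Θ`-algebra of type `(8 | 10)` whose raising ranks lie in `{0, 2, 5, 8}` with a raising of minimal non-zero rank `2` is impossible (the non-zero profiles [(0, 2), (2, 0)] are pairwise exclusive, so constant; `(2, 0)`: `L⁻` would kill `Q ∩ ker B`). [cite: Ribet1983, Thm. 3] [cite: Gordon1997, Thm. 6.3 (3)]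
[cite: Deligne1982HodgeCycles, I §3 Prop. 3.4, 3.6] [cite: GoodmanWallachGTM255, §4.1.1] -/
theorem UnitaryEighteenSixtyFive.subEightTen_ranks2_5_8_min2 [FiniteDimensional ℂ W] {𝔊 : Submodule ℂ (Module.End ℂ W)}
    (hbr : ∀ Y ∈ 𝔊, ∀ Z ∈ 𝔊, Y * Z - Z * Y ∈ 𝔊)
    (hirr : ∀ U : Submodule ℂ W, (∀ A ∈ 𝔊, ∀ u ∈ U, A u ∈ U) → U = ⊥ ∨ U = ⊤)
    {Θ : Module.End ℂ W} (hΘ : Θ ∈ 𝔊) (hΘΘ : Θ * Θ = 1)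
    {P Q : Submodule ℂ W} (hP : ∀ x, x ∈ P ↔ Θ x = x) (hQ : ∀ x, x ∈ Q ↔ Θ x = -x)
    (hP8 : Module.finrank ℂ P = 8) (hQ10 : Module.finrank ℂ Q = 10)
    {s : W → W → ℂ} (hadd : ∀ x y z, s (x + y) z = s x z + s y z)
    (hsmul : ∀ (c : ℂ) (x y : W), s (c • x) y = c * s x y) (hsymm : ∀ x y, s y x = starRingEnd ℂ (s x y))
    (hPQ : ∀ p ∈ P, ∀ q ∈ Q, s p q = 0) (hdefP : ∀ p ∈ P, s p p = 0 → p = 0) (hdefQ : ∀ q ∈ Q, s q q = 0 → q = 0)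
    (hadj : ∀ X ∈ 𝔊, ∃ Y ∈ 𝔊, ∀ x y, s (X x) y = s x (Y y))
    (hS : ∀ B' ∈ 𝔊, Θ * B' = B' → B' * Θ = -B' →
      Module.finrank ℂ (LinearMap.range B') = 0 ∨ Module.finrank ℂ (LinearMap.range B') = 2 ∨ Module.finrank ℂ (LinearMap.range B') = 5 ∨ Module.finrank ℂ (LinearMap.range B') = 8)
    {B : Module.End ℂ W} (hB : B ∈ 𝔊) (hΘB : Θ * B = B) (hBΘ : B * Θ = -B)
    (hr : Module.finrank ℂ (LinearMap.range B) = 2) : False := by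
  classical
  have hsU : ∀ U : Submodule ℂ W, ∀ x y z : U, s ((x + y : U) : W) z = s (x : W) z + s (y : W) z :=
    fun U x y z => by simp only [Submodule.coe_add, hadd]
  have hsmU : ∀ U : Submodule ℂ W, ∀ (c : ℂ) (x y : U), s ((c • x : U) : W) y = c * s (x : W) y :=
    fun U c x y => by simp only [Submodule.coe_smul, hsmul]
  have hno1 : ∀ B' ∈ 𝔊, Θ * B' = B' → B' * Θ = -B' → Module.finrank ℂ (LinearMap.range B') ≠ 1 := by
    intro B' hB' hΘB' hB'Θ h1
    rcases hS B' hB' hΘB' hB'Θ with h | h | h | h <;> omega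
  have hmin : ∀ Y ∈ 𝔊, Θ * Y = Y → Y * Θ = -Y → Y ≠ 0 → 2 ≤ Module.finrank ℂ (LinearMap.range Y) := by
    intro Y hY hΘY hYΘ hY0
    have h0 : Module.finrank ℂ (LinearMap.range Y) ≠ 0 := fun h =>
      hY0 (LinearMap.range_eq_bot.1 (Submodule.finrank_eq_zero.1 h))
    rcases hS Y hY hΘY hYΘ with h | h | h | h <;> omega
  have hmin' : ∀ Z ∈ 𝔊, Θ * Z = Z → Z * Θ = -Z → Z ≠ 0 → Module.finrank ℂ (LinearMap.range B) ≤ Module.finrank ℂ (LinearMap.range Z) := by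
    rw [hr]; exact hmin
  obtain ⟨ι, Um, Up, PU, QU, Lm, ιm, Pm, Qm, Lp, ιp, Pp, Qp, hιmem, hιι, hιΘ, hιs, hUm, hUp, hfinUm, hfinUp,
    hPM, hQM, hPU, hQU, hrangeP, hPUP, hQUQ, hfinQM, hfinPU, hfinQU, hLm, hLp,
    hιmapply, hPmmem, hQmmem, hbrLm, hirrLm, hιmmem, hιmιm, hPm, hQm, hfinPm, hfinQm, hPmQm, hdefPm, hdefQm, hadjLm,
    hιpapply, hPpmem, hQpmem, hbrLp, hirrLp, hιpmem, hιpιp, hPp, hQp, hfinPp, hfinQp, hPpQp, hdefPp, hdefQp, hadjLp,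
    hsplit⟩ :=
    UnitaryLeviSetup.exists_levi_pair hbr hirr hΘ hΘΘ hP hQ hadd hsymm hPQ hdefP hdefQ hadj hB hΘB hBΘ
  have hdich : ∀ X ∈ 𝔊, Θ * X = X → X * Θ = -X → X * ι = ι * X →
      Module.finrank ℂ (Up.map X) + Module.finrank ℂ (Um.map X) ≤ Module.finrank ℂ (LinearMap.range B) ∨
        (2 ≤ Module.finrank ℂ (Up.map X) ∧ 2 ≤ Module.finrank ℂ (Um.map X)) := fun X hX hΘX hXΘ hXc =>
    UnitaryLeviSetup.profile_dichotomy hbr hΘΘ hP hQ hadd hsymm hPQ hdefP hdefQ hadj hmin hB hΘB hBΘ hιι hιΘ hιs hUm hUp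
      hPM hQM hQU hfinQU hrangeP hX hΘX hXΘ hXc
  have hfinQU' := hfinQU
  rw [hr] at hfinQM hfinPU hfinQU hfinPm hfinQm hfinPp hfinQp hsplit hdich
  rw [hQ10] at hfinQM hfinQm hfinUm
  rw [hP8] at hfinPU hfinPp hfinUp
  have hcm : ∀ Z : Module.End ℂ W, Z * ι = ι * Z → ∀ x ∈ Um, Z x ∈ Um := fun Z hZ x hx =>
    (hUm _).2 (by rw [← Module.End.mul_apply, ← hZ, Module.End.mul_apply, (hUm x).1 hx, map_neg])
  have hcp : ∀ Z : Module.End ℂ W, Z * ι = ι * Z → ∀ x ∈ Up, Z x ∈ Up := fun Z hZ x hx =>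
    (hUp _).2 (by rw [← Module.End.mul_apply, ← hZ, Module.End.mul_apply, (hUp x).1 hx])
  have hfullm_of : Lm = ⊤ → False := fun h =>
    UnitaryLeviSetup.false_of_full_larger hbr hΘΘ hno1 hιι hιΘ hUm hUp (by omega) (by omega) hPM hQM (by omega)
      (by omega) hLm h
  have hkillm1 : ∀ X ∈ 𝔊, Θ * X = X → X * Θ = -X → X * ι = ι * X → Module.finrank ℂ (Um.map X) ≠ 1 := by
    intro X hX hΘX hXΘ hXc h1
    obtain ⟨hxmem, hιmx, hxιm, hxrk⟩ := UnitaryLeviSetup.restrict_mem hcm hLm hιmapply X hX hΘX hXΘ hXc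
    rw [h1] at hxrk
    exact hfullm_of (UnitaryRankOneRaise.eq_top_of_rankOne_raise_two hbrLm hirrLm hιmmem hιmιm hPm hQm
      (s := fun v w : Um => s (v : W) w) (hsU Um) (fun v w => hsymm v w) hPmQm hdefPm hdefQm hadjLm hxmem hιmx hxιm
      hxrk (by omega) (by omega))
  have hfullp_of : Lp = ⊤ → False := by
    intro hLptop
    obtain ⟨T1, hιT1, hT1ι, hT1r⟩ := UnitaryRaisingSpace.exists_raise_finrank_range_eq hιpιp hPp hQp (k := 1)
      (by omega) (by omega)
    obtain ⟨X1, hX1, hΘX1, hX1Θ, hX1c, hX1Up⟩ := UnitaryLeviSetup.exists_lift hbr hΘ hΘΘ hcp hιΘ hLp hιpapply T1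
      (by rw [hLptop]; exact Submodule.mem_top) hιT1 hT1ι
    rw [hT1r] at hX1Up
    obtain ⟨hs1, hi1, hi1', hj1, hj1'⟩ := hsplit X1 hΘX1 hX1Θ hX1c
    have hrk1 := hS X1 hX1 hΘX1 hX1Θ
    have hd1 := hdich X1 hX1 hΘX1 hX1Θ hX1c
    rw [hs1] at hrk1
    rw [hX1Up] at hrk1 hd1
    have hk_hkillm1 := hkillm1 X1 hX1 hΘX1 hX1Θ hX1c
    omega
  have hprof : ∀ X ∈ 𝔊, Θ * X = X → X * Θ = -X → X * ι = ι * X →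
      (Module.finrank ℂ (Up.map X) = 0 ∧ Module.finrank ℂ (Um.map X) = 0) ∨
        (Module.finrank ℂ (Up.map X) = 0 ∧ Module.finrank ℂ (Um.map X) = 2) ∨
        (Module.finrank ℂ (Up.map X) = 2 ∧ Module.finrank ℂ (Um.map X) = 0) := by
    intro X hX hΘX hXΘ hXc
    obtain ⟨hs, hi, hi', hj, hj'⟩ := hsplit X hΘX hXΘ hXc
    have hkillm1' := hkillm1 X hX hΘX hXΘ hXc
    have hrk := hS X hX hΘX hXΘ
    have hd := hdich X hX hΘX hXΘ hXc
    rw [hs] at hrk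
    generalize Module.finrank ℂ ↥(Submodule.map X Um) = jj at *
    have hjle : jj ≤ 2 := by omega
    interval_cases jj
    · rcases (show Module.finrank ℂ (Up.map X) = 0 ∨ Module.finrank ℂ (Up.map X) = 2 by omega) with h | h
      · exact Or.inl ⟨h, rfl⟩
      · exact Or.inr (Or.inr (⟨h, rfl⟩))
    · exact (hkillm1' rfl).elim
    · exact Or.inr (Or.inl ⟨by omega, rfl⟩)
  obtain ⟨⟨p, hp⟩, hp0⟩ := Module.finrank_pos_iff_exists_ne_zero.1 (show 0 < Module.finrank ℂ PU by omega)
  obtain ⟨⟨q, hq⟩, hq0⟩ := Module.finrank_pos_iff_exists_ne_zero.1 (show 0 < Module.finrank ℂ QU by omega)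
  obtain ⟨X₀, hX₀, hΘX₀, hX₀Θ, hX₀c, c₀, hιc₀, -, hX₀c0⟩ :=
    UnitaryLeviFull.exists_raise_commute_apply_ne_zero hbr hirr hΘ hΘΘ hQ hιmem hιι hιΘ hUm hUp
      ⟨p, fun h => hp0 (Subtype.ext h), ((hPU p).1 hp).1, ((hPU p).1 hp).2⟩
      ⟨q, fun h => hq0 (Subtype.ext h), ((hQU q).1 hq).1, ((hQU q).1 hq).2⟩
  have hX₀i : Module.finrank ℂ (Up.map X₀) ≠ 0 := fun h0 => by
    have hmem : X₀ c₀ ∈ Up.map X₀ := Submodule.mem_map_of_mem ((hUp c₀).2 hιc₀)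
    rw [Submodule.finrank_eq_zero.1 h0, Submodule.mem_bot] at hmem
    exact hX₀c0 hmem
  have hnotboth : ∀ X ∈ 𝔊, Θ * X = X → X * Θ = -X → X * ι = ι * X → ∀ X' ∈ 𝔊, Θ * X' = X' → X' * Θ = -X' →
      X' * ι = ι * X' → 2 < Module.finrank ℂ (Up.map X') + Module.finrank ℂ (Um.map X) → False := by
    intro X hX hΘX hXΘ hXc X' hX' hΘX' hX'Θ hX'c hgt
    obtain ⟨c, hc1, hc2⟩ := UnitaryGenericRank.exists_finrank_le_and_finrank_le (X'.restrict (hcp X' hX'c))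
      (X.restrict (hcp X hXc)) (X.restrict (hcm X hXc)) (X'.restrict (hcm X' hX'c))
    obtain ⟨hX₁, hΘX₁, hX₁Θ, hX₁c⟩ := UnitaryLeviSetup.add_smul_raise X hX hΘX hXΘ hXc X' hX' hΘX' hX'Θ hX'c c
    have hi₁ := UnitaryLeviSetup.finrank_map_add_smul hcp X X' hXc hX'c c hX₁c
    have hj₁ := UnitaryLeviSetup.finrank_map_add_smul hcm X X' hXc hX'c c hX₁c
    rw [UnitaryLeviRank.finrank_range_restrict] at hc1 hc2
    have hp := hprof (X + c • X') hX₁ hΘX₁ hX₁Θ hX₁c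
    rw [hi₁, hj₁] at hp
    omega
  have hzero : ∀ X ∈ 𝔊, Θ * X = X → X * Θ = -X → X * ι = ι * X → Module.finrank ℂ (Up.map X) = 0 → Module.finrank ℂ (Um.map X) = 0 → X = 0 := by
    intro X hX hΘX hXΘ hXc hi hj
    obtain ⟨hs, -, -, -, -⟩ := hsplit X hΘX hXΘ hXc
    rw [hi, hj, add_zero] at hs
    exact LinearMap.range_eq_bot.1 (Submodule.finrank_eq_zero.1 hs)
  have hjoint : ∀ v ∈ Q ⊓ LinearMap.ker B,
      (∀ X ∈ 𝔊, Θ * X = X → X * Θ = -X → X * ι = ι * X → X v = 0) → v = 0 := by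
    intro v hv hkill
    obtain ⟨hιv, -⟩ := (hQM v).1 hv
    have hvUm : v ∈ Um := (hUm v).2 hιv
    obtain ⟨⟨p₁, hp₁⟩, hp₁0⟩ := Module.finrank_pos_iff_exists_ne_zero.1 (show 0 < Module.finrank ℂ Pm by omega)
    have hq : ιm ⟨v, hvUm⟩ = -⟨v, hvUm⟩ := (hQm _).1 ((hQmmem _).2 hv)
    have h0 := UnitaryThetaCore.eq_zero_of_forall_raise_apply_eq_zero hbrLm hirrLm hιmmem hιmιm
      ⟨p₁, fun h => hp₁0 (Subtype.ext h), (hPm p₁).1 hp₁⟩ hq fun T hT hιT hTι => ?_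
    · exact congrArg Subtype.val h0
    obtain ⟨X, hX, hΘX, hXΘ, hXc, hXT⟩ := UnitaryLeviSetup.exists_lift_eq hbr hΘ hΘΘ hιΘ hLm hιmapply T hT hιT hTι
    exact Subtype.ext (by rw [← hXT]; exact hkill X hX hΘX hXΘ hXc)
  rcases hprof X₀ hX₀ hΘX₀ hX₀Θ hX₀c with ⟨h0i, h0j⟩ | ⟨h0i, h0j⟩ | ⟨h0i, h0j⟩
  · exact hX₀i h0i
  · exact hX₀i h0i
  · -- constant profile `(2, 0)`
    have hprofc : ∀ X ∈ 𝔊, Θ * X = X → X * Θ = -X → X * ι = ι * X → X ≠ 0 →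
        Module.finrank ℂ (Up.map X) = 2 ∧ Module.finrank ℂ (Um.map X) = 0 := by
      intro X hX hΘX hXΘ hXc hX0
      rcases hprof X hX hΘX hXΘ hXc with ⟨hi, hj⟩ | ⟨hi, hj⟩ | ⟨hi, hj⟩
      · exact (hX0 (hzero X hX hΘX hXΘ hXc hi hj)).elim
      · exact (hnotboth X hX hΘX hXΘ hXc X₀ hX₀ hΘX₀ hX₀Θ hX₀c (by omega)).elim
      · exact ⟨hi, hj⟩
    obtain ⟨⟨v, hv⟩, hv0⟩ := Module.finrank_pos_iff_exists_ne_zero.1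
      (show 0 < Module.finrank ℂ ↥(Q ⊓ LinearMap.ker B) by omega)
    refine hv0 (Subtype.ext (hjoint v hv fun X hX hΘX hXΘ hXc => ?_))
    by_cases hX0 : X = 0
    · rw [hX0, LinearMap.zero_apply]
    · have hj := (hprofc X hX hΘX hXΘ hXc hX0).2
      have hvUm : v ∈ Um := (hUm v).2 ((hQM v).1 hv).1
      have hXv : X v ∈ Um.map X := Submodule.mem_map_of_mem hvUm
      rw [Submodule.finrank_eq_zero.1 hj, Submodule.mem_bot] at hXv
      exact hXv

/-- Sub-Levi configuration for the `(18 | 65)` cell: a `Θ`-algebra of type `(10 | 8)` whose raising ranks lie in `{0, 2, 5, 8}` with a raising of minimal non-zero rank `2` is impossible (apply the `(8 | 10)` configuration to `−Θ` (adjoints have equal rank): the non-zero profiles [(0, 2), (2, 0)] are pairwise exclusive, so constant; `(2, 0)`: `L⁻` would kill `Q ∩ ker B`). [cite: Ribet1983, Thm. 3] [cite: Gordon1997, Thm. 6.3 (3)]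
[cite: Deligne1982HodgeCycles, I §3 Prop. 3.4, 3.6] [cite: GoodmanWallachGTM255, §4.1.1] -/
theorem UnitaryEighteenSixtyFive.subTenEight_ranks2_5_8_min2 [FiniteDimensional ℂ W] {𝔊 : Submodule ℂ (Module.End ℂ W)}
    (hbr : ∀ Y ∈ 𝔊, ∀ Z ∈ 𝔊, Y * Z - Z * Y ∈ 𝔊)
    (hirr : ∀ U : Submodule ℂ W, (∀ A ∈ 𝔊, ∀ u ∈ U, A u ∈ U) → U = ⊥ ∨ U = ⊤)
    {Θ : Module.End ℂ W} (hΘ : Θ ∈ 𝔊) (hΘΘ : Θ * Θ = 1)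
    {P Q : Submodule ℂ W} (hP : ∀ x, x ∈ P ↔ Θ x = x) (hQ : ∀ x, x ∈ Q ↔ Θ x = -x)
    (hP10 : Module.finrank ℂ P = 10) (hQ8 : Module.finrank ℂ Q = 8)
    {s : W → W → ℂ} (hadd : ∀ x y z, s (x + y) z = s x z + s y z)
    (hsmul : ∀ (c : ℂ) (x y : W), s (c • x) y = c * s x y) (hsymm : ∀ x y, s y x = starRingEnd ℂ (s x y))
    (hPQ : ∀ p ∈ P, ∀ q ∈ Q, s p q = 0) (hdefP : ∀ p ∈ P, s p p = 0 → p = 0) (hdefQ : ∀ q ∈ Q, s q q = 0 → q = 0)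
    (hadj : ∀ X ∈ 𝔊, ∃ Y ∈ 𝔊, ∀ x y, s (X x) y = s x (Y y))
    (hS : ∀ B' ∈ 𝔊, Θ * B' = B' → B' * Θ = -B' →
      Module.finrank ℂ (LinearMap.range B') = 0 ∨ Module.finrank ℂ (LinearMap.range B') = 2 ∨ Module.finrank ℂ (LinearMap.range B') = 5 ∨ Module.finrank ℂ (LinearMap.range B') = 8)
    {B : Module.End ℂ W} (hB : B ∈ 𝔊) (hΘB : Θ * B = B) (hBΘ : B * Θ = -B)
    (hr : Module.finrank ℂ (LinearMap.range B) = 2) : False := by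
  classical
  have hsU : ∀ U : Submodule ℂ W, ∀ x y z : U, s ((x + y : U) : W) z = s (x : W) z + s (y : W) z :=
    fun U x y z => by simp only [Submodule.coe_add, hadd]
  have hsmU : ∀ U : Submodule ℂ W, ∀ (c : ℂ) (x y : U), s ((c • x : U) : W) y = c * s (x : W) y :=
    fun U c x y => by simp only [Submodule.coe_smul, hsmul]
  obtain ⟨C, hC, hBC⟩ := hadj B hB
  obtain ⟨hΘC, hCΘ⟩ := UnitaryTwoOdd.lower_of_adjoint hadd hsymm hΘΘ hP hQ hPQ hdefP hdefQ hΘB hBΘ hBC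
  have hraise : ∀ v, B v ∈ P := fun v => (hP _).2 (by rw [← Module.End.mul_apply, hΘB])
  have hlower : ∀ w, C w ∈ Q := fun w => (hQ _).2 (by rw [← Module.End.mul_apply, hΘC, LinearMap.neg_apply])
  have hrk : Module.finrank ℂ (LinearMap.range C) = Module.finrank ℂ (LinearMap.range B) :=
    (UnitaryAdjointRank.finrank_range_eq hadd hsymm hBC (fun v h => hdefP _ (hraise v) h)
      (fun w h => hdefQ _ (hlower w) h)).symm
  have hnΘ : -Θ ∈ 𝔊 := Submodule.neg_mem _ hΘ
  have hnΘΘ : (-Θ) * (-Θ) = 1 := by rw [neg_mul_neg, hΘΘ]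
  have hQ' : ∀ x, x ∈ Q ↔ (-Θ) x = x := fun x => by rw [hQ, LinearMap.neg_apply, neg_eq_iff_eq_neg]
  have hP' : ∀ x, x ∈ P ↔ (-Θ) x = -x := fun x => by rw [hP, LinearMap.neg_apply, neg_inj]
  have hQP : ∀ q ∈ Q, ∀ p ∈ P, s q p = 0 := fun q hq p hp => by rw [hsymm, hPQ p hp q hq, map_zero]
  have hΘC' : (-Θ) * C = C := by rw [neg_mul, hΘC, neg_neg]
  have hCΘ' : C * (-Θ) = -C := by rw [mul_neg, hCΘ]
  have hS' : ∀ B' ∈ 𝔊, (-Θ) * B' = B' → B' * (-Θ) = -B' → Module.finrank ℂ (LinearMap.range B') = 0 ∨ Module.finrank ℂ (LinearMap.range B') = 2 ∨ Module.finrank ℂ (LinearMap.range B') = 5 ∨ Module.finrank ℂ (LinearMap.range B') = 8 := by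
    intro B' hB' h1 h2
    obtain ⟨C', hC', hB'C'⟩ := hadj B' hB'
    obtain ⟨hΘC'', hC''Θ⟩ := UnitaryTwoOdd.lower_of_adjoint hadd hsymm hnΘΘ hQ' hP' hQP hdefQ hdefP h1 h2 hB'C'
    have h1' : Θ * B' = -B' := by rw [neg_mul, neg_eq_iff_eq_neg] at h1; exact h1
    rw [neg_mul, neg_inj] at hΘC''
    rw [mul_neg, neg_eq_iff_eq_neg] at hC''Θ
    have hrk' : Module.finrank ℂ (LinearMap.range B') = Module.finrank ℂ (LinearMap.range C') :=
      UnitaryAdjointRank.finrank_range_eq hadd hsymm hB'C'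
        (fun v h => hdefQ _ ((hQ _).2 (by rw [← Module.End.mul_apply, h1', LinearMap.neg_apply])) h)
        (fun w h => hdefP _ ((hP _).2 (by rw [← Module.End.mul_apply, hΘC''])) h)
    have h := hS C' hC' hΘC'' hC''Θ
    rw [← hrk'] at h
    exact h
  exact UnitaryEighteenSixtyFive.subEightTen_ranks2_5_8_min2 hbr hirr hnΘ hnΘΘ hQ' hP' hQ8 hP10 hadd hsmul hsymm hQP hdefQ hdefP hadj hS' hC hΘC' hCΘ'
    (by rw [hrk, hr])

/-- Sub-Levi configuration for the `(18 | 65)` cell: a `Θ`-algebra of type `(8 | 10)` whose raising ranks lie in `{0, 5, 8}` with a raising of minimal non-zero rank `5` is impossible (`L⁺` of type `(3 | 5)` is full; two pencils (lifts with `i = 1`, `i = 2`)). [cite: Ribet1983, Thm. 3] [cite: Gordon1997, Thm. 6.3 (3)]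
[cite: Deligne1982HodgeCycles, I §3 Prop. 3.4, 3.6] [cite: GoodmanWallachGTM255, §4.1.1] -/
theorem UnitaryEighteenSixtyFive.subEightTen_ranks5_8_min5 [FiniteDimensional ℂ W] {𝔊 : Submodule ℂ (Module.End ℂ W)}
    (hbr : ∀ Y ∈ 𝔊, ∀ Z ∈ 𝔊, Y * Z - Z * Y ∈ 𝔊)
    (hirr : ∀ U : Submodule ℂ W, (∀ A ∈ 𝔊, ∀ u ∈ U, A u ∈ U) → U = ⊥ ∨ U = ⊤)
    {Θ : Module.End ℂ W} (hΘ : Θ ∈ 𝔊) (hΘΘ : Θ * Θ = 1)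
    {P Q : Submodule ℂ W} (hP : ∀ x, x ∈ P ↔ Θ x = x) (hQ : ∀ x, x ∈ Q ↔ Θ x = -x)
    (hP8 : Module.finrank ℂ P = 8) (hQ10 : Module.finrank ℂ Q = 10)
    {s : W → W → ℂ} (hadd : ∀ x y z, s (x + y) z = s x z + s y z)
    (hsmul : ∀ (c : ℂ) (x y : W), s (c • x) y = c * s x y) (hsymm : ∀ x y, s y x = starRingEnd ℂ (s x y))
    (hPQ : ∀ p ∈ P, ∀ q ∈ Q, s p q = 0) (hdefP : ∀ p ∈ P, s p p = 0 → p = 0) (hdefQ : ∀ q ∈ Q, s q q = 0 → q = 0)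
    (hadj : ∀ X ∈ 𝔊, ∃ Y ∈ 𝔊, ∀ x y, s (X x) y = s x (Y y))
    (hS : ∀ B' ∈ 𝔊, Θ * B' = B' → B' * Θ = -B' →
      Module.finrank ℂ (LinearMap.range B') = 0 ∨ Module.finrank ℂ (LinearMap.range B') = 5 ∨ Module.finrank ℂ (LinearMap.range B') = 8)
    {B : Module.End ℂ W} (hB : B ∈ 𝔊) (hΘB : Θ * B = B) (hBΘ : B * Θ = -B)
    (hr : Module.finrank ℂ (LinearMap.range B) = 5) : False := by
  classical
  have hsU : ∀ U : Submodule ℂ W, ∀ x y z : U, s ((x + y : U) : W) z = s (x : W) z + s (y : W) z :=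
    fun U x y z => by simp only [Submodule.coe_add, hadd]
  have hsmU : ∀ U : Submodule ℂ W, ∀ (c : ℂ) (x y : U), s ((c • x : U) : W) y = c * s (x : W) y :=
    fun U c x y => by simp only [Submodule.coe_smul, hsmul]
  have hno1 : ∀ B' ∈ 𝔊, Θ * B' = B' → B' * Θ = -B' → Module.finrank ℂ (LinearMap.range B') ≠ 1 := by
    intro B' hB' hΘB' hB'Θ h1
    rcases hS B' hB' hΘB' hB'Θ with h | h | h <;> omega
  have hmin : ∀ Y ∈ 𝔊, Θ * Y = Y → Y * Θ = -Y → Y ≠ 0 → 5 ≤ Module.finrank ℂ (LinearMap.range Y) := by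
    intro Y hY hΘY hYΘ hY0
    have h0 : Module.finrank ℂ (LinearMap.range Y) ≠ 0 := fun h =>
      hY0 (LinearMap.range_eq_bot.1 (Submodule.finrank_eq_zero.1 h))
    rcases hS Y hY hΘY hYΘ with h | h | h <;> omega
  have hmin' : ∀ Z ∈ 𝔊, Θ * Z = Z → Z * Θ = -Z → Z ≠ 0 → Module.finrank ℂ (LinearMap.range B) ≤ Module.finrank ℂ (LinearMap.range Z) := by
    rw [hr]; exact hmin
  obtain ⟨ι, Um, Up, PU, QU, Lm, ιm, Pm, Qm, Lp, ιp, Pp, Qp, hιmem, hιι, hιΘ, hιs, hUm, hUp, hfinUm, hfinUp,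
    hPM, hQM, hPU, hQU, hrangeP, hPUP, hQUQ, hfinQM, hfinPU, hfinQU, hLm, hLp,
    hιmapply, hPmmem, hQmmem, hbrLm, hirrLm, hιmmem, hιmιm, hPm, hQm, hfinPm, hfinQm, hPmQm, hdefPm, hdefQm, hadjLm,
    hιpapply, hPpmem, hQpmem, hbrLp, hirrLp, hιpmem, hιpιp, hPp, hQp, hfinPp, hfinQp, hPpQp, hdefPp, hdefQp, hadjLp,
    hsplit⟩ :=
    UnitaryLeviSetup.exists_levi_pair hbr hirr hΘ hΘΘ hP hQ hadd hsymm hPQ hdefP hdefQ hadj hB hΘB hBΘ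
  have hdich : ∀ X ∈ 𝔊, Θ * X = X → X * Θ = -X → X * ι = ι * X →
      Module.finrank ℂ (Up.map X) + Module.finrank ℂ (Um.map X) ≤ Module.finrank ℂ (LinearMap.range B) ∨
        (5 ≤ Module.finrank ℂ (Up.map X) ∧ 5 ≤ Module.finrank ℂ (Um.map X)) := fun X hX hΘX hXΘ hXc =>
    UnitaryLeviSetup.profile_dichotomy hbr hΘΘ hP hQ hadd hsymm hPQ hdefP hdefQ hadj hmin hB hΘB hBΘ hιι hιΘ hιs hUm hUp
      hPM hQM hQU hfinQU hrangeP hX hΘX hXΘ hXc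
  have hfinQU' := hfinQU
  rw [hr] at hfinQM hfinPU hfinQU hfinPm hfinQm hfinPp hfinQp hsplit hdich
  rw [hQ10] at hfinQM hfinQm hfinUm
  rw [hP8] at hfinPU hfinPp hfinUp
  have hcm : ∀ Z : Module.End ℂ W, Z * ι = ι * Z → ∀ x ∈ Um, Z x ∈ Um := fun Z hZ x hx =>
    (hUm _).2 (by rw [← Module.End.mul_apply, ← hZ, Module.End.mul_apply, (hUm x).1 hx, map_neg])
  have hcp : ∀ Z : Module.End ℂ W, Z * ι = ι * Z → ∀ x ∈ Up, Z x ∈ Up := fun Z hZ x hx =>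
    (hUp _).2 (by rw [← Module.End.mul_apply, ← hZ, Module.End.mul_apply, (hUp x).1 hx])
  have hfullm_of : Lm = ⊤ → False := fun h =>
    UnitaryLeviSetup.false_of_full_larger hbr hΘΘ hno1 hιι hιΘ hUm hUp (by omega) (by omega) hPM hQM (by omega)
      (by omega) hLm h
  have hLptop : Lp = ⊤ :=
    UnitaryThreeCoprime.eq_top hbrLp hirrLp hιpmem hιpιp hPp hQp (by omega) (by omega) (s := fun x y : Up => s (x : W) y) (fun x y z => by simp only [Submodule.coe_add, hadd]) (fun x y => hsymm _ _) hPpQp hdefPp hdefQp hadjLp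
  obtain ⟨T1, hιT1, hT1ι, hT1r⟩ := UnitaryRaisingSpace.exists_raise_finrank_range_eq hιpιp hPp hQp (k := 1)
    (by omega) (by omega)
  obtain ⟨X1, hX1, hΘX1, hX1Θ, hX1c, hX1Up⟩ := UnitaryLeviSetup.exists_lift hbr hΘ hΘΘ hcp hιΘ hLp hιpapply T1
    (by rw [hLptop]; exact Submodule.mem_top) hιT1 hT1ι
  rw [hT1r] at hX1Up
  obtain ⟨hs1, hi1, hi1', hj1, hj1'⟩ := hsplit X1 hΘX1 hX1Θ hX1c
  have hrk1 := hS X1 hX1 hΘX1 hX1Θ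
  have hd1 := hdich X1 hX1 hΘX1 hX1Θ hX1c
  rw [hs1] at hrk1
  rw [hX1Up] at hrk1 hd1
  obtain ⟨T2, hιT2, hT2ι, hT2r⟩ := UnitaryRaisingSpace.exists_raise_finrank_range_eq hιpιp hPp hQp (k := 2)
    (by omega) (by omega)
  obtain ⟨X2, hX2, hΘX2, hX2Θ, hX2c, hX2Up⟩ := UnitaryLeviSetup.exists_lift hbr hΘ hΘΘ hcp hιΘ hLp hιpapply T2
    (by rw [hLptop]; exact Submodule.mem_top) hιT2 hT2ι
  rw [hT2r] at hX2Up
  obtain ⟨hs2, hi2, hi2', hj2, hj2'⟩ := hsplit X2 hΘX2 hX2Θ hX2c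
  have hrk2 := hS X2 hX2 hΘX2 hX2Θ
  have hd2 := hdich X2 hX2 hΘX2 hX2Θ hX2c
  rw [hs2] at hrk2
  rw [hX2Up] at hrk2 hd2
  have hprof : ∀ X ∈ 𝔊, Θ * X = X → X * Θ = -X → X * ι = ι * X →
      (Module.finrank ℂ (Up.map X) + Module.finrank ℂ (Um.map X) = 0 ∨
        Module.finrank ℂ (Up.map X) + Module.finrank ℂ (Um.map X) = 5) ∧ Module.finrank ℂ (Up.map X) ≤ 3 := by
    intro X hX hΘX hXΘ hXc
    obtain ⟨hs, hi, hi', hj, hj'⟩ := hsplit X hΘX hXΘ hXc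

    have hrk := hS X hX hΘX hXΘ
    have hd := hdich X hX hΘX hXΘ hXc
    rw [hs] at hrk
    omega
  have hnotboth : ∀ X ∈ 𝔊, Θ * X = X → X * Θ = -X → X * ι = ι * X → ∀ X' ∈ 𝔊, Θ * X' = X' → X' * Θ = -X' →
      X' * ι = ι * X' → 5 < Module.finrank ℂ (Up.map X') + Module.finrank ℂ (Um.map X) → False := by
    intro X hX hΘX hXΘ hXc X' hX' hΘX' hX'Θ hX'c hgt
    obtain ⟨c, hc1, hc2⟩ := UnitaryGenericRank.exists_finrank_le_and_finrank_le (X'.restrict (hcp X' hX'c))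
      (X.restrict (hcp X hXc)) (X.restrict (hcm X hXc)) (X'.restrict (hcm X' hX'c))
    obtain ⟨hX₁, hΘX₁, hX₁Θ, hX₁c⟩ := UnitaryLeviSetup.add_smul_raise X hX hΘX hXΘ hXc X' hX' hΘX' hX'Θ hX'c c
    have hi₁ := UnitaryLeviSetup.finrank_map_add_smul hcp X X' hXc hX'c c hX₁c
    have hj₁ := UnitaryLeviSetup.finrank_map_add_smul hcm X X' hXc hX'c c hX₁c
    rw [UnitaryLeviRank.finrank_range_restrict] at hc1 hc2
    have hp := hprof (X + c • X') hX₁ hΘX₁ hX₁Θ hX₁c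
    rw [hi₁, hj₁] at hp
    omega
  exact hnotboth X1 hX1 hΘX1 hX1Θ hX1c X2 hX2 hΘX2 hX2Θ hX2c (by omega)

/-- Sub-Levi configuration for the `(18 | 65)` cell: a `Θ`-algebra of type `(10 | 8)` whose raising ranks lie in `{0, 5, 8}` with a raising of minimal non-zero rank `5` is impossible (apply the `(8 | 10)` configuration to `−Θ` (adjoints have equal rank): `L⁺` of type `(3 | 5)` is full; two pencils (lifts with `i = 1`, `i = 2`)). [cite: Ribet1983, Thm. 3] [cite: Gordon1997, Thm. 6.3 (3)]
[cite: Deligne1982HodgeCycles, I §3 Prop. 3.4, 3.6] [cite: GoodmanWallachGTM255, §4.1.1] -/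
theorem UnitaryEighteenSixtyFive.subTenEight_ranks5_8_min5 [FiniteDimensional ℂ W] {𝔊 : Submodule ℂ (Module.End ℂ W)}
    (hbr : ∀ Y ∈ 𝔊, ∀ Z ∈ 𝔊, Y * Z - Z * Y ∈ 𝔊)
    (hirr : ∀ U : Submodule ℂ W, (∀ A ∈ 𝔊, ∀ u ∈ U, A u ∈ U) → U = ⊥ ∨ U = ⊤)
    {Θ : Module.End ℂ W} (hΘ : Θ ∈ 𝔊) (hΘΘ : Θ * Θ = 1)
    {P Q : Submodule ℂ W} (hP : ∀ x, x ∈ P ↔ Θ x = x) (hQ : ∀ x, x ∈ Q ↔ Θ x = -x)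
    (hP10 : Module.finrank ℂ P = 10) (hQ8 : Module.finrank ℂ Q = 8)
    {s : W → W → ℂ} (hadd : ∀ x y z, s (x + y) z = s x z + s y z)
    (hsmul : ∀ (c : ℂ) (x y : W), s (c • x) y = c * s x y) (hsymm : ∀ x y, s y x = starRingEnd ℂ (s x y))
    (hPQ : ∀ p ∈ P, ∀ q ∈ Q, s p q = 0) (hdefP : ∀ p ∈ P, s p p = 0 → p = 0) (hdefQ : ∀ q ∈ Q, s q q = 0 → q = 0)
    (hadj : ∀ X ∈ 𝔊, ∃ Y ∈ 𝔊, ∀ x y, s (X x) y = s x (Y y))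
    (hS : ∀ B' ∈ 𝔊, Θ * B' = B' → B' * Θ = -B' →
      Module.finrank ℂ (LinearMap.range B') = 0 ∨ Module.finrank ℂ (LinearMap.range B') = 5 ∨ Module.finrank ℂ (LinearMap.range B') = 8)
    {B : Module.End ℂ W} (hB : B ∈ 𝔊) (hΘB : Θ * B = B) (hBΘ : B * Θ = -B)
    (hr : Module.finrank ℂ (LinearMap.range B) = 5) : False := by
  classical
  have hsU : ∀ U : Submodule ℂ W, ∀ x y z : U, s ((x + y : U) : W) z = s (x : W) z + s (y : W) z :=
    fun U x y z => by simp only [Submodule.coe_add, hadd]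
  have hsmU : ∀ U : Submodule ℂ W, ∀ (c : ℂ) (x y : U), s ((c • x : U) : W) y = c * s (x : W) y :=
    fun U c x y => by simp only [Submodule.coe_smul, hsmul]
  obtain ⟨C, hC, hBC⟩ := hadj B hB
  obtain ⟨hΘC, hCΘ⟩ := UnitaryTwoOdd.lower_of_adjoint hadd hsymm hΘΘ hP hQ hPQ hdefP hdefQ hΘB hBΘ hBC
  have hraise : ∀ v, B v ∈ P := fun v => (hP _).2 (by rw [← Module.End.mul_apply, hΘB])
  have hlower : ∀ w, C w ∈ Q := fun w => (hQ _).2 (by rw [← Module.End.mul_apply, hΘC, LinearMap.neg_apply])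
  have hrk : Module.finrank ℂ (LinearMap.range C) = Module.finrank ℂ (LinearMap.range B) :=
    (UnitaryAdjointRank.finrank_range_eq hadd hsymm hBC (fun v h => hdefP _ (hraise v) h)
      (fun w h => hdefQ _ (hlower w) h)).symm
  have hnΘ : -Θ ∈ 𝔊 := Submodule.neg_mem _ hΘ
  have hnΘΘ : (-Θ) * (-Θ) = 1 := by rw [neg_mul_neg, hΘΘ]
  have hQ' : ∀ x, x ∈ Q ↔ (-Θ) x = x := fun x => by rw [hQ, LinearMap.neg_apply, neg_eq_iff_eq_neg]
  have hP' : ∀ x, x ∈ P ↔ (-Θ) x = -x := fun x => by rw [hP, LinearMap.neg_apply, neg_inj]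
  have hQP : ∀ q ∈ Q, ∀ p ∈ P, s q p = 0 := fun q hq p hp => by rw [hsymm, hPQ p hp q hq, map_zero]
  have hΘC' : (-Θ) * C = C := by rw [neg_mul, hΘC, neg_neg]
  have hCΘ' : C * (-Θ) = -C := by rw [mul_neg, hCΘ]
  have hS' : ∀ B' ∈ 𝔊, (-Θ) * B' = B' → B' * (-Θ) = -B' → Module.finrank ℂ (LinearMap.range B') = 0 ∨ Module.finrank ℂ (LinearMap.range B') = 5 ∨ Module.finrank ℂ (LinearMap.range B') = 8 := by
    intro B' hB' h1 h2
    obtain ⟨C', hC', hB'C'⟩ := hadj B' hB'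
    obtain ⟨hΘC'', hC''Θ⟩ := UnitaryTwoOdd.lower_of_adjoint hadd hsymm hnΘΘ hQ' hP' hQP hdefQ hdefP h1 h2 hB'C'
    have h1' : Θ * B' = -B' := by rw [neg_mul, neg_eq_iff_eq_neg] at h1; exact h1
    rw [neg_mul, neg_inj] at hΘC''
    rw [mul_neg, neg_eq_iff_eq_neg] at hC''Θ
    have hrk' : Module.finrank ℂ (LinearMap.range B') = Module.finrank ℂ (LinearMap.range C') :=
      UnitaryAdjointRank.finrank_range_eq hadd hsymm hB'C'
        (fun v h => hdefQ _ ((hQ _).2 (by rw [← Module.End.mul_apply, h1', LinearMap.neg_apply])) h)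
        (fun w h => hdefP _ ((hP _).2 (by rw [← Module.End.mul_apply, hΘC''])) h)
    have h := hS C' hC' hΘC'' hC''Θ
    rw [← hrk'] at h
    exact h
  exact UnitaryEighteenSixtyFive.subEightTen_ranks5_8_min5 hbr hirr hnΘ hnΘΘ hQ' hP' hQ8 hP10 hadd hsmul hsymm hQP hdefQ hdefP hadj hS' hC hΘC' hCΘ'
    (by rw [hrk, hr])

/-- Sub-Levi configuration for the `(18 | 65)` cell: a `Θ`-algebra of type `(8 | 10)` whose non-zero raising ranks are all `8` is impossible (the full-rank chain would give `8 ∣ 10`). [cite: Ribet1983, Thm. 3] [cite: Gordon1997, Thm. 6.3 (3)]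
[cite: Deligne1982HodgeCycles, I §3 Prop. 3.4, 3.6] [cite: GoodmanWallachGTM255, §4.1.1] -/
theorem UnitaryEighteenSixtyFive.subEightTen_rank8 [FiniteDimensional ℂ W] {𝔊 : Submodule ℂ (Module.End ℂ W)}
    (hbr : ∀ Y ∈ 𝔊, ∀ Z ∈ 𝔊, Y * Z - Z * Y ∈ 𝔊)
    (hirr : ∀ U : Submodule ℂ W, (∀ A ∈ 𝔊, ∀ u ∈ U, A u ∈ U) → U = ⊥ ∨ U = ⊤)
    {Θ : Module.End ℂ W} (hΘ : Θ ∈ 𝔊) (hΘΘ : Θ * Θ = 1)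
    {P Q : Submodule ℂ W} (hP : ∀ x, x ∈ P ↔ Θ x = x) (hQ : ∀ x, x ∈ Q ↔ Θ x = -x)
    (hP8 : Module.finrank ℂ P = 8) (hQ10 : Module.finrank ℂ Q = 10)
    {s : W → W → ℂ} (hadd : ∀ x y z, s (x + y) z = s x z + s y z)
    (hsmul : ∀ (c : ℂ) (x y : W), s (c • x) y = c * s x y) (hsymm : ∀ x y, s y x = starRingEnd ℂ (s x y))
    (hPQ : ∀ p ∈ P, ∀ q ∈ Q, s p q = 0) (hdefP : ∀ p ∈ P, s p p = 0 → p = 0) (hdefQ : ∀ q ∈ Q, s q q = 0 → q = 0)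
    (hadj : ∀ X ∈ 𝔊, ∃ Y ∈ 𝔊, ∀ x y, s (X x) y = s x (Y y))
    (hS : ∀ B' ∈ 𝔊, Θ * B' = B' → B' * Θ = -B' →
      Module.finrank ℂ (LinearMap.range B') = 0 ∨ Module.finrank ℂ (LinearMap.range B') = 8)
    {B : Module.End ℂ W} (hB : B ∈ 𝔊) (hΘB : Θ * B = B) (hBΘ : B * Θ = -B)
    (hr : Module.finrank ℂ (LinearMap.range B) = 8) : False := by
  classical
  have hsU : ∀ U : Submodule ℂ W, ∀ x y z : U, s ((x + y : U) : W) z = s (x : W) z + s (y : W) z :=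
    fun U x y z => by simp only [Submodule.coe_add, hadd]
  have hsmU : ∀ U : Submodule ℂ W, ∀ (c : ℂ) (x y : U), s ((c • x : U) : W) y = c * s (x : W) y :=
    fun U c x y => by simp only [Submodule.coe_smul, hsmul]
  have hSa : ∀ Y ∈ 𝔊, Θ * Y = Y → Y * Θ = -Y → Y ≠ 0 → Module.finrank ℂ (LinearMap.range Y) = 8 := by
    intro Y hY hΘY hYΘ hY0
    have h0 : Module.finrank ℂ (LinearMap.range Y) ≠ 0 := fun h => hY0 (LinearMap.range_eq_bot.1 (Submodule.finrank_eq_zero.1 h))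
    rcases hS Y hY hΘY hYΘ with h | h <;> omega
  have hB0 : B ≠ 0 := fun h => by rw [h, LinearMap.range_zero, finrank_bot] at hr; omega
  have hdvd := UnitaryConstantRank.dvd_of_rank_eq_finrank 10 hbr hirr hΘ hΘΘ hP hQ (by omega) hP8 hQ10 hadd hsymm hPQ
    hdefP hdefQ hadj hSa ⟨B, hB, hΘB, hBΘ, hB0⟩
  omega

/-- Sub-Levi configuration for the `(18 | 65)` cell: a `Θ`-algebra of type `(10 | 8)` whose non-zero raising ranks are all `8` is impossible (apply the `(8 | 10)` configuration to `−Θ` (adjoints have equal rank): the full-rank chain would give `8 ∣ 10`). [cite: Ribet1983, Thm. 3] [cite: Gordon1997, Thm. 6.3 (3)]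
[cite: Deligne1982HodgeCycles, I §3 Prop. 3.4, 3.6] [cite: GoodmanWallachGTM255, §4.1.1] -/
theorem UnitaryEighteenSixtyFive.subTenEight_rank8 [FiniteDimensional ℂ W] {𝔊 : Submodule ℂ (Module.End ℂ W)}
    (hbr : ∀ Y ∈ 𝔊, ∀ Z ∈ 𝔊, Y * Z - Z * Y ∈ 𝔊)
    (hirr : ∀ U : Submodule ℂ W, (∀ A ∈ 𝔊, ∀ u ∈ U, A u ∈ U) → U = ⊥ ∨ U = ⊤)
    {Θ : Module.End ℂ W} (hΘ : Θ ∈ 𝔊) (hΘΘ : Θ * Θ = 1)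
    {P Q : Submodule ℂ W} (hP : ∀ x, x ∈ P ↔ Θ x = x) (hQ : ∀ x, x ∈ Q ↔ Θ x = -x)
    (hP10 : Module.finrank ℂ P = 10) (hQ8 : Module.finrank ℂ Q = 8)
    {s : W → W → ℂ} (hadd : ∀ x y z, s (x + y) z = s x z + s y z)
    (hsmul : ∀ (c : ℂ) (x y : W), s (c • x) y = c * s x y) (hsymm : ∀ x y, s y x = starRingEnd ℂ (s x y))
    (hPQ : ∀ p ∈ P, ∀ q ∈ Q, s p q = 0) (hdefP : ∀ p ∈ P, s p p = 0 → p = 0) (hdefQ : ∀ q ∈ Q, s q q = 0 → q = 0)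
    (hadj : ∀ X ∈ 𝔊, ∃ Y ∈ 𝔊, ∀ x y, s (X x) y = s x (Y y))
    (hS : ∀ B' ∈ 𝔊, Θ * B' = B' → B' * Θ = -B' →
      Module.finrank ℂ (LinearMap.range B') = 0 ∨ Module.finrank ℂ (LinearMap.range B') = 8)
    {B : Module.End ℂ W} (hB : B ∈ 𝔊) (hΘB : Θ * B = B) (hBΘ : B * Θ = -B)
    (hr : Module.finrank ℂ (LinearMap.range B) = 8) : False := by
  classical
  have hsU : ∀ U : Submodule ℂ W, ∀ x y z : U, s ((x + y : U) : W) z = s (x : W) z + s (y : W) z :=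
    fun U x y z => by simp only [Submodule.coe_add, hadd]
  have hsmU : ∀ U : Submodule ℂ W, ∀ (c : ℂ) (x y : U), s ((c • x : U) : W) y = c * s (x : W) y :=
    fun U c x y => by simp only [Submodule.coe_smul, hsmul]
  obtain ⟨C, hC, hBC⟩ := hadj B hB
  obtain ⟨hΘC, hCΘ⟩ := UnitaryTwoOdd.lower_of_adjoint hadd hsymm hΘΘ hP hQ hPQ hdefP hdefQ hΘB hBΘ hBC
  have hraise : ∀ v, B v ∈ P := fun v => (hP _).2 (by rw [← Module.End.mul_apply, hΘB])
  have hlower : ∀ w, C w ∈ Q := fun w => (hQ _).2 (by rw [← Module.End.mul_apply, hΘC, LinearMap.neg_apply])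
  have hrk : Module.finrank ℂ (LinearMap.range C) = Module.finrank ℂ (LinearMap.range B) :=
    (UnitaryAdjointRank.finrank_range_eq hadd hsymm hBC (fun v h => hdefP _ (hraise v) h)
      (fun w h => hdefQ _ (hlower w) h)).symm
  have hnΘ : -Θ ∈ 𝔊 := Submodule.neg_mem _ hΘ
  have hnΘΘ : (-Θ) * (-Θ) = 1 := by rw [neg_mul_neg, hΘΘ]
  have hQ' : ∀ x, x ∈ Q ↔ (-Θ) x = x := fun x => by rw [hQ, LinearMap.neg_apply, neg_eq_iff_eq_neg]
  have hP' : ∀ x, x ∈ P ↔ (-Θ) x = -x := fun x => by rw [hP, LinearMap.neg_apply, neg_inj]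
  have hQP : ∀ q ∈ Q, ∀ p ∈ P, s q p = 0 := fun q hq p hp => by rw [hsymm, hPQ p hp q hq, map_zero]
  have hΘC' : (-Θ) * C = C := by rw [neg_mul, hΘC, neg_neg]
  have hCΘ' : C * (-Θ) = -C := by rw [mul_neg, hCΘ]
  have hS' : ∀ B' ∈ 𝔊, (-Θ) * B' = B' → B' * (-Θ) = -B' → Module.finrank ℂ (LinearMap.range B') = 0 ∨ Module.finrank ℂ (LinearMap.range B') = 8 := by
    intro B' hB' h1 h2
    obtain ⟨C', hC', hB'C'⟩ := hadj B' hB'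
    obtain ⟨hΘC'', hC''Θ⟩ := UnitaryTwoOdd.lower_of_adjoint hadd hsymm hnΘΘ hQ' hP' hQP hdefQ hdefP h1 h2 hB'C'
    have h1' : Θ * B' = -B' := by rw [neg_mul, neg_eq_iff_eq_neg] at h1; exact h1
    rw [neg_mul, neg_inj] at hΘC''
    rw [mul_neg, neg_eq_iff_eq_neg] at hC''Θ
    have hrk' : Module.finrank ℂ (LinearMap.range B') = Module.finrank ℂ (LinearMap.range C') :=
      UnitaryAdjointRank.finrank_range_eq hadd hsymm hB'C'
        (fun v h => hdefQ _ ((hQ _).2 (by rw [← Module.End.mul_apply, h1', LinearMap.neg_apply])) h)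
        (fun w h => hdefP _ ((hP _).2 (by rw [← Module.End.mul_apply, hΘC''])) h)
    have h := hS C' hC' hΘC'' hC''Θ
    rw [← hrk'] at h
    exact h
  exact UnitaryEighteenSixtyFive.subEightTen_rank8 hbr hirr hnΘ hnΘΘ hQ' hP' hQ8 hP10 hadd hsmul hsymm hQP hdefQ hdefP hadj hS' hC hΘC' hCΘ'
    (by rw [hrk, hr])

/-- Sub-Levi configuration for the `(18 | 65)` cell: a `Θ`-algebra of type `(9 | 56)` whose raising ranks lie in `{0, 2, 4, 6, 7, 8, 9}` with a raising of minimal non-zero rank `2` is impossible (`L⁺` of type `(7 | 2)` is full and a lift with `i = 1` has `j ∈ {1}`, killed in `L⁻` (type `(2 | 54)`)). [cite: Ribet1983, Thm. 3] [cite: Gordon1997, Thm. 6.3 (3)]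
[cite: Deligne1982HodgeCycles, I §3 Prop. 3.4, 3.6] [cite: GoodmanWallachGTM255, §4.1.1] -/
theorem UnitaryEighteenSixtyFive.subNineFiftySix_ranks2_4_6_7_8_9_min2 [FiniteDimensional ℂ W] {𝔊 : Submodule ℂ (Module.End ℂ W)}
    (hbr : ∀ Y ∈ 𝔊, ∀ Z ∈ 𝔊, Y * Z - Z * Y ∈ 𝔊)
    (hirr : ∀ U : Submodule ℂ W, (∀ A ∈ 𝔊, ∀ u ∈ U, A u ∈ U) → U = ⊥ ∨ U = ⊤)
    {Θ : Module.End ℂ W} (hΘ : Θ ∈ 𝔊) (hΘΘ : Θ * Θ = 1)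
    {P Q : Submodule ℂ W} (hP : ∀ x, x ∈ P ↔ Θ x = x) (hQ : ∀ x, x ∈ Q ↔ Θ x = -x)
    (hP9 : Module.finrank ℂ P = 9) (hQ56 : Module.finrank ℂ Q = 56)
    {s : W → W → ℂ} (hadd : ∀ x y z, s (x + y) z = s x z + s y z)
    (hsmul : ∀ (c : ℂ) (x y : W), s (c • x) y = c * s x y) (hsymm : ∀ x y, s y x = starRingEnd ℂ (s x y))
    (hPQ : ∀ p ∈ P, ∀ q ∈ Q, s p q = 0) (hdefP : ∀ p ∈ P, s p p = 0 → p = 0) (hdefQ : ∀ q ∈ Q, s q q = 0 → q = 0)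
    (hadj : ∀ X ∈ 𝔊, ∃ Y ∈ 𝔊, ∀ x y, s (X x) y = s x (Y y))
    (hS : ∀ B' ∈ 𝔊, Θ * B' = B' → B' * Θ = -B' →
      Module.finrank ℂ (LinearMap.range B') = 0 ∨ Module.finrank ℂ (LinearMap.range B') = 2 ∨ Module.finrank ℂ (LinearMap.range B') = 4 ∨ Module.finrank ℂ (LinearMap.range B') = 6 ∨ Module.finrank ℂ (LinearMap.range B') = 7 ∨ Module.finrank ℂ (LinearMap.range B') = 8 ∨ Module.finrank ℂ (LinearMap.range B') = 9)
    {B : Module.End ℂ W} (hB : B ∈ 𝔊) (hΘB : Θ * B = B) (hBΘ : B * Θ = -B)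
    (hr : Module.finrank ℂ (LinearMap.range B) = 2) : False := by
  classical
  have hsU : ∀ U : Submodule ℂ W, ∀ x y z : U, s ((x + y : U) : W) z = s (x : W) z + s (y : W) z :=
    fun U x y z => by simp only [Submodule.coe_add, hadd]
  have hsmU : ∀ U : Submodule ℂ W, ∀ (c : ℂ) (x y : U), s ((c • x : U) : W) y = c * s (x : W) y :=
    fun U c x y => by simp only [Submodule.coe_smul, hsmul]
  have hno1 : ∀ B' ∈ 𝔊, Θ * B' = B' → B' * Θ = -B' → Module.finrank ℂ (LinearMap.range B') ≠ 1 := by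
    intro B' hB' hΘB' hB'Θ h1
    rcases hS B' hB' hΘB' hB'Θ with h | h | h | h | h | h | h <;> omega
  have hmin : ∀ Y ∈ 𝔊, Θ * Y = Y → Y * Θ = -Y → Y ≠ 0 → 2 ≤ Module.finrank ℂ (LinearMap.range Y) := by
    intro Y hY hΘY hYΘ hY0
    have h0 : Module.finrank ℂ (LinearMap.range Y) ≠ 0 := fun h =>
      hY0 (LinearMap.range_eq_bot.1 (Submodule.finrank_eq_zero.1 h))
    rcases hS Y hY hΘY hYΘ with h | h | h | h | h | h | h <;> omega
  have hmin' : ∀ Z ∈ 𝔊, Θ * Z = Z → Z * Θ = -Z → Z ≠ 0 → Module.finrank ℂ (LinearMap.range B) ≤ Module.finrank ℂ (LinearMap.range Z) := by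
    rw [hr]; exact hmin
  obtain ⟨ι, Um, Up, PU, QU, Lm, ιm, Pm, Qm, Lp, ιp, Pp, Qp, hιmem, hιι, hιΘ, hιs, hUm, hUp, hfinUm, hfinUp,
    hPM, hQM, hPU, hQU, hrangeP, hPUP, hQUQ, hfinQM, hfinPU, hfinQU, hLm, hLp,
    hιmapply, hPmmem, hQmmem, hbrLm, hirrLm, hιmmem, hιmιm, hPm, hQm, hfinPm, hfinQm, hPmQm, hdefPm, hdefQm, hadjLm,
    hιpapply, hPpmem, hQpmem, hbrLp, hirrLp, hιpmem, hιpιp, hPp, hQp, hfinPp, hfinQp, hPpQp, hdefPp, hdefQp, hadjLp,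
    hsplit⟩ :=
    UnitaryLeviSetup.exists_levi_pair hbr hirr hΘ hΘΘ hP hQ hadd hsymm hPQ hdefP hdefQ hadj hB hΘB hBΘ
  have hdich : ∀ X ∈ 𝔊, Θ * X = X → X * Θ = -X → X * ι = ι * X →
      Module.finrank ℂ (Up.map X) + Module.finrank ℂ (Um.map X) ≤ Module.finrank ℂ (LinearMap.range B) ∨
        (2 ≤ Module.finrank ℂ (Up.map X) ∧ 2 ≤ Module.finrank ℂ (Um.map X)) := fun X hX hΘX hXΘ hXc =>
    UnitaryLeviSetup.profile_dichotomy hbr hΘΘ hP hQ hadd hsymm hPQ hdefP hdefQ hadj hmin hB hΘB hBΘ hιι hιΘ hιs hUm hUp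
      hPM hQM hQU hfinQU hrangeP hX hΘX hXΘ hXc
  have hfinQU' := hfinQU
  rw [hr] at hfinQM hfinPU hfinQU hfinPm hfinQm hfinPp hfinQp hsplit hdich
  rw [hQ56] at hfinQM hfinQm hfinUm
  rw [hP9] at hfinPU hfinPp hfinUp
  have hcm : ∀ Z : Module.End ℂ W, Z * ι = ι * Z → ∀ x ∈ Um, Z x ∈ Um := fun Z hZ x hx =>
    (hUm _).2 (by rw [← Module.End.mul_apply, ← hZ, Module.End.mul_apply, (hUm x).1 hx, map_neg])
  have hcp : ∀ Z : Module.End ℂ W, Z * ι = ι * Z → ∀ x ∈ Up, Z x ∈ Up := fun Z hZ x hx =>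
    (hUp _).2 (by rw [← Module.End.mul_apply, ← hZ, Module.End.mul_apply, (hUp x).1 hx])
  have hfullm_of : Lm = ⊤ → False := fun h =>
    UnitaryLeviSetup.false_of_full_larger hbr hΘΘ hno1 hιι hιΘ hUm hUp (by omega) (by omega) hPM hQM (by omega)
      (by omega) hLm h
  have hkillm1 : ∀ X ∈ 𝔊, Θ * X = X → X * Θ = -X → X * ι = ι * X → Module.finrank ℂ (Um.map X) ≠ 1 := by
    intro X hX hΘX hXΘ hXc h1
    obtain ⟨hxmem, hιmx, hxιm, hxrk⟩ := UnitaryLeviSetup.restrict_mem hcm hLm hιmapply X hX hΘX hXΘ hXc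
    rw [h1] at hxrk
    exact hfullm_of (UnitaryRankOneRaise.eq_top_of_rankOne_raise_two hbrLm hirrLm hιmmem hιmιm hPm hQm
      (s := fun v w : Um => s (v : W) w) (hsU Um) (fun v w => hsymm v w) hPmQm hdefPm hdefQm hadjLm hxmem hιmx hxιm
      hxrk (by omega) (by omega))
  have hLptop : Lp = ⊤ :=
    UnitaryTwoOdd.eq_top' hbrLp hirrLp hιpmem hιpιp hPp hQp ⟨3, by omega⟩ (by omega) (s := fun x y : Up => s (x : W) y) (fun x y z => by simp only [Submodule.coe_add, hadd]) (fun x y => hsymm _ _) hPpQp hdefPp hdefQp hadjLp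
  obtain ⟨T1, hιT1, hT1ι, hT1r⟩ := UnitaryRaisingSpace.exists_raise_finrank_range_eq hιpιp hPp hQp (k := 1)
    (by omega) (by omega)
  obtain ⟨X1, hX1, hΘX1, hX1Θ, hX1c, hX1Up⟩ := UnitaryLeviSetup.exists_lift hbr hΘ hΘΘ hcp hιΘ hLp hιpapply T1
    (by rw [hLptop]; exact Submodule.mem_top) hιT1 hT1ι
  rw [hT1r] at hX1Up
  obtain ⟨hs1, hi1, hi1', hj1, hj1'⟩ := hsplit X1 hΘX1 hX1Θ hX1c
  have hrk1 := hS X1 hX1 hΘX1 hX1Θ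
  have hd1 := hdich X1 hX1 hΘX1 hX1Θ hX1c
  rw [hs1] at hrk1
  rw [hX1Up] at hrk1 hd1
  have hk_hkillm1 := hkillm1 X1 hX1 hΘX1 hX1Θ hX1c
  omega

/-- Sub-Levi configuration for the `(18 | 65)` cell: a `Θ`-algebra of type `(9 | 56)` whose raising ranks lie in `{0, 4, 6, 7, 8, 9}` with a raising of minimal non-zero rank `4` is impossible (`L⁺` of type `(5 | 4)` is full and a lift with `i = 1` has `j ∈ {3}`, killed in `L⁻` (type `(4 | 52)`)). [cite: Ribet1983, Thm. 3] [cite: Gordon1997, Thm. 6.3 (3)]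
[cite: Deligne1982HodgeCycles, I §3 Prop. 3.4, 3.6] [cite: GoodmanWallachGTM255, §4.1.1] -/
theorem UnitaryEighteenSixtyFive.subNineFiftySix_ranks4_6_7_8_9_min4 [FiniteDimensional ℂ W] {𝔊 : Submodule ℂ (Module.End ℂ W)}
    (hbr : ∀ Y ∈ 𝔊, ∀ Z ∈ 𝔊, Y * Z - Z * Y ∈ 𝔊)
    (hirr : ∀ U : Submodule ℂ W, (∀ A ∈ 𝔊, ∀ u ∈ U, A u ∈ U) → U = ⊥ ∨ U = ⊤)
    {Θ : Module.End ℂ W} (hΘ : Θ ∈ 𝔊) (hΘΘ : Θ * Θ = 1)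
    {P Q : Submodule ℂ W} (hP : ∀ x, x ∈ P ↔ Θ x = x) (hQ : ∀ x, x ∈ Q ↔ Θ x = -x)
    (hP9 : Module.finrank ℂ P = 9) (hQ56 : Module.finrank ℂ Q = 56)
    {s : W → W → ℂ} (hadd : ∀ x y z, s (x + y) z = s x z + s y z)
    (hsmul : ∀ (c : ℂ) (x y : W), s (c • x) y = c * s x y) (hsymm : ∀ x y, s y x = starRingEnd ℂ (s x y))
    (hPQ : ∀ p ∈ P, ∀ q ∈ Q, s p q = 0) (hdefP : ∀ p ∈ P, s p p = 0 → p = 0) (hdefQ : ∀ q ∈ Q, s q q = 0 → q = 0)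
    (hadj : ∀ X ∈ 𝔊, ∃ Y ∈ 𝔊, ∀ x y, s (X x) y = s x (Y y))
    (hS : ∀ B' ∈ 𝔊, Θ * B' = B' → B' * Θ = -B' →
      Module.finrank ℂ (LinearMap.range B') = 0 ∨ Module.finrank ℂ (LinearMap.range B') = 4 ∨ Module.finrank ℂ (LinearMap.range B') = 6 ∨ Module.finrank ℂ (LinearMap.range B') = 7 ∨ Module.finrank ℂ (LinearMap.range B') = 8 ∨ Module.finrank ℂ (LinearMap.range B') = 9)
    {B : Module.End ℂ W} (hB : B ∈ 𝔊) (hΘB : Θ * B = B) (hBΘ : B * Θ = -B)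
    (hr : Module.finrank ℂ (LinearMap.range B) = 4) : False := by
  classical
  have hsU : ∀ U : Submodule ℂ W, ∀ x y z : U, s ((x + y : U) : W) z = s (x : W) z + s (y : W) z :=
    fun U x y z => by simp only [Submodule.coe_add, hadd]
  have hsmU : ∀ U : Submodule ℂ W, ∀ (c : ℂ) (x y : U), s ((c • x : U) : W) y = c * s (x : W) y :=
    fun U c x y => by simp only [Submodule.coe_smul, hsmul]
  have hno1 : ∀ B' ∈ 𝔊, Θ * B' = B' → B' * Θ = -B' → Module.finrank ℂ (LinearMap.range B') ≠ 1 := by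
    intro B' hB' hΘB' hB'Θ h1
    rcases hS B' hB' hΘB' hB'Θ with h | h | h | h | h | h <;> omega
  have hmin : ∀ Y ∈ 𝔊, Θ * Y = Y → Y * Θ = -Y → Y ≠ 0 → 4 ≤ Module.finrank ℂ (LinearMap.range Y) := by
    intro Y hY hΘY hYΘ hY0
    have h0 : Module.finrank ℂ (LinearMap.range Y) ≠ 0 := fun h =>
      hY0 (LinearMap.range_eq_bot.1 (Submodule.finrank_eq_zero.1 h))
    rcases hS Y hY hΘY hYΘ with h | h | h | h | h | h <;> omega
  have hmin' : ∀ Z ∈ 𝔊, Θ * Z = Z → Z * Θ = -Z → Z ≠ 0 → Module.finrank ℂ (LinearMap.range B) ≤ Module.finrank ℂ (LinearMap.range Z) := by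
    rw [hr]; exact hmin
  obtain ⟨ι, Um, Up, PU, QU, Lm, ιm, Pm, Qm, Lp, ιp, Pp, Qp, hιmem, hιι, hιΘ, hιs, hUm, hUp, hfinUm, hfinUp,
    hPM, hQM, hPU, hQU, hrangeP, hPUP, hQUQ, hfinQM, hfinPU, hfinQU, hLm, hLp,
    hιmapply, hPmmem, hQmmem, hbrLm, hirrLm, hιmmem, hιmιm, hPm, hQm, hfinPm, hfinQm, hPmQm, hdefPm, hdefQm, hadjLm,
    hιpapply, hPpmem, hQpmem, hbrLp, hirrLp, hιpmem, hιpιp, hPp, hQp, hfinPp, hfinQp, hPpQp, hdefPp, hdefQp, hadjLp,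
    hsplit⟩ :=
    UnitaryLeviSetup.exists_levi_pair hbr hirr hΘ hΘΘ hP hQ hadd hsymm hPQ hdefP hdefQ hadj hB hΘB hBΘ
  have hdich : ∀ X ∈ 𝔊, Θ * X = X → X * Θ = -X → X * ι = ι * X →
      Module.finrank ℂ (Up.map X) + Module.finrank ℂ (Um.map X) ≤ Module.finrank ℂ (LinearMap.range B) ∨
        (4 ≤ Module.finrank ℂ (Up.map X) ∧ 4 ≤ Module.finrank ℂ (Um.map X)) := fun X hX hΘX hXΘ hXc =>
    UnitaryLeviSetup.profile_dichotomy hbr hΘΘ hP hQ hadd hsymm hPQ hdefP hdefQ hadj hmin hB hΘB hBΘ hιι hιΘ hιs hUm hUp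
      hPM hQM hQU hfinQU hrangeP hX hΘX hXΘ hXc
  have hfinQU' := hfinQU
  rw [hr] at hfinQM hfinPU hfinQU hfinPm hfinQm hfinPp hfinQp hsplit hdich
  rw [hQ56] at hfinQM hfinQm hfinUm
  rw [hP9] at hfinPU hfinPp hfinUp
  have hcm : ∀ Z : Module.End ℂ W, Z * ι = ι * Z → ∀ x ∈ Um, Z x ∈ Um := fun Z hZ x hx =>
    (hUm _).2 (by rw [← Module.End.mul_apply, ← hZ, Module.End.mul_apply, (hUm x).1 hx, map_neg])
  have hcp : ∀ Z : Module.End ℂ W, Z * ι = ι * Z → ∀ x ∈ Up, Z x ∈ Up := fun Z hZ x hx =>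
    (hUp _).2 (by rw [← Module.End.mul_apply, ← hZ, Module.End.mul_apply, (hUp x).1 hx])
  have hfullm_of : Lm = ⊤ → False := fun h =>
    UnitaryLeviSetup.false_of_full_larger hbr hΘΘ hno1 hιι hιΘ hUm hUp (by omega) (by omega) hPM hQM (by omega)
      (by omega) hLm h
  have hkillm3 : ∀ X ∈ 𝔊, Θ * X = X → X * Θ = -X → X * ι = ι * X → Module.finrank ℂ (Um.map X) ≠ 3 := by
    intro X hX hΘX hXΘ hXc h3
    obtain ⟨hxmem, hιmx, hxιm, hxrk⟩ := UnitaryLeviSetup.restrict_mem hcm hLm hιmapply X hX hΘX hXΘ hXc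
    rw [h3] at hxrk
    refine hfullm_of (UnitaryDoubleLevi.eq_top_of_raise_of_core hbrLm hirrLm hιmmem hιmιm hPm hQm
      (s := fun v w : Um => s (v : W) w) (hsU Um) (fun v w => hsymm v w) hPmQm hdefPm hdefQm hadjLm hxmem hιmx hxιm
      (by rw [hxrk]; omega) (by omega) (by omega)
      fun U' 𝔩' ι' P' Q' hbr𝔩' hirr𝔩' hι' hι'ι' hP' hQ' hfinP' hfinQ' hP'Q' hdefP' hdefQ' hadj𝔩' => ?_)
    rw [hxrk] at hfinP' hfinQ'
    exact UnitaryThreeCoprime.eq_top hbr𝔩' hirr𝔩' hι' hι'ι' hP' hQ' hfinP' (by omega) (s := fun x y : U' => s ((x : Um) : W) y) (fun x y z => by simp only [Submodule.coe_add, hadd]) (fun x y => hsymm _ _) hP'Q' hdefP' hdefQ' hadj𝔩'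
  have hLptop : Lp = ⊤ :=
    UnitaryFourOdd.eq_top' hbrLp hirrLp hιpmem hιpιp hPp hQp ⟨2, by omega⟩ (by omega) (s := fun x y : Up => s (x : W) y) (fun x y z => by simp only [Submodule.coe_add, hadd]) (fun x y => hsymm _ _) hPpQp hdefPp hdefQp hadjLp
  obtain ⟨T1, hιT1, hT1ι, hT1r⟩ := UnitaryRaisingSpace.exists_raise_finrank_range_eq hιpιp hPp hQp (k := 1)
    (by omega) (by omega)
  obtain ⟨X1, hX1, hΘX1, hX1Θ, hX1c, hX1Up⟩ := UnitaryLeviSetup.exists_lift hbr hΘ hΘΘ hcp hιΘ hLp hιpapply T1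
    (by rw [hLptop]; exact Submodule.mem_top) hιT1 hT1ι
  rw [hT1r] at hX1Up
  obtain ⟨hs1, hi1, hi1', hj1, hj1'⟩ := hsplit X1 hΘX1 hX1Θ hX1c
  have hrk1 := hS X1 hX1 hΘX1 hX1Θ
  have hd1 := hdich X1 hX1 hΘX1 hX1Θ hX1c
  rw [hs1] at hrk1
  rw [hX1Up] at hrk1 hd1
  have hk_hkillm3 := hkillm3 X1 hX1 hΘX1 hX1Θ hX1c
  omega

/-- Sub-Levi configuration for the `(18 | 65)` cell: a `Θ`-algebra of type `(9 | 56)` whose raising ranks lie in `{0, 6, 7, 8, 9}` with a raising of minimal non-zero rank `6` is impossible (the non-zero profiles [(0, 6), (2, 4)] are pairwise exclusive, so constant; `(2, 4)`: TOOL C on `L⁺`). [cite: Ribet1983, Thm. 3] [cite: Gordon1997, Thm. 6.3 (3)]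
[cite: Deligne1982HodgeCycles, I §3 Prop. 3.4, 3.6] [cite: GoodmanWallachGTM255, §4.1.1] -/
theorem UnitaryEighteenSixtyFive.subNineFiftySix_ranks6_7_8_9_min6 [FiniteDimensional ℂ W] {𝔊 : Submodule ℂ (Module.End ℂ W)}
    (hbr : ∀ Y ∈ 𝔊, ∀ Z ∈ 𝔊, Y * Z - Z * Y ∈ 𝔊)
    (hirr : ∀ U : Submodule ℂ W, (∀ A ∈ 𝔊, ∀ u ∈ U, A u ∈ U) → U = ⊥ ∨ U = ⊤)
    {Θ : Module.End ℂ W} (hΘ : Θ ∈ 𝔊) (hΘΘ : Θ * Θ = 1)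
    {P Q : Submodule ℂ W} (hP : ∀ x, x ∈ P ↔ Θ x = x) (hQ : ∀ x, x ∈ Q ↔ Θ x = -x)
    (hP9 : Module.finrank ℂ P = 9) (hQ56 : Module.finrank ℂ Q = 56)
    {s : W → W → ℂ} (hadd : ∀ x y z, s (x + y) z = s x z + s y z)
    (hsmul : ∀ (c : ℂ) (x y : W), s (c • x) y = c * s x y) (hsymm : ∀ x y, s y x = starRingEnd ℂ (s x y))
    (hPQ : ∀ p ∈ P, ∀ q ∈ Q, s p q = 0) (hdefP : ∀ p ∈ P, s p p = 0 → p = 0) (hdefQ : ∀ q ∈ Q, s q q = 0 → q = 0)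
    (hadj : ∀ X ∈ 𝔊, ∃ Y ∈ 𝔊, ∀ x y, s (X x) y = s x (Y y))
    (hS : ∀ B' ∈ 𝔊, Θ * B' = B' → B' * Θ = -B' →
      Module.finrank ℂ (LinearMap.range B') = 0 ∨ Module.finrank ℂ (LinearMap.range B') = 6 ∨ Module.finrank ℂ (LinearMap.range B') = 7 ∨ Module.finrank ℂ (LinearMap.range B') = 8 ∨ Module.finrank ℂ (LinearMap.range B') = 9)
    {B : Module.End ℂ W} (hB : B ∈ 𝔊) (hΘB : Θ * B = B) (hBΘ : B * Θ = -B)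
    (hr : Module.finrank ℂ (LinearMap.range B) = 6) : False := by
  classical
  have hsU : ∀ U : Submodule ℂ W, ∀ x y z : U, s ((x + y : U) : W) z = s (x : W) z + s (y : W) z :=
    fun U x y z => by simp only [Submodule.coe_add, hadd]
  have hsmU : ∀ U : Submodule ℂ W, ∀ (c : ℂ) (x y : U), s ((c • x : U) : W) y = c * s (x : W) y :=
    fun U c x y => by simp only [Submodule.coe_smul, hsmul]
  have hno1 : ∀ B' ∈ 𝔊, Θ * B' = B' → B' * Θ = -B' → Module.finrank ℂ (LinearMap.range B') ≠ 1 := by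
    intro B' hB' hΘB' hB'Θ h1
    rcases hS B' hB' hΘB' hB'Θ with h | h | h | h | h <;> omega
  have hmin : ∀ Y ∈ 𝔊, Θ * Y = Y → Y * Θ = -Y → Y ≠ 0 → 6 ≤ Module.finrank ℂ (LinearMap.range Y) := by
    intro Y hY hΘY hYΘ hY0
    have h0 : Module.finrank ℂ (LinearMap.range Y) ≠ 0 := fun h =>
      hY0 (LinearMap.range_eq_bot.1 (Submodule.finrank_eq_zero.1 h))
    rcases hS Y hY hΘY hYΘ with h | h | h | h | h <;> omega
  have hmin' : ∀ Z ∈ 𝔊, Θ * Z = Z → Z * Θ = -Z → Z ≠ 0 → Module.finrank ℂ (LinearMap.range B) ≤ Module.finrank ℂ (LinearMap.range Z) := by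
    rw [hr]; exact hmin
  obtain ⟨ι, Um, Up, PU, QU, Lm, ιm, Pm, Qm, Lp, ιp, Pp, Qp, hιmem, hιι, hιΘ, hιs, hUm, hUp, hfinUm, hfinUp,
    hPM, hQM, hPU, hQU, hrangeP, hPUP, hQUQ, hfinQM, hfinPU, hfinQU, hLm, hLp,
    hιmapply, hPmmem, hQmmem, hbrLm, hirrLm, hιmmem, hιmιm, hPm, hQm, hfinPm, hfinQm, hPmQm, hdefPm, hdefQm, hadjLm,
    hιpapply, hPpmem, hQpmem, hbrLp, hirrLp, hιpmem, hιpιp, hPp, hQp, hfinPp, hfinQp, hPpQp, hdefPp, hdefQp, hadjLp,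
    hsplit⟩ :=
    UnitaryLeviSetup.exists_levi_pair hbr hirr hΘ hΘΘ hP hQ hadd hsymm hPQ hdefP hdefQ hadj hB hΘB hBΘ
  have hdich : ∀ X ∈ 𝔊, Θ * X = X → X * Θ = -X → X * ι = ι * X →
      Module.finrank ℂ (Up.map X) + Module.finrank ℂ (Um.map X) ≤ Module.finrank ℂ (LinearMap.range B) ∨
        (6 ≤ Module.finrank ℂ (Up.map X) ∧ 6 ≤ Module.finrank ℂ (Um.map X)) := fun X hX hΘX hXΘ hXc =>
    UnitaryLeviSetup.profile_dichotomy hbr hΘΘ hP hQ hadd hsymm hPQ hdefP hdefQ hadj hmin hB hΘB hBΘ hιι hιΘ hιs hUm hUp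
      hPM hQM hQU hfinQU hrangeP hX hΘX hXΘ hXc
  have hfinQU' := hfinQU
  rw [hr] at hfinQM hfinPU hfinQU hfinPm hfinQm hfinPp hfinQp hsplit hdich
  rw [hQ56] at hfinQM hfinQm hfinUm
  rw [hP9] at hfinPU hfinPp hfinUp
  have hcm : ∀ Z : Module.End ℂ W, Z * ι = ι * Z → ∀ x ∈ Um, Z x ∈ Um := fun Z hZ x hx =>
    (hUm _).2 (by rw [← Module.End.mul_apply, ← hZ, Module.End.mul_apply, (hUm x).1 hx, map_neg])
  have hcp : ∀ Z : Module.End ℂ W, Z * ι = ι * Z → ∀ x ∈ Up, Z x ∈ Up := fun Z hZ x hx =>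
    (hUp _).2 (by rw [← Module.End.mul_apply, ← hZ, Module.End.mul_apply, (hUp x).1 hx])
  have hfullm_of : Lm = ⊤ → False := fun h =>
    UnitaryLeviSetup.false_of_full_larger hbr hΘΘ hno1 hιι hιΘ hUm hUp (by omega) (by omega) hPM hQM (by omega)
      (by omega) hLm h
  have hkillm3 : ∀ X ∈ 𝔊, Θ * X = X → X * Θ = -X → X * ι = ι * X → Module.finrank ℂ (Um.map X) ≠ 3 := by
    intro X hX hΘX hXΘ hXc h3
    obtain ⟨hxmem, hιmx, hxιm, hxrk⟩ := UnitaryLeviSetup.restrict_mem hcm hLm hιmapply X hX hΘX hXΘ hXc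
    rw [h3] at hxrk
    refine hfullm_of (UnitaryDoubleLevi.eq_top_of_raise_of_core hbrLm hirrLm hιmmem hιmιm hPm hQm
      (s := fun v w : Um => s (v : W) w) (hsU Um) (fun v w => hsymm v w) hPmQm hdefPm hdefQm hadjLm hxmem hιmx hxιm
      (by rw [hxrk]; omega) (by omega) (by omega)
      fun U' 𝔩' ι' P' Q' hbr𝔩' hirr𝔩' hι' hι'ι' hP' hQ' hfinP' hfinQ' hP'Q' hdefP' hdefQ' hadj𝔩' => ?_)
    rw [hxrk] at hfinP' hfinQ'
    exact UnitaryThreeCoprime.eq_top hbr𝔩' hirr𝔩' hι' hι'ι' hP' hQ' hfinP' (by omega) (s := fun x y : U' => s ((x : Um) : W) y) (fun x y z => by simp only [Submodule.coe_add, hadd]) (fun x y => hsymm _ _) hP'Q' hdefP' hdefQ' hadj𝔩'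
  have hfullp_of : Lp = ⊤ → False := by
    intro hLptop
    obtain ⟨T3, hιT3, hT3ι, hT3r⟩ := UnitaryRaisingSpace.exists_raise_finrank_range_eq hιpιp hPp hQp (k := 3)
      (by omega) (by omega)
    obtain ⟨X3, hX3, hΘX3, hX3Θ, hX3c, hX3Up⟩ := UnitaryLeviSetup.exists_lift hbr hΘ hΘΘ hcp hιΘ hLp hιpapply T3
      (by rw [hLptop]; exact Submodule.mem_top) hιT3 hT3ι
    rw [hT3r] at hX3Up
    obtain ⟨hs3, hi3, hi3', hj3, hj3'⟩ := hsplit X3 hΘX3 hX3Θ hX3c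
    have hrk3 := hS X3 hX3 hΘX3 hX3Θ
    have hd3 := hdich X3 hX3 hΘX3 hX3Θ hX3c
    rw [hs3] at hrk3
    rw [hX3Up] at hrk3 hd3
    have hk_hkillm3 := hkillm3 X3 hX3 hΘX3 hX3Θ hX3c
    omega
  have hkillp1 : ∀ X ∈ 𝔊, Θ * X = X → X * Θ = -X → X * ι = ι * X → Module.finrank ℂ (Up.map X) ≠ 1 := by
    intro X hX hΘX hXΘ hXc h1
    obtain ⟨hymem, hιpy, hyιp, hyrk⟩ := UnitaryLeviSetup.restrict_mem hcp hLp hιpapply X hX hΘX hXΘ hXc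
    rw [h1] at hyrk
    exact hfullp_of (UnitaryRankOneRaise.eq_top_of_rankOne_raise hbrLp hirrLp hιpmem hιpιp hPp hQp
      (s := fun v w : Up => s (v : W) w) (hsU Up) (fun v w => hsymm v w) hPpQp hdefPp hdefQp hadjLp hymem hιpy hyιp
      hyrk (by omega) (by omega) (by omega))
  have hprof : ∀ X ∈ 𝔊, Θ * X = X → X * Θ = -X → X * ι = ι * X →
      (Module.finrank ℂ (Up.map X) = 0 ∧ Module.finrank ℂ (Um.map X) = 0) ∨
        (Module.finrank ℂ (Up.map X) = 0 ∧ Module.finrank ℂ (Um.map X) = 6) ∨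
        (Module.finrank ℂ (Up.map X) = 2 ∧ Module.finrank ℂ (Um.map X) = 4) := by
    intro X hX hΘX hXΘ hXc
    obtain ⟨hs, hi, hi', hj, hj'⟩ := hsplit X hΘX hXΘ hXc
    have hkillm3' := hkillm3 X hX hΘX hXΘ hXc
    have hkillp1' := hkillp1 X hX hΘX hXΘ hXc
    have hrk := hS X hX hΘX hXΘ
    have hd := hdich X hX hΘX hXΘ hXc
    rw [hs] at hrk
    generalize Module.finrank ℂ ↥(Submodule.map X Um) = jj at *
    have hjle : jj ≤ 6 := by omega
    interval_cases jj
    · exact Or.inl ⟨by omega, rfl⟩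
    · exfalso; omega
    · exfalso; omega
    · exact (hkillm3' rfl).elim
    · exact Or.inr (Or.inr (⟨by omega, rfl⟩))
    · exfalso; omega
    · exact Or.inr (Or.inl ⟨by omega, rfl⟩)
  obtain ⟨⟨p, hp⟩, hp0⟩ := Module.finrank_pos_iff_exists_ne_zero.1 (show 0 < Module.finrank ℂ PU by omega)
  obtain ⟨⟨q, hq⟩, hq0⟩ := Module.finrank_pos_iff_exists_ne_zero.1 (show 0 < Module.finrank ℂ QU by omega)
  obtain ⟨X₀, hX₀, hΘX₀, hX₀Θ, hX₀c, c₀, hιc₀, -, hX₀c0⟩ :=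
    UnitaryLeviFull.exists_raise_commute_apply_ne_zero hbr hirr hΘ hΘΘ hQ hιmem hιι hιΘ hUm hUp
      ⟨p, fun h => hp0 (Subtype.ext h), ((hPU p).1 hp).1, ((hPU p).1 hp).2⟩
      ⟨q, fun h => hq0 (Subtype.ext h), ((hQU q).1 hq).1, ((hQU q).1 hq).2⟩
  have hX₀i : Module.finrank ℂ (Up.map X₀) ≠ 0 := fun h0 => by
    have hmem : X₀ c₀ ∈ Up.map X₀ := Submodule.mem_map_of_mem ((hUp c₀).2 hιc₀)
    rw [Submodule.finrank_eq_zero.1 h0, Submodule.mem_bot] at hmem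
    exact hX₀c0 hmem
  have hnotboth : ∀ X ∈ 𝔊, Θ * X = X → X * Θ = -X → X * ι = ι * X → ∀ X' ∈ 𝔊, Θ * X' = X' → X' * Θ = -X' →
      X' * ι = ι * X' → 6 < Module.finrank ℂ (Up.map X') + Module.finrank ℂ (Um.map X) → False := by
    intro X hX hΘX hXΘ hXc X' hX' hΘX' hX'Θ hX'c hgt
    obtain ⟨c, hc1, hc2⟩ := UnitaryGenericRank.exists_finrank_le_and_finrank_le (X'.restrict (hcp X' hX'c))
      (X.restrict (hcp X hXc)) (X.restrict (hcm X hXc)) (X'.restrict (hcm X' hX'c))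
    obtain ⟨hX₁, hΘX₁, hX₁Θ, hX₁c⟩ := UnitaryLeviSetup.add_smul_raise X hX hΘX hXΘ hXc X' hX' hΘX' hX'Θ hX'c c
    have hi₁ := UnitaryLeviSetup.finrank_map_add_smul hcp X X' hXc hX'c c hX₁c
    have hj₁ := UnitaryLeviSetup.finrank_map_add_smul hcm X X' hXc hX'c c hX₁c
    rw [UnitaryLeviRank.finrank_range_restrict] at hc1 hc2
    have hp := hprof (X + c • X') hX₁ hΘX₁ hX₁Θ hX₁c
    rw [hi₁, hj₁] at hp
    omega
  have hzero : ∀ X ∈ 𝔊, Θ * X = X → X * Θ = -X → X * ι = ι * X → Module.finrank ℂ (Up.map X) = 0 → Module.finrank ℂ (Um.map X) = 0 → X = 0 := by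
    intro X hX hΘX hXΘ hXc hi hj
    obtain ⟨hs, -, -, -, -⟩ := hsplit X hΘX hXΘ hXc
    rw [hi, hj, add_zero] at hs
    exact LinearMap.range_eq_bot.1 (Submodule.finrank_eq_zero.1 hs)
  rcases hprof X₀ hX₀ hΘX₀ hX₀Θ hX₀c with ⟨h0i, h0j⟩ | ⟨h0i, h0j⟩ | ⟨h0i, h0j⟩
  · exact hX₀i h0i
  · exact hX₀i h0i
  · -- constant profile `(2, 4)`
    have hprofc : ∀ X ∈ 𝔊, Θ * X = X → X * Θ = -X → X * ι = ι * X → X ≠ 0 →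
        Module.finrank ℂ (Up.map X) = 2 ∧ Module.finrank ℂ (Um.map X) = 4 := by
      intro X hX hΘX hXΘ hXc hX0
      rcases hprof X hX hΘX hXΘ hXc with ⟨hi, hj⟩ | ⟨hi, hj⟩ | ⟨hi, hj⟩
      · exact (hX0 (hzero X hX hΘX hXΘ hXc hi hj)).elim
      · exact (hnotboth X hX hΘX hXΘ hXc X₀ hX₀ hΘX₀ hX₀Θ hX₀c (by omega)).elim
      · exact ⟨hi, hj⟩
    obtain ⟨A, hA, hιpA, hAιp, hAne, hA2⟩ :=
      UnitaryConstantRank.exists_raise_rank_ne_two hbrLp hirrLp hιpmem hιpιp hPp hQp (by omega) (by omega) (by omega)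
        (s := fun v w : Up => s (v : W) w) (hsU Up) (fun v w => hsymm v w) hPpQp hdefPp hdefQp hadjLp
    obtain ⟨XA, hXA, hΘXA, hXAΘ, hXAc, hXAUp⟩ := UnitaryLeviSetup.exists_lift hbr hΘ hΘΘ hcp hιΘ hLp hιpapply A hA hιpA hAιp
    have hA0 : Module.finrank ℂ (LinearMap.range A) ≠ 0 := fun h =>
      hAne (LinearMap.range_eq_bot.1 (Submodule.finrank_eq_zero.1 h))
    have hXA0 : XA ≠ 0 := fun h0 => hA0 (by rw [← hXAUp, h0, Submodule.map_zero, finrank_bot])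
    have hpA := hprofc XA hXA hΘXA hXAΘ hXAc hXA0
    rw [← hXAUp] at hA2
    omega

/-- Sub-Levi configuration for the `(18 | 65)` cell: a `Θ`-algebra of type `(9 | 56)` whose raising ranks lie in `{0, 7, 8, 9}` with a raising of minimal non-zero rank `7` is impossible (`L⁺` of type `(2 | 7)` is full and a lift with `i = 1` has `j ∈ {6}`, killed in `L⁻` (type `(7 | 49)`)). [cite: Ribet1983, Thm. 3] [cite: Gordon1997, Thm. 6.3 (3)]
[cite: Deligne1982HodgeCycles, I §3 Prop. 3.4, 3.6] [cite: GoodmanWallachGTM255, §4.1.1] -/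
theorem UnitaryEighteenSixtyFive.subNineFiftySix_ranks7_8_9_min7 [FiniteDimensional ℂ W] {𝔊 : Submodule ℂ (Module.End ℂ W)}
    (hbr : ∀ Y ∈ 𝔊, ∀ Z ∈ 𝔊, Y * Z - Z * Y ∈ 𝔊)
    (hirr : ∀ U : Submodule ℂ W, (∀ A ∈ 𝔊, ∀ u ∈ U, A u ∈ U) → U = ⊥ ∨ U = ⊤)
    {Θ : Module.End ℂ W} (hΘ : Θ ∈ 𝔊) (hΘΘ : Θ * Θ = 1)
    {P Q : Submodule ℂ W} (hP : ∀ x, x ∈ P ↔ Θ x = x) (hQ : ∀ x, x ∈ Q ↔ Θ x = -x)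
    (hP9 : Module.finrank ℂ P = 9) (hQ56 : Module.finrank ℂ Q = 56)
    {s : W → W → ℂ} (hadd : ∀ x y z, s (x + y) z = s x z + s y z)
    (hsmul : ∀ (c : ℂ) (x y : W), s (c • x) y = c * s x y) (hsymm : ∀ x y, s y x = starRingEnd ℂ (s x y))
    (hPQ : ∀ p ∈ P, ∀ q ∈ Q, s p q = 0) (hdefP : ∀ p ∈ P, s p p = 0 → p = 0) (hdefQ : ∀ q ∈ Q, s q q = 0 → q = 0)
    (hadj : ∀ X ∈ 𝔊, ∃ Y ∈ 𝔊, ∀ x y, s (X x) y = s x (Y y))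
    (hS : ∀ B' ∈ 𝔊, Θ * B' = B' → B' * Θ = -B' →
      Module.finrank ℂ (LinearMap.range B') = 0 ∨ Module.finrank ℂ (LinearMap.range B') = 7 ∨ Module.finrank ℂ (LinearMap.range B') = 8 ∨ Module.finrank ℂ (LinearMap.range B') = 9)
    {B : Module.End ℂ W} (hB : B ∈ 𝔊) (hΘB : Θ * B = B) (hBΘ : B * Θ = -B)
    (hr : Module.finrank ℂ (LinearMap.range B) = 7) : False := by
  classical
  have hsU : ∀ U : Submodule ℂ W, ∀ x y z : U, s ((x + y : U) : W) z = s (x : W) z + s (y : W) z :=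
    fun U x y z => by simp only [Submodule.coe_add, hadd]
  have hsmU : ∀ U : Submodule ℂ W, ∀ (c : ℂ) (x y : U), s ((c • x : U) : W) y = c * s (x : W) y :=
    fun U c x y => by simp only [Submodule.coe_smul, hsmul]
  have hno1 : ∀ B' ∈ 𝔊, Θ * B' = B' → B' * Θ = -B' → Module.finrank ℂ (LinearMap.range B') ≠ 1 := by
    intro B' hB' hΘB' hB'Θ h1
    rcases hS B' hB' hΘB' hB'Θ with h | h | h | h <;> omega
  have hmin : ∀ Y ∈ 𝔊, Θ * Y = Y → Y * Θ = -Y → Y ≠ 0 → 7 ≤ Module.finrank ℂ (LinearMap.range Y) := by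
    intro Y hY hΘY hYΘ hY0
    have h0 : Module.finrank ℂ (LinearMap.range Y) ≠ 0 := fun h =>
      hY0 (LinearMap.range_eq_bot.1 (Submodule.finrank_eq_zero.1 h))
    rcases hS Y hY hΘY hYΘ with h | h | h | h <;> omega
  have hmin' : ∀ Z ∈ 𝔊, Θ * Z = Z → Z * Θ = -Z → Z ≠ 0 → Module.finrank ℂ (LinearMap.range B) ≤ Module.finrank ℂ (LinearMap.range Z) := by
    rw [hr]; exact hmin
  obtain ⟨ι, Um, Up, PU, QU, Lm, ιm, Pm, Qm, Lp, ιp, Pp, Qp, hιmem, hιι, hιΘ, hιs, hUm, hUp, hfinUm, hfinUp,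
    hPM, hQM, hPU, hQU, hrangeP, hPUP, hQUQ, hfinQM, hfinPU, hfinQU, hLm, hLp,
    hιmapply, hPmmem, hQmmem, hbrLm, hirrLm, hιmmem, hιmιm, hPm, hQm, hfinPm, hfinQm, hPmQm, hdefPm, hdefQm, hadjLm,
    hιpapply, hPpmem, hQpmem, hbrLp, hirrLp, hιpmem, hιpιp, hPp, hQp, hfinPp, hfinQp, hPpQp, hdefPp, hdefQp, hadjLp,
    hsplit⟩ :=
    UnitaryLeviSetup.exists_levi_pair hbr hirr hΘ hΘΘ hP hQ hadd hsymm hPQ hdefP hdefQ hadj hB hΘB hBΘ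
  have hdich : ∀ X ∈ 𝔊, Θ * X = X → X * Θ = -X → X * ι = ι * X →
      Module.finrank ℂ (Up.map X) + Module.finrank ℂ (Um.map X) ≤ Module.finrank ℂ (LinearMap.range B) ∨
        (7 ≤ Module.finrank ℂ (Up.map X) ∧ 7 ≤ Module.finrank ℂ (Um.map X)) := fun X hX hΘX hXΘ hXc =>
    UnitaryLeviSetup.profile_dichotomy hbr hΘΘ hP hQ hadd hsymm hPQ hdefP hdefQ hadj hmin hB hΘB hBΘ hιι hιΘ hιs hUm hUp
      hPM hQM hQU hfinQU hrangeP hX hΘX hXΘ hXc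
  have hfinQU' := hfinQU
  rw [hr] at hfinQM hfinPU hfinQU hfinPm hfinQm hfinPp hfinQp hsplit hdich
  rw [hQ56] at hfinQM hfinQm hfinUm
  rw [hP9] at hfinPU hfinPp hfinUp
  have hcm : ∀ Z : Module.End ℂ W, Z * ι = ι * Z → ∀ x ∈ Um, Z x ∈ Um := fun Z hZ x hx =>
    (hUm _).2 (by rw [← Module.End.mul_apply, ← hZ, Module.End.mul_apply, (hUm x).1 hx, map_neg])
  have hcp : ∀ Z : Module.End ℂ W, Z * ι = ι * Z → ∀ x ∈ Up, Z x ∈ Up := fun Z hZ x hx =>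
    (hUp _).2 (by rw [← Module.End.mul_apply, ← hZ, Module.End.mul_apply, (hUp x).1 hx])
  have hfullm_of : Lm = ⊤ → False := fun h =>
    UnitaryLeviSetup.false_of_full_larger hbr hΘΘ hno1 hιι hιΘ hUm hUp (by omega) (by omega) hPM hQM (by omega)
      (by omega) hLm h
  have hkillm6 : ∀ X ∈ 𝔊, Θ * X = X → X * Θ = -X → X * ι = ι * X → Module.finrank ℂ (Um.map X) ≠ 6 := by
    intro X hX hΘX hXΘ hXc h6
    obtain ⟨hxmem, hιmx, hxιm, hxrk⟩ := UnitaryLeviSetup.restrict_mem hcm hLm hιmapply X hX hΘX hXΘ hXc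
    rw [h6] at hxrk
    refine hfullm_of (UnitaryDoubleLevi.eq_top_of_raise_of_core hbrLm hirrLm hιmmem hιmιm hPm hQm
      (s := fun v w : Um => s (v : W) w) (hsU Um) (fun v w => hsymm v w) hPmQm hdefPm hdefQm hadjLm hxmem hιmx hxιm
      (by rw [hxrk]; omega) (by omega) (by omega)
      fun U' 𝔩' ι' P' Q' hbr𝔩' hirr𝔩' hι' hι'ι' hP' hQ' hfinP' hfinQ' hP'Q' hdefP' hdefQ' hadj𝔩' => ?_)
    rw [hxrk] at hfinP' hfinQ'
    exact UnitarySix.eq_top_of_smul hbr𝔩' hirr𝔩' hι' hι'ι' hP' hQ' hfinP' ⟨21, by omega⟩ (by omega) (s := fun x y : U' => s ((x : Um) : W) y) (fun x y z => by simp only [Submodule.coe_add, hadd]) (fun c x y => by simp only [Submodule.coe_smul, hsmul]) (fun x y => hsymm _ _) hP'Q' hdefP' hdefQ' hadj𝔩'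
  have hLptop : Lp = ⊤ :=
    UnitaryTwoOdd.eq_top hbrLp hirrLp hιpmem hιpιp hPp hQp (by omega) ⟨3, by omega⟩ (s := fun x y : Up => s (x : W) y) (fun x y z => by simp only [Submodule.coe_add, hadd]) (fun x y => hsymm _ _) hPpQp hdefPp hdefQp hadjLp
  obtain ⟨T1, hιT1, hT1ι, hT1r⟩ := UnitaryRaisingSpace.exists_raise_finrank_range_eq hιpιp hPp hQp (k := 1)
    (by omega) (by omega)
  obtain ⟨X1, hX1, hΘX1, hX1Θ, hX1c, hX1Up⟩ := UnitaryLeviSetup.exists_lift hbr hΘ hΘΘ hcp hιΘ hLp hιpapply T1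
    (by rw [hLptop]; exact Submodule.mem_top) hιT1 hT1ι
  rw [hT1r] at hX1Up
  obtain ⟨hs1, hi1, hi1', hj1, hj1'⟩ := hsplit X1 hΘX1 hX1Θ hX1c
  have hrk1 := hS X1 hX1 hΘX1 hX1Θ
  have hd1 := hdich X1 hX1 hΘX1 hX1Θ hX1c
  rw [hs1] at hrk1
  rw [hX1Up] at hrk1 hd1
  have hk_hkillm6 := hkillm6 X1 hX1 hΘX1 hX1Θ hX1c
  omega

/-- Sub-Levi configuration for the `(18 | 65)` cell: a `Θ`-algebra of type `(9 | 56)` whose raising ranks lie in `{0, 8, 9}` with a raising of minimal non-zero rank `8` is impossible (`L⁺` of type `(1 | 8)` is full and a lift with `i = 1` has `j ∈ {7}`, killed in `L⁻` (type `(8 | 48)`)). [cite: Ribet1983, Thm. 3] [cite: Gordon1997, Thm. 6.3 (3)]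
[cite: Deligne1982HodgeCycles, I §3 Prop. 3.4, 3.6] [cite: GoodmanWallachGTM255, §4.1.1] -/
theorem UnitaryEighteenSixtyFive.subNineFiftySix_ranks8_9_min8 [FiniteDimensional ℂ W] {𝔊 : Submodule ℂ (Module.End ℂ W)}
    (hbr : ∀ Y ∈ 𝔊, ∀ Z ∈ 𝔊, Y * Z - Z * Y ∈ 𝔊)
    (hirr : ∀ U : Submodule ℂ W, (∀ A ∈ 𝔊, ∀ u ∈ U, A u ∈ U) → U = ⊥ ∨ U = ⊤)
    {Θ : Module.End ℂ W} (hΘ : Θ ∈ 𝔊) (hΘΘ : Θ * Θ = 1)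
    {P Q : Submodule ℂ W} (hP : ∀ x, x ∈ P ↔ Θ x = x) (hQ : ∀ x, x ∈ Q ↔ Θ x = -x)
    (hP9 : Module.finrank ℂ P = 9) (hQ56 : Module.finrank ℂ Q = 56)
    {s : W → W → ℂ} (hadd : ∀ x y z, s (x + y) z = s x z + s y z)
    (hsmul : ∀ (c : ℂ) (x y : W), s (c • x) y = c * s x y) (hsymm : ∀ x y, s y x = starRingEnd ℂ (s x y))
    (hPQ : ∀ p ∈ P, ∀ q ∈ Q, s p q = 0) (hdefP : ∀ p ∈ P, s p p = 0 → p = 0) (hdefQ : ∀ q ∈ Q, s q q = 0 → q = 0)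
    (hadj : ∀ X ∈ 𝔊, ∃ Y ∈ 𝔊, ∀ x y, s (X x) y = s x (Y y))
    (hS : ∀ B' ∈ 𝔊, Θ * B' = B' → B' * Θ = -B' →
      Module.finrank ℂ (LinearMap.range B') = 0 ∨ Module.finrank ℂ (LinearMap.range B') = 8 ∨ Module.finrank ℂ (LinearMap.range B') = 9)
    {B : Module.End ℂ W} (hB : B ∈ 𝔊) (hΘB : Θ * B = B) (hBΘ : B * Θ = -B)
    (hr : Module.finrank ℂ (LinearMap.range B) = 8) : False := by
  classical
  have hsU : ∀ U : Submodule ℂ W, ∀ x y z : U, s ((x + y : U) : W) z = s (x : W) z + s (y : W) z :=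
    fun U x y z => by simp only [Submodule.coe_add, hadd]
  have hsmU : ∀ U : Submodule ℂ W, ∀ (c : ℂ) (x y : U), s ((c • x : U) : W) y = c * s (x : W) y :=
    fun U c x y => by simp only [Submodule.coe_smul, hsmul]
  have hno1 : ∀ B' ∈ 𝔊, Θ * B' = B' → B' * Θ = -B' → Module.finrank ℂ (LinearMap.range B') ≠ 1 := by
    intro B' hB' hΘB' hB'Θ h1
    rcases hS B' hB' hΘB' hB'Θ with h | h | h <;> omega
  have hmin : ∀ Y ∈ 𝔊, Θ * Y = Y → Y * Θ = -Y → Y ≠ 0 → 8 ≤ Module.finrank ℂ (LinearMap.range Y) := by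
    intro Y hY hΘY hYΘ hY0
    have h0 : Module.finrank ℂ (LinearMap.range Y) ≠ 0 := fun h =>
      hY0 (LinearMap.range_eq_bot.1 (Submodule.finrank_eq_zero.1 h))
    rcases hS Y hY hΘY hYΘ with h | h | h <;> omega
  have hmin' : ∀ Z ∈ 𝔊, Θ * Z = Z → Z * Θ = -Z → Z ≠ 0 → Module.finrank ℂ (LinearMap.range B) ≤ Module.finrank ℂ (LinearMap.range Z) := by
    rw [hr]; exact hmin
  obtain ⟨ι, Um, Up, PU, QU, Lm, ιm, Pm, Qm, Lp, ιp, Pp, Qp, hιmem, hιι, hιΘ, hιs, hUm, hUp, hfinUm, hfinUp,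
    hPM, hQM, hPU, hQU, hrangeP, hPUP, hQUQ, hfinQM, hfinPU, hfinQU, hLm, hLp,
    hιmapply, hPmmem, hQmmem, hbrLm, hirrLm, hιmmem, hιmιm, hPm, hQm, hfinPm, hfinQm, hPmQm, hdefPm, hdefQm, hadjLm,
    hιpapply, hPpmem, hQpmem, hbrLp, hirrLp, hιpmem, hιpιp, hPp, hQp, hfinPp, hfinQp, hPpQp, hdefPp, hdefQp, hadjLp,
    hsplit⟩ :=
    UnitaryLeviSetup.exists_levi_pair hbr hirr hΘ hΘΘ hP hQ hadd hsymm hPQ hdefP hdefQ hadj hB hΘB hBΘ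
  have hdich : ∀ X ∈ 𝔊, Θ * X = X → X * Θ = -X → X * ι = ι * X →
      Module.finrank ℂ (Up.map X) + Module.finrank ℂ (Um.map X) ≤ Module.finrank ℂ (LinearMap.range B) ∨
        (8 ≤ Module.finrank ℂ (Up.map X) ∧ 8 ≤ Module.finrank ℂ (Um.map X)) := fun X hX hΘX hXΘ hXc =>
    UnitaryLeviSetup.profile_dichotomy hbr hΘΘ hP hQ hadd hsymm hPQ hdefP hdefQ hadj hmin hB hΘB hBΘ hιι hιΘ hιs hUm hUp
      hPM hQM hQU hfinQU hrangeP hX hΘX hXΘ hXc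
  have hfinQU' := hfinQU
  rw [hr] at hfinQM hfinPU hfinQU hfinPm hfinQm hfinPp hfinQp hsplit hdich
  rw [hQ56] at hfinQM hfinQm hfinUm
  rw [hP9] at hfinPU hfinPp hfinUp
  have hcm : ∀ Z : Module.End ℂ W, Z * ι = ι * Z → ∀ x ∈ Um, Z x ∈ Um := fun Z hZ x hx =>
    (hUm _).2 (by rw [← Module.End.mul_apply, ← hZ, Module.End.mul_apply, (hUm x).1 hx, map_neg])
  have hcp : ∀ Z : Module.End ℂ W, Z * ι = ι * Z → ∀ x ∈ Up, Z x ∈ Up := fun Z hZ x hx =>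
    (hUp _).2 (by rw [← Module.End.mul_apply, ← hZ, Module.End.mul_apply, (hUp x).1 hx])
  have hfullm_of : Lm = ⊤ → False := fun h =>
    UnitaryLeviSetup.false_of_full_larger hbr hΘΘ hno1 hιι hιΘ hUm hUp (by omega) (by omega) hPM hQM (by omega)
      (by omega) hLm h
  have hkillm7 : ∀ X ∈ 𝔊, Θ * X = X → X * Θ = -X → X * ι = ι * X → Module.finrank ℂ (Um.map X) ≠ 7 := by
    intro X hX hΘX hXΘ hXc h7
    obtain ⟨hxmem, hιmx, hxιm, hxrk⟩ := UnitaryLeviSetup.restrict_mem hcm hLm hιmapply X hX hΘX hXΘ hXc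
    rw [h7] at hxrk
    refine hfullm_of (UnitaryDoubleLevi.eq_top_of_raise_of_core hbrLm hirrLm hιmmem hιmιm hPm hQm
      (s := fun v w : Um => s (v : W) w) (hsU Um) (fun v w => hsymm v w) hPmQm hdefPm hdefQm hadjLm hxmem hιmx hxιm
      (by rw [hxrk]; omega) (by omega) (by omega)
      fun U' 𝔩' ι' P' Q' hbr𝔩' hirr𝔩' hι' hι'ι' hP' hQ' hfinP' hfinQ' hP'Q' hdefP' hdefQ' hadj𝔩' => ?_)
    rw [hxrk] at hfinP' hfinQ'
    exact UnitarySeven.eq_top_of_smul hbr𝔩' hirr𝔩' hι' hι'ι' hP' hQ' hfinP' (by omega) (s := fun x y : U' => s ((x : Um) : W) y) (fun x y z => by simp only [Submodule.coe_add, hadd]) (fun c x y => by simp only [Submodule.coe_smul, hsmul]) (fun x y => hsymm _ _) hP'Q' hdefP' hdefQ' hadj𝔩'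
  have hLptop : Lp = ⊤ :=
    UnitaryThreeCoprime.eq_top_of_finrank_eq_one hbrLp hirrLp (Submodule.neg_mem _ hιpmem) ((neg_mul_neg ιp ιp).trans hιpιp) (P := Qp) (Q := Pp) (fun x => by rw [hQp, LinearMap.neg_apply, neg_eq_iff_eq_neg]) (fun x => by rw [hPp, LinearMap.neg_apply, neg_inj]) (by omega) (by omega)
  obtain ⟨T1, hιT1, hT1ι, hT1r⟩ := UnitaryRaisingSpace.exists_raise_finrank_range_eq hιpιp hPp hQp (k := 1)
    (by omega) (by omega)
  obtain ⟨X1, hX1, hΘX1, hX1Θ, hX1c, hX1Up⟩ := UnitaryLeviSetup.exists_lift hbr hΘ hΘΘ hcp hιΘ hLp hιpapply T1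
    (by rw [hLptop]; exact Submodule.mem_top) hιT1 hT1ι
  rw [hT1r] at hX1Up
  obtain ⟨hs1, hi1, hi1', hj1, hj1'⟩ := hsplit X1 hΘX1 hX1Θ hX1c
  have hrk1 := hS X1 hX1 hΘX1 hX1Θ
  have hd1 := hdich X1 hX1 hΘX1 hX1Θ hX1c
  rw [hs1] at hrk1
  rw [hX1Up] at hrk1 hd1
  have hk_hkillm7 := hkillm7 X1 hX1 hΘX1 hX1Θ hX1c
  omega

/-- Sub-Levi configuration for the `(18 | 65)` cell: a `Θ`-algebra of type `(9 | 56)` whose non-zero raising ranks are all `9` is impossible (the full-rank chain would give `9 ∣ 56`). [cite: Ribet1983, Thm. 3] [cite: Gordon1997, Thm. 6.3 (3)]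
[cite: Deligne1982HodgeCycles, I §3 Prop. 3.4, 3.6] [cite: GoodmanWallachGTM255, §4.1.1] -/
theorem UnitaryEighteenSixtyFive.subNineFiftySix_rank9 [FiniteDimensional ℂ W] {𝔊 : Submodule ℂ (Module.End ℂ W)}
    (hbr : ∀ Y ∈ 𝔊, ∀ Z ∈ 𝔊, Y * Z - Z * Y ∈ 𝔊)
    (hirr : ∀ U : Submodule ℂ W, (∀ A ∈ 𝔊, ∀ u ∈ U, A u ∈ U) → U = ⊥ ∨ U = ⊤)
    {Θ : Module.End ℂ W} (hΘ : Θ ∈ 𝔊) (hΘΘ : Θ * Θ = 1)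
    {P Q : Submodule ℂ W} (hP : ∀ x, x ∈ P ↔ Θ x = x) (hQ : ∀ x, x ∈ Q ↔ Θ x = -x)
    (hP9 : Module.finrank ℂ P = 9) (hQ56 : Module.finrank ℂ Q = 56)
    {s : W → W → ℂ} (hadd : ∀ x y z, s (x + y) z = s x z + s y z)
    (hsmul : ∀ (c : ℂ) (x y : W), s (c • x) y = c * s x y) (hsymm : ∀ x y, s y x = starRingEnd ℂ (s x y))
    (hPQ : ∀ p ∈ P, ∀ q ∈ Q, s p q = 0) (hdefP : ∀ p ∈ P, s p p = 0 → p = 0) (hdefQ : ∀ q ∈ Q, s q q = 0 → q = 0)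
    (hadj : ∀ X ∈ 𝔊, ∃ Y ∈ 𝔊, ∀ x y, s (X x) y = s x (Y y))
    (hS : ∀ B' ∈ 𝔊, Θ * B' = B' → B' * Θ = -B' →
      Module.finrank ℂ (LinearMap.range B') = 0 ∨ Module.finrank ℂ (LinearMap.range B') = 9)
    {B : Module.End ℂ W} (hB : B ∈ 𝔊) (hΘB : Θ * B = B) (hBΘ : B * Θ = -B)
    (hr : Module.finrank ℂ (LinearMap.range B) = 9) : False := by
  classical
  have hsU : ∀ U : Submodule ℂ W, ∀ x y z : U, s ((x + y : U) : W) z = s (x : W) z + s (y : W) z :=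
    fun U x y z => by simp only [Submodule.coe_add, hadd]
  have hsmU : ∀ U : Submodule ℂ W, ∀ (c : ℂ) (x y : U), s ((c • x : U) : W) y = c * s (x : W) y :=
    fun U c x y => by simp only [Submodule.coe_smul, hsmul]
  have hSa : ∀ Y ∈ 𝔊, Θ * Y = Y → Y * Θ = -Y → Y ≠ 0 → Module.finrank ℂ (LinearMap.range Y) = 9 := by
    intro Y hY hΘY hYΘ hY0
    have h0 : Module.finrank ℂ (LinearMap.range Y) ≠ 0 := fun h => hY0 (LinearMap.range_eq_bot.1 (Submodule.finrank_eq_zero.1 h))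
    rcases hS Y hY hΘY hYΘ with h | h <;> omega
  have hB0 : B ≠ 0 := fun h => by rw [h, LinearMap.range_zero, finrank_bot] at hr; omega
  have hdvd := UnitaryConstantRank.dvd_of_rank_eq_finrank 56 hbr hirr hΘ hΘΘ hP hQ (by omega) hP9 hQ56 hadd hsymm hPQ
    hdefP hdefQ hadj hSa ⟨B, hB, hΘB, hBΘ, hB0⟩
  omega

/-- Sub-Levi configuration for the `(18 | 65)` cell: a `Θ`-algebra of type `(15 | 50)` whose non-zero raising ranks are all `12` is impossible (the non-zero profiles [(0, 12), (2, 10), (3, 9)] are pairwise exclusive, so constant; `(2, 10)`: TOOL C on `L⁺`; `(3, 9)`: TOOL G). [cite: Ribet1983, Thm. 3] [cite: Gordon1997, Thm. 6.3 (3)]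
[cite: Deligne1982HodgeCycles, I §3 Prop. 3.4, 3.6] [cite: GoodmanWallachGTM255, §4.1.1] -/
theorem UnitaryEighteenSixtyFive.subFifteenFifty_rank12 [FiniteDimensional ℂ W] {𝔊 : Submodule ℂ (Module.End ℂ W)}
    (hbr : ∀ Y ∈ 𝔊, ∀ Z ∈ 𝔊, Y * Z - Z * Y ∈ 𝔊)
    (hirr : ∀ U : Submodule ℂ W, (∀ A ∈ 𝔊, ∀ u ∈ U, A u ∈ U) → U = ⊥ ∨ U = ⊤)
    {Θ : Module.End ℂ W} (hΘ : Θ ∈ 𝔊) (hΘΘ : Θ * Θ = 1)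
    {P Q : Submodule ℂ W} (hP : ∀ x, x ∈ P ↔ Θ x = x) (hQ : ∀ x, x ∈ Q ↔ Θ x = -x)
    (hP15 : Module.finrank ℂ P = 15) (hQ50 : Module.finrank ℂ Q = 50)
    {s : W → W → ℂ} (hadd : ∀ x y z, s (x + y) z = s x z + s y z)
    (hsmul : ∀ (c : ℂ) (x y : W), s (c • x) y = c * s x y) (hsymm : ∀ x y, s y x = starRingEnd ℂ (s x y))
    (hPQ : ∀ p ∈ P, ∀ q ∈ Q, s p q = 0) (hdefP : ∀ p ∈ P, s p p = 0 → p = 0) (hdefQ : ∀ q ∈ Q, s q q = 0 → q = 0)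
    (hadj : ∀ X ∈ 𝔊, ∃ Y ∈ 𝔊, ∀ x y, s (X x) y = s x (Y y))
    (hS : ∀ B' ∈ 𝔊, Θ * B' = B' → B' * Θ = -B' →
      Module.finrank ℂ (LinearMap.range B') = 0 ∨ Module.finrank ℂ (LinearMap.range B') = 12)
    {B : Module.End ℂ W} (hB : B ∈ 𝔊) (hΘB : Θ * B = B) (hBΘ : B * Θ = -B)
    (hr : Module.finrank ℂ (LinearMap.range B) = 12) : False := by
  classical
  have hsU : ∀ U : Submodule ℂ W, ∀ x y z : U, s ((x + y : U) : W) z = s (x : W) z + s (y : W) z :=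
    fun U x y z => by simp only [Submodule.coe_add, hadd]
  have hsmU : ∀ U : Submodule ℂ W, ∀ (c : ℂ) (x y : U), s ((c • x : U) : W) y = c * s (x : W) y :=
    fun U c x y => by simp only [Submodule.coe_smul, hsmul]
  have hno1 : ∀ B' ∈ 𝔊, Θ * B' = B' → B' * Θ = -B' → Module.finrank ℂ (LinearMap.range B') ≠ 1 := by
    intro B' hB' hΘB' hB'Θ h1
    rcases hS B' hB' hΘB' hB'Θ with h | h <;> omega
  have hmin : ∀ Y ∈ 𝔊, Θ * Y = Y → Y * Θ = -Y → Y ≠ 0 → 12 ≤ Module.finrank ℂ (LinearMap.range Y) := by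
    intro Y hY hΘY hYΘ hY0
    have h0 : Module.finrank ℂ (LinearMap.range Y) ≠ 0 := fun h =>
      hY0 (LinearMap.range_eq_bot.1 (Submodule.finrank_eq_zero.1 h))
    rcases hS Y hY hΘY hYΘ with h | h <;> omega
  have hmin' : ∀ Z ∈ 𝔊, Θ * Z = Z → Z * Θ = -Z → Z ≠ 0 → Module.finrank ℂ (LinearMap.range B) ≤ Module.finrank ℂ (LinearMap.range Z) := by
    rw [hr]; exact hmin
  obtain ⟨ι, Um, Up, PU, QU, Lm, ιm, Pm, Qm, Lp, ιp, Pp, Qp, hιmem, hιι, hιΘ, hιs, hUm, hUp, hfinUm, hfinUp,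
    hPM, hQM, hPU, hQU, hrangeP, hPUP, hQUQ, hfinQM, hfinPU, hfinQU, hLm, hLp,
    hιmapply, hPmmem, hQmmem, hbrLm, hirrLm, hιmmem, hιmιm, hPm, hQm, hfinPm, hfinQm, hPmQm, hdefPm, hdefQm, hadjLm,
    hιpapply, hPpmem, hQpmem, hbrLp, hirrLp, hιpmem, hιpιp, hPp, hQp, hfinPp, hfinQp, hPpQp, hdefPp, hdefQp, hadjLp,
    hsplit⟩ :=
    UnitaryLeviSetup.exists_levi_pair hbr hirr hΘ hΘΘ hP hQ hadd hsymm hPQ hdefP hdefQ hadj hB hΘB hBΘ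
  have hdich : ∀ X ∈ 𝔊, Θ * X = X → X * Θ = -X → X * ι = ι * X →
      Module.finrank ℂ (Up.map X) + Module.finrank ℂ (Um.map X) ≤ Module.finrank ℂ (LinearMap.range B) ∨
        (12 ≤ Module.finrank ℂ (Up.map X) ∧ 12 ≤ Module.finrank ℂ (Um.map X)) := fun X hX hΘX hXΘ hXc =>
    UnitaryLeviSetup.profile_dichotomy hbr hΘΘ hP hQ hadd hsymm hPQ hdefP hdefQ hadj hmin hB hΘB hBΘ hιι hιΘ hιs hUm hUp
      hPM hQM hQU hfinQU hrangeP hX hΘX hXΘ hXc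
  have hfinQU' := hfinQU
  rw [hr] at hfinQM hfinPU hfinQU hfinPm hfinQm hfinPp hfinQp hsplit hdich
  rw [hQ50] at hfinQM hfinQm hfinUm
  rw [hP15] at hfinPU hfinPp hfinUp
  have hcm : ∀ Z : Module.End ℂ W, Z * ι = ι * Z → ∀ x ∈ Um, Z x ∈ Um := fun Z hZ x hx =>
    (hUm _).2 (by rw [← Module.End.mul_apply, ← hZ, Module.End.mul_apply, (hUm x).1 hx, map_neg])
  have hcp : ∀ Z : Module.End ℂ W, Z * ι = ι * Z → ∀ x ∈ Up, Z x ∈ Up := fun Z hZ x hx =>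
    (hUp _).2 (by rw [← Module.End.mul_apply, ← hZ, Module.End.mul_apply, (hUp x).1 hx])
  have hfullm_of : Lm = ⊤ → False := fun h =>
    UnitaryLeviSetup.false_of_full_larger hbr hΘΘ hno1 hιι hιΘ hUm hUp (by omega) (by omega) hPM hQM (by omega)
      (by omega) hLm h
  have hkillm11 : ∀ X ∈ 𝔊, Θ * X = X → X * Θ = -X → X * ι = ι * X → Module.finrank ℂ (Um.map X) ≠ 11 := by
    intro X hX hΘX hXΘ hXc h11
    obtain ⟨hxmem, hιmx, hxιm, hxrk⟩ := UnitaryLeviSetup.restrict_mem hcm hLm hιmapply X hX hΘX hXΘ hXc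
    rw [h11] at hxrk
    refine hfullm_of (UnitaryDoubleLevi.eq_top_of_raise_of_core hbrLm hirrLm hιmmem hιmιm hPm hQm
      (s := fun v w : Um => s (v : W) w) (hsU Um) (fun v w => hsymm v w) hPmQm hdefPm hdefQm hadjLm hxmem hιmx hxιm
      (by rw [hxrk]; omega) (by omega) (by omega)
      fun U' 𝔩' ι' P' Q' hbr𝔩' hirr𝔩' hι' hι'ι' hP' hQ' hfinP' hfinQ' hP'Q' hdefP' hdefQ' hadj𝔩' => ?_)
    rw [hxrk] at hfinP' hfinQ'
    exact UnitaryEleven.eq_top_of_smul hbr𝔩' hirr𝔩' hι' hι'ι' hP' hQ' hfinP' (by omega) (s := fun x y : U' => s ((x : Um) : W) y) (fun x y z => by simp only [Submodule.coe_add, hadd]) (fun c x y => by simp only [Submodule.coe_smul, hsmul]) (fun x y => hsymm _ _) hP'Q' hdefP' hdefQ' hadj𝔩'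
  have hfullp_of : Lp = ⊤ → False := by
    intro hLptop
    obtain ⟨T1, hιT1, hT1ι, hT1r⟩ := UnitaryRaisingSpace.exists_raise_finrank_range_eq hιpιp hPp hQp (k := 1)
      (by omega) (by omega)
    obtain ⟨X1, hX1, hΘX1, hX1Θ, hX1c, hX1Up⟩ := UnitaryLeviSetup.exists_lift hbr hΘ hΘΘ hcp hιΘ hLp hιpapply T1
      (by rw [hLptop]; exact Submodule.mem_top) hιT1 hT1ι
    rw [hT1r] at hX1Up
    obtain ⟨hs1, hi1, hi1', hj1, hj1'⟩ := hsplit X1 hΘX1 hX1Θ hX1c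
    have hrk1 := hS X1 hX1 hΘX1 hX1Θ
    have hd1 := hdich X1 hX1 hΘX1 hX1Θ hX1c
    rw [hs1] at hrk1
    rw [hX1Up] at hrk1 hd1
    have hk_hkillm11 := hkillm11 X1 hX1 hΘX1 hX1Θ hX1c
    omega
  have hprof : ∀ X ∈ 𝔊, Θ * X = X → X * Θ = -X → X * ι = ι * X →
      (Module.finrank ℂ (Up.map X) = 0 ∧ Module.finrank ℂ (Um.map X) = 0) ∨
        (Module.finrank ℂ (Up.map X) = 0 ∧ Module.finrank ℂ (Um.map X) = 12) ∨
        (Module.finrank ℂ (Up.map X) = 2 ∧ Module.finrank ℂ (Um.map X) = 10) ∨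
        (Module.finrank ℂ (Up.map X) = 3 ∧ Module.finrank ℂ (Um.map X) = 9) := by
    intro X hX hΘX hXΘ hXc
    obtain ⟨hs, hi, hi', hj, hj'⟩ := hsplit X hΘX hXΘ hXc
    have hkillm11' := hkillm11 X hX hΘX hXΘ hXc
    have hrk := hS X hX hΘX hXΘ
    have hd := hdich X hX hΘX hXΘ hXc
    rw [hs] at hrk
    generalize Module.finrank ℂ ↥(Submodule.map X Um) = jj at *
    have hjle : jj ≤ 12 := by omega
    interval_cases jj
    · exact Or.inl ⟨by omega, rfl⟩
    · exfalso; omega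
    · exfalso; omega
    · exfalso; omega
    · exfalso; omega
    · exfalso; omega
    · exfalso; omega
    · exfalso; omega
    · exfalso; omega
    · exact Or.inr (Or.inr (Or.inr (⟨by omega, rfl⟩)))
    · exact Or.inr (Or.inr (Or.inl ⟨by omega, rfl⟩))
    · exact (hkillm11' rfl).elim
    · exact Or.inr (Or.inl ⟨by omega, rfl⟩)
  obtain ⟨⟨p, hp⟩, hp0⟩ := Module.finrank_pos_iff_exists_ne_zero.1 (show 0 < Module.finrank ℂ PU by omega)
  obtain ⟨⟨q, hq⟩, hq0⟩ := Module.finrank_pos_iff_exists_ne_zero.1 (show 0 < Module.finrank ℂ QU by omega)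
  obtain ⟨X₀, hX₀, hΘX₀, hX₀Θ, hX₀c, c₀, hιc₀, -, hX₀c0⟩ :=
    UnitaryLeviFull.exists_raise_commute_apply_ne_zero hbr hirr hΘ hΘΘ hQ hιmem hιι hιΘ hUm hUp
      ⟨p, fun h => hp0 (Subtype.ext h), ((hPU p).1 hp).1, ((hPU p).1 hp).2⟩
      ⟨q, fun h => hq0 (Subtype.ext h), ((hQU q).1 hq).1, ((hQU q).1 hq).2⟩
  have hX₀i : Module.finrank ℂ (Up.map X₀) ≠ 0 := fun h0 => by
    have hmem : X₀ c₀ ∈ Up.map X₀ := Submodule.mem_map_of_mem ((hUp c₀).2 hιc₀)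
    rw [Submodule.finrank_eq_zero.1 h0, Submodule.mem_bot] at hmem
    exact hX₀c0 hmem
  have hnotboth : ∀ X ∈ 𝔊, Θ * X = X → X * Θ = -X → X * ι = ι * X → ∀ X' ∈ 𝔊, Θ * X' = X' → X' * Θ = -X' →
      X' * ι = ι * X' → 12 < Module.finrank ℂ (Up.map X') + Module.finrank ℂ (Um.map X) → False := by
    intro X hX hΘX hXΘ hXc X' hX' hΘX' hX'Θ hX'c hgt
    obtain ⟨c, hc1, hc2⟩ := UnitaryGenericRank.exists_finrank_le_and_finrank_le (X'.restrict (hcp X' hX'c))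
      (X.restrict (hcp X hXc)) (X.restrict (hcm X hXc)) (X'.restrict (hcm X' hX'c))
    obtain ⟨hX₁, hΘX₁, hX₁Θ, hX₁c⟩ := UnitaryLeviSetup.add_smul_raise X hX hΘX hXΘ hXc X' hX' hΘX' hX'Θ hX'c c
    have hi₁ := UnitaryLeviSetup.finrank_map_add_smul hcp X X' hXc hX'c c hX₁c
    have hj₁ := UnitaryLeviSetup.finrank_map_add_smul hcm X X' hXc hX'c c hX₁c
    rw [UnitaryLeviRank.finrank_range_restrict] at hc1 hc2
    have hp := hprof (X + c • X') hX₁ hΘX₁ hX₁Θ hX₁c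
    rw [hi₁, hj₁] at hp
    omega
  have hzero : ∀ X ∈ 𝔊, Θ * X = X → X * Θ = -X → X * ι = ι * X → Module.finrank ℂ (Up.map X) = 0 → Module.finrank ℂ (Um.map X) = 0 → X = 0 := by
    intro X hX hΘX hXΘ hXc hi hj
    obtain ⟨hs, -, -, -, -⟩ := hsplit X hΘX hXΘ hXc
    rw [hi, hj, add_zero] at hs
    exact LinearMap.range_eq_bot.1 (Submodule.finrank_eq_zero.1 hs)
  have hjoint : ∀ v ∈ Q ⊓ LinearMap.ker B,
      (∀ X ∈ 𝔊, Θ * X = X → X * Θ = -X → X * ι = ι * X → X v = 0) → v = 0 := by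
    intro v hv hkill
    obtain ⟨hιv, -⟩ := (hQM v).1 hv
    have hvUm : v ∈ Um := (hUm v).2 hιv
    obtain ⟨⟨p₁, hp₁⟩, hp₁0⟩ := Module.finrank_pos_iff_exists_ne_zero.1 (show 0 < Module.finrank ℂ Pm by omega)
    have hq : ιm ⟨v, hvUm⟩ = -⟨v, hvUm⟩ := (hQm _).1 ((hQmmem _).2 hv)
    have h0 := UnitaryThetaCore.eq_zero_of_forall_raise_apply_eq_zero hbrLm hirrLm hιmmem hιmιm
      ⟨p₁, fun h => hp₁0 (Subtype.ext h), (hPm p₁).1 hp₁⟩ hq fun T hT hιT hTι => ?_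
    · exact congrArg Subtype.val h0
    obtain ⟨X, hX, hΘX, hXΘ, hXc, hXT⟩ := UnitaryLeviSetup.exists_lift_eq hbr hΘ hΘΘ hιΘ hLm hιmapply T hT hιT hTι
    exact Subtype.ext (by rw [← hXT]; exact hkill X hX hΘX hXΘ hXc)
  rcases hprof X₀ hX₀ hΘX₀ hX₀Θ hX₀c with ⟨h0i, h0j⟩ | ⟨h0i, h0j⟩ | ⟨h0i, h0j⟩ | ⟨h0i, h0j⟩
  · exact hX₀i h0i
  · exact hX₀i h0i
  · -- constant profile `(2, 10)`
    have hprofc : ∀ X ∈ 𝔊, Θ * X = X → X * Θ = -X → X * ι = ι * X → X ≠ 0 →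
        Module.finrank ℂ (Up.map X) = 2 ∧ Module.finrank ℂ (Um.map X) = 10 := by
      intro X hX hΘX hXΘ hXc hX0
      rcases hprof X hX hΘX hXΘ hXc with ⟨hi, hj⟩ | ⟨hi, hj⟩ | ⟨hi, hj⟩ | ⟨hi, hj⟩
      · exact (hX0 (hzero X hX hΘX hXΘ hXc hi hj)).elim
      · exact (hnotboth X hX hΘX hXΘ hXc X₀ hX₀ hΘX₀ hX₀Θ hX₀c (by omega)).elim
      · exact ⟨hi, hj⟩
      · exact (hnotboth X₀ hX₀ hΘX₀ hX₀Θ hX₀c X hX hΘX hXΘ hXc (by omega)).elim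
    obtain ⟨A, hA, hιpA, hAιp, hAne, hA2⟩ :=
      UnitaryConstantRank.exists_raise_rank_ne_two hbrLp hirrLp hιpmem hιpιp hPp hQp (by omega) (by omega) (by omega)
        (s := fun v w : Up => s (v : W) w) (hsU Up) (fun v w => hsymm v w) hPpQp hdefPp hdefQp hadjLp
    obtain ⟨XA, hXA, hΘXA, hXAΘ, hXAc, hXAUp⟩ := UnitaryLeviSetup.exists_lift hbr hΘ hΘΘ hcp hιΘ hLp hιpapply A hA hιpA hAιp
    have hA0 : Module.finrank ℂ (LinearMap.range A) ≠ 0 := fun h =>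
      hAne (LinearMap.range_eq_bot.1 (Submodule.finrank_eq_zero.1 h))
    have hXA0 : XA ≠ 0 := fun h0 => hA0 (by rw [← hXAUp, h0, Submodule.map_zero, finrank_bot])
    have hpA := hprofc XA hXA hΘXA hXAΘ hXAc hXA0
    rw [← hXAUp] at hA2
    omega
  · -- constant profile `(3, 9)`
    have hprofc : ∀ X ∈ 𝔊, Θ * X = X → X * Θ = -X → X * ι = ι * X → X ≠ 0 →
        Module.finrank ℂ (Up.map X) = 3 ∧ Module.finrank ℂ (Um.map X) = 9 := by
      intro X hX hΘX hXΘ hXc hX0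
      rcases hprof X hX hΘX hXΘ hXc with ⟨hi, hj⟩ | ⟨hi, hj⟩ | ⟨hi, hj⟩ | ⟨hi, hj⟩
      · exact (hX0 (hzero X hX hΘX hXΘ hXc hi hj)).elim
      · exact (hnotboth X hX hΘX hXΘ hXc X₀ hX₀ hΘX₀ hX₀Θ hX₀c (by omega)).elim
      · exact (hnotboth X hX hΘX hXΘ hXc X₀ hX₀ hΘX₀ hX₀Θ hX₀c (by omega)).elim
      · exact ⟨hi, hj⟩
    have hnum0 : Module.finrank ℂ QU ≤ (fun t : ℕ => (max (max (max (12 - 3 * t) (12 - 3 * t)) (12 - 3 * t)) (12 - 3 * t))) 0 := by beta_reduce; omega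
    have hnum1 : (fun t : ℕ => (min (min (min (9 * t) (6 * t + 3)) (3 * t + 9)) 18)) 0 = 0 := by beta_reduce; omega
    have hnum2 : ∀ t : ℕ, (fun t : ℕ => (max (max (max (12 - 3 * t) (12 - 3 * t)) (12 - 3 * t)) (12 - 3 * t))) t ≤ (fun t : ℕ => (max (max (max (12 - 3 * t) (12 - 3 * t)) (12 - 3 * t)) (12 - 3 * t))) (t + 1) + (Module.finrank ℂ PU - (t + 1) * 0) := by
      intro t; beta_reduce; omega
    have hnum3 : ∀ t : ℕ, (fun t : ℕ => (min (min (min (9 * t) (6 * t + 3)) (3 * t + 9)) 18)) t + (fun t : ℕ => (max (max (max (12 - 3 * t) (12 - 3 * t)) (12 - 3 * t)) (12 - 3 * t))) (t + 1) ≤ (fun t : ℕ => (min (min (min (9 * t) (6 * t + 3)) (3 * t + 9)) 18)) (t + 1) := by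
      intro t; beta_reduce; omega
    have hnum4 : ∀ t : ℕ, (fun t : ℕ => (min (min (min (9 * t) (6 * t + 3)) (3 * t + 9)) 18)) t < Module.finrank ℂ ↥(Q ⊓ LinearMap.ker B) := by
      intro t; beta_reduce; omega
    exact UnitaryOrthogonalChain.false_of_constProfile hbr hΘΘ hP hQ hadd hsmul hsymm hPQ hdefP hdefQ hadj hB hΘB hBΘ
      hmin' hιι hιΘ hιs hUm hUp hPM hQM hPU hQU hfinQU' (i := 3) (j := 9) (c := 0) hprofc (by omega) (by omega)
      (by omega) (fun t : ℕ => (max (max (max (12 - 3 * t) (12 - 3 * t)) (12 - 3 * t)) (12 - 3 * t))) (fun t : ℕ => (min (min (min (9 * t) (6 * t + 3)) (3 * t + 9)) 18)) hnum0 hnum1 hnum2 hnum3 hnum4 hjoint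

/-- Sub-Levi configuration for the `(18 | 65)` cell: a `Θ`-algebra of type `(14 | 35)` whose non-zero raising ranks are all `12` is impossible (after the Levi kills every profile has `i = 0` (profiles [(0, 0)]), against the non-vanishing lemma). [cite: Ribet1983, Thm. 3] [cite: Gordon1997, Thm. 6.3 (3)]
[cite: Deligne1982HodgeCycles, I §3 Prop. 3.4, 3.6] [cite: GoodmanWallachGTM255, §4.1.1] -/
theorem UnitaryEighteenSixtyFive.subFourteenThirtyFive_rank12 [FiniteDimensional ℂ W] {𝔊 : Submodule ℂ (Module.End ℂ W)}
    (hbr : ∀ Y ∈ 𝔊, ∀ Z ∈ 𝔊, Y * Z - Z * Y ∈ 𝔊)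
    (hirr : ∀ U : Submodule ℂ W, (∀ A ∈ 𝔊, ∀ u ∈ U, A u ∈ U) → U = ⊥ ∨ U = ⊤)
    {Θ : Module.End ℂ W} (hΘ : Θ ∈ 𝔊) (hΘΘ : Θ * Θ = 1)
    {P Q : Submodule ℂ W} (hP : ∀ x, x ∈ P ↔ Θ x = x) (hQ : ∀ x, x ∈ Q ↔ Θ x = -x)
    (hP14 : Module.finrank ℂ P = 14) (hQ35 : Module.finrank ℂ Q = 35)
    {s : W → W → ℂ} (hadd : ∀ x y z, s (x + y) z = s x z + s y z)
    (hsmul : ∀ (c : ℂ) (x y : W), s (c • x) y = c * s x y) (hsymm : ∀ x y, s y x = starRingEnd ℂ (s x y))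
    (hPQ : ∀ p ∈ P, ∀ q ∈ Q, s p q = 0) (hdefP : ∀ p ∈ P, s p p = 0 → p = 0) (hdefQ : ∀ q ∈ Q, s q q = 0 → q = 0)
    (hadj : ∀ X ∈ 𝔊, ∃ Y ∈ 𝔊, ∀ x y, s (X x) y = s x (Y y))
    (hS : ∀ B' ∈ 𝔊, Θ * B' = B' → B' * Θ = -B' →
      Module.finrank ℂ (LinearMap.range B') = 0 ∨ Module.finrank ℂ (LinearMap.range B') = 12)
    {B : Module.End ℂ W} (hB : B ∈ 𝔊) (hΘB : Θ * B = B) (hBΘ : B * Θ = -B)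
    (hr : Module.finrank ℂ (LinearMap.range B) = 12) : False := by
  classical
  have hsU : ∀ U : Submodule ℂ W, ∀ x y z : U, s ((x + y : U) : W) z = s (x : W) z + s (y : W) z :=
    fun U x y z => by simp only [Submodule.coe_add, hadd]
  have hsmU : ∀ U : Submodule ℂ W, ∀ (c : ℂ) (x y : U), s ((c • x : U) : W) y = c * s (x : W) y :=
    fun U c x y => by simp only [Submodule.coe_smul, hsmul]
  have hno1 : ∀ B' ∈ 𝔊, Θ * B' = B' → B' * Θ = -B' → Module.finrank ℂ (LinearMap.range B') ≠ 1 := by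
    intro B' hB' hΘB' hB'Θ h1
    rcases hS B' hB' hΘB' hB'Θ with h | h <;> omega
  have hmin : ∀ Y ∈ 𝔊, Θ * Y = Y → Y * Θ = -Y → Y ≠ 0 → 12 ≤ Module.finrank ℂ (LinearMap.range Y) := by
    intro Y hY hΘY hYΘ hY0
    have h0 : Module.finrank ℂ (LinearMap.range Y) ≠ 0 := fun h =>
      hY0 (LinearMap.range_eq_bot.1 (Submodule.finrank_eq_zero.1 h))
    rcases hS Y hY hΘY hYΘ with h | h <;> omega
  have hmin' : ∀ Z ∈ 𝔊, Θ * Z = Z → Z * Θ = -Z → Z ≠ 0 → Module.finrank ℂ (LinearMap.range B) ≤ Module.finrank ℂ (LinearMap.range Z) := by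
    rw [hr]; exact hmin
  obtain ⟨ι, Um, Up, PU, QU, Lm, ιm, Pm, Qm, Lp, ιp, Pp, Qp, hιmem, hιι, hιΘ, hιs, hUm, hUp, hfinUm, hfinUp,
    hPM, hQM, hPU, hQU, hrangeP, hPUP, hQUQ, hfinQM, hfinPU, hfinQU, hLm, hLp,
    hιmapply, hPmmem, hQmmem, hbrLm, hirrLm, hιmmem, hιmιm, hPm, hQm, hfinPm, hfinQm, hPmQm, hdefPm, hdefQm, hadjLm,
    hιpapply, hPpmem, hQpmem, hbrLp, hirrLp, hιpmem, hιpιp, hPp, hQp, hfinPp, hfinQp, hPpQp, hdefPp, hdefQp, hadjLp,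
    hsplit⟩ :=
    UnitaryLeviSetup.exists_levi_pair hbr hirr hΘ hΘΘ hP hQ hadd hsymm hPQ hdefP hdefQ hadj hB hΘB hBΘ
  have hdich : ∀ X ∈ 𝔊, Θ * X = X → X * Θ = -X → X * ι = ι * X →
      Module.finrank ℂ (Up.map X) + Module.finrank ℂ (Um.map X) ≤ Module.finrank ℂ (LinearMap.range B) ∨
        (12 ≤ Module.finrank ℂ (Up.map X) ∧ 12 ≤ Module.finrank ℂ (Um.map X)) := fun X hX hΘX hXΘ hXc =>
    UnitaryLeviSetup.profile_dichotomy hbr hΘΘ hP hQ hadd hsymm hPQ hdefP hdefQ hadj hmin hB hΘB hBΘ hιι hιΘ hιs hUm hUp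
      hPM hQM hQU hfinQU hrangeP hX hΘX hXΘ hXc
  have hfinQU' := hfinQU
  rw [hr] at hfinQM hfinPU hfinQU hfinPm hfinQm hfinPp hfinQp hsplit hdich
  rw [hQ35] at hfinQM hfinQm hfinUm
  rw [hP14] at hfinPU hfinPp hfinUp
  have hcm : ∀ Z : Module.End ℂ W, Z * ι = ι * Z → ∀ x ∈ Um, Z x ∈ Um := fun Z hZ x hx =>
    (hUm _).2 (by rw [← Module.End.mul_apply, ← hZ, Module.End.mul_apply, (hUm x).1 hx, map_neg])
  have hcp : ∀ Z : Module.End ℂ W, Z * ι = ι * Z → ∀ x ∈ Up, Z x ∈ Up := fun Z hZ x hx =>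
    (hUp _).2 (by rw [← Module.End.mul_apply, ← hZ, Module.End.mul_apply, (hUp x).1 hx])
  have hfullm_of : Lm = ⊤ → False := fun h =>
    UnitaryLeviSetup.false_of_full_larger hbr hΘΘ hno1 hιι hιΘ hUm hUp (by omega) (by omega) hPM hQM (by omega)
      (by omega) hLm h
  have hkillm10 : ∀ X ∈ 𝔊, Θ * X = X → X * Θ = -X → X * ι = ι * X → Module.finrank ℂ (Um.map X) ≠ 10 := by
    intro X hX hΘX hXΘ hXc h10
    obtain ⟨hxmem, hιmx, hxιm, hxrk⟩ := UnitaryLeviSetup.restrict_mem hcm hLm hιmapply X hX hΘX hXΘ hXc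
    rw [h10] at hxrk
    refine hfullm_of (UnitaryDoubleLevi.eq_top_of_raise_of_core hbrLm hirrLm hιmmem hιmιm hPm hQm
      (s := fun v w : Um => s (v : W) w) (hsU Um) (fun v w => hsymm v w) hPmQm hdefPm hdefQm hadjLm hxmem hιmx hxιm
      (by rw [hxrk]; omega) (by omega) (by omega)
      fun U' 𝔩' ι' P' Q' hbr𝔩' hirr𝔩' hι' hι'ι' hP' hQ' hfinP' hfinQ' hP'Q' hdefP' hdefQ' hadj𝔩' => ?_)
    rw [hxrk] at hfinP' hfinQ'
    exact UnitaryThirteen.eq_top_of_smul' hbr𝔩' hirr𝔩' hι' hι'ι' hP' hQ' (by omega) (by omega) (s := fun x y : U' => s ((x : Um) : W) y) (fun x y z => by simp only [Submodule.coe_add, hadd]) (fun c x y => by simp only [Submodule.coe_smul, hsmul]) (fun x y => hsymm _ _) hP'Q' hdefP' hdefQ' hadj𝔩'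
  have hkillm11 : ∀ X ∈ 𝔊, Θ * X = X → X * Θ = -X → X * ι = ι * X → Module.finrank ℂ (Um.map X) ≠ 11 := by
    intro X hX hΘX hXΘ hXc h11
    obtain ⟨hxmem, hιmx, hxιm, hxrk⟩ := UnitaryLeviSetup.restrict_mem hcm hLm hιmapply X hX hΘX hXΘ hXc
    rw [h11] at hxrk
    refine hfullm_of (UnitaryDoubleLevi.eq_top_of_raise_of_core hbrLm hirrLm hιmmem hιmιm hPm hQm
      (s := fun v w : Um => s (v : W) w) (hsU Um) (fun v w => hsymm v w) hPmQm hdefPm hdefQm hadjLm hxmem hιmx hxιm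
      (by rw [hxrk]; omega) (by omega) (by omega)
      fun U' 𝔩' ι' P' Q' hbr𝔩' hirr𝔩' hι' hι'ι' hP' hQ' hfinP' hfinQ' hP'Q' hdefP' hdefQ' hadj𝔩' => ?_)
    rw [hxrk] at hfinP' hfinQ'
    exact UnitaryEleven.eq_top_of_smul hbr𝔩' hirr𝔩' hι' hι'ι' hP' hQ' hfinP' (by omega) (s := fun x y : U' => s ((x : Um) : W) y) (fun x y z => by simp only [Submodule.coe_add, hadd]) (fun c x y => by simp only [Submodule.coe_smul, hsmul]) (fun x y => hsymm _ _) hP'Q' hdefP' hdefQ' hadj𝔩'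
  have hkillm12 : ∀ X ∈ 𝔊, Θ * X = X → X * Θ = -X → X * ι = ι * X → Module.finrank ℂ (Um.map X) ≠ 12 := by
    intro X hX hΘX hXΘ hXc h12
    obtain ⟨hxmem, hιmx, hxιm, hxrk⟩ := UnitaryLeviSetup.restrict_mem hcm hLm hιmapply X hX hΘX hXΘ hXc
    rw [h12] at hxrk
    refine hfullm_of (UnitaryDoubleLevi.eq_top_of_raise_of_core hbrLm hirrLm hιmmem hιmιm hPm hQm
      (s := fun v w : Um => s (v : W) w) (hsU Um) (fun v w => hsymm v w) hPmQm hdefPm hdefQm hadjLm hxmem hιmx hxιm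
      (by rw [hxrk]; omega) (by omega) (by omega)
      fun U' 𝔩' ι' P' Q' hbr𝔩' hirr𝔩' hι' hι'ι' hP' hQ' hfinP' hfinQ' hP'Q' hdefP' hdefQ' hadj𝔩' => ?_)
    rw [hxrk] at hfinP' hfinQ'
    exact UnitaryEleven.eq_top_of_smul' hbr𝔩' hirr𝔩' hι' hι'ι' hP' hQ' (by omega) (by omega) (s := fun x y : U' => s ((x : Um) : W) y) (fun x y z => by simp only [Submodule.coe_add, hadd]) (fun c x y => by simp only [Submodule.coe_smul, hsmul]) (fun x y => hsymm _ _) hP'Q' hdefP' hdefQ' hadj𝔩'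
  have hfullp_of : Lp = ⊤ → False := by
    intro hLptop
    obtain ⟨T1, hιT1, hT1ι, hT1r⟩ := UnitaryRaisingSpace.exists_raise_finrank_range_eq hιpιp hPp hQp (k := 1)
      (by omega) (by omega)
    obtain ⟨X1, hX1, hΘX1, hX1Θ, hX1c, hX1Up⟩ := UnitaryLeviSetup.exists_lift hbr hΘ hΘΘ hcp hιΘ hLp hιpapply T1
      (by rw [hLptop]; exact Submodule.mem_top) hιT1 hT1ι
    rw [hT1r] at hX1Up
    obtain ⟨hs1, hi1, hi1', hj1, hj1'⟩ := hsplit X1 hΘX1 hX1Θ hX1c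
    have hrk1 := hS X1 hX1 hΘX1 hX1Θ
    have hd1 := hdich X1 hX1 hΘX1 hX1Θ hX1c
    rw [hs1] at hrk1
    rw [hX1Up] at hrk1 hd1
    have hk_hkillm11 := hkillm11 X1 hX1 hΘX1 hX1Θ hX1c
    omega
  have hprof : ∀ X ∈ 𝔊, Θ * X = X → X * Θ = -X → X * ι = ι * X →
      (Module.finrank ℂ (Up.map X) = 0 ∧ Module.finrank ℂ (Um.map X) = 0) := by
    intro X hX hΘX hXΘ hXc
    obtain ⟨hs, hi, hi', hj, hj'⟩ := hsplit X hΘX hXΘ hXc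
    have hkillm10' := hkillm10 X hX hΘX hXΘ hXc
    have hkillm11' := hkillm11 X hX hΘX hXΘ hXc
    have hkillm12' := hkillm12 X hX hΘX hXΘ hXc
    have hrk := hS X hX hΘX hXΘ
    have hd := hdich X hX hΘX hXΘ hXc
    rw [hs] at hrk
    generalize Module.finrank ℂ ↥(Submodule.map X Um) = jj at *
    have hjle : jj ≤ 12 := by omega
    interval_cases jj
    · exact ⟨by omega, rfl⟩
    · exfalso; omega
    · exfalso; omega
    · exfalso; omega
    · exfalso; omega
    · exfalso; omega
    · exfalso; omega
    · exfalso; omega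
    · exfalso; omega
    · exfalso; omega
    · exact (hkillm10' rfl).elim
    · exact (hkillm11' rfl).elim
    · exact (hkillm12' rfl).elim
  obtain ⟨⟨p, hp⟩, hp0⟩ := Module.finrank_pos_iff_exists_ne_zero.1 (show 0 < Module.finrank ℂ PU by omega)
  obtain ⟨⟨q, hq⟩, hq0⟩ := Module.finrank_pos_iff_exists_ne_zero.1 (show 0 < Module.finrank ℂ QU by omega)
  obtain ⟨X₀, hX₀, hΘX₀, hX₀Θ, hX₀c, c₀, hιc₀, -, hX₀c0⟩ :=
    UnitaryLeviFull.exists_raise_commute_apply_ne_zero hbr hirr hΘ hΘΘ hQ hιmem hιι hιΘ hUm hUp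
      ⟨p, fun h => hp0 (Subtype.ext h), ((hPU p).1 hp).1, ((hPU p).1 hp).2⟩
      ⟨q, fun h => hq0 (Subtype.ext h), ((hQU q).1 hq).1, ((hQU q).1 hq).2⟩
  have hX₀i : Module.finrank ℂ (Up.map X₀) ≠ 0 := fun h0 => by
    have hmem : X₀ c₀ ∈ Up.map X₀ := Submodule.mem_map_of_mem ((hUp c₀).2 hιc₀)
    rw [Submodule.finrank_eq_zero.1 h0, Submodule.mem_bot] at hmem
    exact hX₀c0 hmem
  have hp0 := hprof X₀ hX₀ hΘX₀ hX₀Θ hX₀c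
  omega

/-- Sub-Levi configuration for the `(18 | 65)` cell: a `Θ`-algebra of type `(16 | 49)` whose non-zero raising ranks are all `14` is impossible (the non-zero profiles [(0, 14), (2, 12)] are pairwise exclusive, so constant; `(2, 12)`: `L⁻` (type `(14 | 35)`) has constant rank `12`). [cite: Ribet1983, Thm. 3] [cite: Gordon1997, Thm. 6.3 (3)]
[cite: Deligne1982HodgeCycles, I §3 Prop. 3.4, 3.6] [cite: GoodmanWallachGTM255, §4.1.1] -/
theorem UnitaryEighteenSixtyFive.subSixteenFortyNine_rank14 [FiniteDimensional ℂ W] {𝔊 : Submodule ℂ (Module.End ℂ W)}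
    (hbr : ∀ Y ∈ 𝔊, ∀ Z ∈ 𝔊, Y * Z - Z * Y ∈ 𝔊)
    (hirr : ∀ U : Submodule ℂ W, (∀ A ∈ 𝔊, ∀ u ∈ U, A u ∈ U) → U = ⊥ ∨ U = ⊤)
    {Θ : Module.End ℂ W} (hΘ : Θ ∈ 𝔊) (hΘΘ : Θ * Θ = 1)
    {P Q : Submodule ℂ W} (hP : ∀ x, x ∈ P ↔ Θ x = x) (hQ : ∀ x, x ∈ Q ↔ Θ x = -x)
    (hP16 : Module.finrank ℂ P = 16) (hQ49 : Module.finrank ℂ Q = 49)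
    {s : W → W → ℂ} (hadd : ∀ x y z, s (x + y) z = s x z + s y z)
    (hsmul : ∀ (c : ℂ) (x y : W), s (c • x) y = c * s x y) (hsymm : ∀ x y, s y x = starRingEnd ℂ (s x y))
    (hPQ : ∀ p ∈ P, ∀ q ∈ Q, s p q = 0) (hdefP : ∀ p ∈ P, s p p = 0 → p = 0) (hdefQ : ∀ q ∈ Q, s q q = 0 → q = 0)
    (hadj : ∀ X ∈ 𝔊, ∃ Y ∈ 𝔊, ∀ x y, s (X x) y = s x (Y y))
    (hS : ∀ B' ∈ 𝔊, Θ * B' = B' → B' * Θ = -B' →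
      Module.finrank ℂ (LinearMap.range B') = 0 ∨ Module.finrank ℂ (LinearMap.range B') = 14)
    {B : Module.End ℂ W} (hB : B ∈ 𝔊) (hΘB : Θ * B = B) (hBΘ : B * Θ = -B)
    (hr : Module.finrank ℂ (LinearMap.range B) = 14) : False := by
  classical
  have hsU : ∀ U : Submodule ℂ W, ∀ x y z : U, s ((x + y : U) : W) z = s (x : W) z + s (y : W) z :=
    fun U x y z => by simp only [Submodule.coe_add, hadd]
  have hsmU : ∀ U : Submodule ℂ W, ∀ (c : ℂ) (x y : U), s ((c • x : U) : W) y = c * s (x : W) y :=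
    fun U c x y => by simp only [Submodule.coe_smul, hsmul]
  have hno1 : ∀ B' ∈ 𝔊, Θ * B' = B' → B' * Θ = -B' → Module.finrank ℂ (LinearMap.range B') ≠ 1 := by
    intro B' hB' hΘB' hB'Θ h1
    rcases hS B' hB' hΘB' hB'Θ with h | h <;> omega
  have hmin : ∀ Y ∈ 𝔊, Θ * Y = Y → Y * Θ = -Y → Y ≠ 0 → 14 ≤ Module.finrank ℂ (LinearMap.range Y) := by
    intro Y hY hΘY hYΘ hY0
    have h0 : Module.finrank ℂ (LinearMap.range Y) ≠ 0 := fun h =>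
      hY0 (LinearMap.range_eq_bot.1 (Submodule.finrank_eq_zero.1 h))
    rcases hS Y hY hΘY hYΘ with h | h <;> omega
  have hmin' : ∀ Z ∈ 𝔊, Θ * Z = Z → Z * Θ = -Z → Z ≠ 0 → Module.finrank ℂ (LinearMap.range B) ≤ Module.finrank ℂ (LinearMap.range Z) := by
    rw [hr]; exact hmin
  obtain ⟨ι, Um, Up, PU, QU, Lm, ιm, Pm, Qm, Lp, ιp, Pp, Qp, hιmem, hιι, hιΘ, hιs, hUm, hUp, hfinUm, hfinUp,
    hPM, hQM, hPU, hQU, hrangeP, hPUP, hQUQ, hfinQM, hfinPU, hfinQU, hLm, hLp,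
    hιmapply, hPmmem, hQmmem, hbrLm, hirrLm, hιmmem, hιmιm, hPm, hQm, hfinPm, hfinQm, hPmQm, hdefPm, hdefQm, hadjLm,
    hιpapply, hPpmem, hQpmem, hbrLp, hirrLp, hιpmem, hιpιp, hPp, hQp, hfinPp, hfinQp, hPpQp, hdefPp, hdefQp, hadjLp,
    hsplit⟩ :=
    UnitaryLeviSetup.exists_levi_pair hbr hirr hΘ hΘΘ hP hQ hadd hsymm hPQ hdefP hdefQ hadj hB hΘB hBΘ
  have hdich : ∀ X ∈ 𝔊, Θ * X = X → X * Θ = -X → X * ι = ι * X →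
      Module.finrank ℂ (Up.map X) + Module.finrank ℂ (Um.map X) ≤ Module.finrank ℂ (LinearMap.range B) ∨
        (14 ≤ Module.finrank ℂ (Up.map X) ∧ 14 ≤ Module.finrank ℂ (Um.map X)) := fun X hX hΘX hXΘ hXc =>
    UnitaryLeviSetup.profile_dichotomy hbr hΘΘ hP hQ hadd hsymm hPQ hdefP hdefQ hadj hmin hB hΘB hBΘ hιι hιΘ hιs hUm hUp
      hPM hQM hQU hfinQU hrangeP hX hΘX hXΘ hXc
  have hfinQU' := hfinQU
  rw [hr] at hfinQM hfinPU hfinQU hfinPm hfinQm hfinPp hfinQp hsplit hdich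
  rw [hQ49] at hfinQM hfinQm hfinUm
  rw [hP16] at hfinPU hfinPp hfinUp
  have hcm : ∀ Z : Module.End ℂ W, Z * ι = ι * Z → ∀ x ∈ Um, Z x ∈ Um := fun Z hZ x hx =>
    (hUm _).2 (by rw [← Module.End.mul_apply, ← hZ, Module.End.mul_apply, (hUm x).1 hx, map_neg])
  have hcp : ∀ Z : Module.End ℂ W, Z * ι = ι * Z → ∀ x ∈ Up, Z x ∈ Up := fun Z hZ x hx =>
    (hUp _).2 (by rw [← Module.End.mul_apply, ← hZ, Module.End.mul_apply, (hUp x).1 hx])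
  have hfullm_of : Lm = ⊤ → False := fun h =>
    UnitaryLeviSetup.false_of_full_larger hbr hΘΘ hno1 hιι hιΘ hUm hUp (by omega) (by omega) hPM hQM (by omega)
      (by omega) hLm h
  have hkillm13 : ∀ X ∈ 𝔊, Θ * X = X → X * Θ = -X → X * ι = ι * X → Module.finrank ℂ (Um.map X) ≠ 13 := by
    intro X hX hΘX hXΘ hXc h13
    obtain ⟨hxmem, hιmx, hxιm, hxrk⟩ := UnitaryLeviSetup.restrict_mem hcm hLm hιmapply X hX hΘX hXΘ hXc
    rw [h13] at hxrk
    refine hfullm_of (UnitaryDoubleLevi.eq_top_of_raise_of_core hbrLm hirrLm hιmmem hιmιm hPm hQm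
      (s := fun v w : Um => s (v : W) w) (hsU Um) (fun v w => hsymm v w) hPmQm hdefPm hdefQm hadjLm hxmem hιmx hxιm
      (by rw [hxrk]; omega) (by omega) (by omega)
      fun U' 𝔩' ι' P' Q' hbr𝔩' hirr𝔩' hι' hι'ι' hP' hQ' hfinP' hfinQ' hP'Q' hdefP' hdefQ' hadj𝔩' => ?_)
    rw [hxrk] at hfinP' hfinQ'
    exact UnitaryThirteen.eq_top_of_smul hbr𝔩' hirr𝔩' hι' hι'ι' hP' hQ' hfinP' (by omega) (s := fun x y : U' => s ((x : Um) : W) y) (fun x y z => by simp only [Submodule.coe_add, hadd]) (fun c x y => by simp only [Submodule.coe_smul, hsmul]) (fun x y => hsymm _ _) hP'Q' hdefP' hdefQ' hadj𝔩'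
  have hfullp_of : Lp = ⊤ → False := by
    intro hLptop
    obtain ⟨T1, hιT1, hT1ι, hT1r⟩ := UnitaryRaisingSpace.exists_raise_finrank_range_eq hιpιp hPp hQp (k := 1)
      (by omega) (by omega)
    obtain ⟨X1, hX1, hΘX1, hX1Θ, hX1c, hX1Up⟩ := UnitaryLeviSetup.exists_lift hbr hΘ hΘΘ hcp hιΘ hLp hιpapply T1
      (by rw [hLptop]; exact Submodule.mem_top) hιT1 hT1ι
    rw [hT1r] at hX1Up
    obtain ⟨hs1, hi1, hi1', hj1, hj1'⟩ := hsplit X1 hΘX1 hX1Θ hX1c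
    have hrk1 := hS X1 hX1 hΘX1 hX1Θ
    have hd1 := hdich X1 hX1 hΘX1 hX1Θ hX1c
    rw [hs1] at hrk1
    rw [hX1Up] at hrk1 hd1
    have hk_hkillm13 := hkillm13 X1 hX1 hΘX1 hX1Θ hX1c
    omega
  have hprof : ∀ X ∈ 𝔊, Θ * X = X → X * Θ = -X → X * ι = ι * X →
      (Module.finrank ℂ (Up.map X) = 0 ∧ Module.finrank ℂ (Um.map X) = 0) ∨
        (Module.finrank ℂ (Up.map X) = 0 ∧ Module.finrank ℂ (Um.map X) = 14) ∨
        (Module.finrank ℂ (Up.map X) = 2 ∧ Module.finrank ℂ (Um.map X) = 12) := by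
    intro X hX hΘX hXΘ hXc
    obtain ⟨hs, hi, hi', hj, hj'⟩ := hsplit X hΘX hXΘ hXc
    have hkillm13' := hkillm13 X hX hΘX hXΘ hXc
    have hrk := hS X hX hΘX hXΘ
    have hd := hdich X hX hΘX hXΘ hXc
    rw [hs] at hrk
    generalize Module.finrank ℂ ↥(Submodule.map X Um) = jj at *
    have hjle : jj ≤ 14 := by omega
    interval_cases jj
    · exact Or.inl ⟨by omega, rfl⟩
    · exfalso; omega
    · exfalso; omega
    · exfalso; omega
    · exfalso; omega
    · exfalso; omega
    · exfalso; omega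
    · exfalso; omega
    · exfalso; omega
    · exfalso; omega
    · exfalso; omega
    · exfalso; omega
    · exact Or.inr (Or.inr (⟨by omega, rfl⟩))
    · exact (hkillm13' rfl).elim
    · exact Or.inr (Or.inl ⟨by omega, rfl⟩)
  obtain ⟨⟨p, hp⟩, hp0⟩ := Module.finrank_pos_iff_exists_ne_zero.1 (show 0 < Module.finrank ℂ PU by omega)
  obtain ⟨⟨q, hq⟩, hq0⟩ := Module.finrank_pos_iff_exists_ne_zero.1 (show 0 < Module.finrank ℂ QU by omega)
  obtain ⟨X₀, hX₀, hΘX₀, hX₀Θ, hX₀c, c₀, hιc₀, -, hX₀c0⟩ :=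
    UnitaryLeviFull.exists_raise_commute_apply_ne_zero hbr hirr hΘ hΘΘ hQ hιmem hιι hιΘ hUm hUp
      ⟨p, fun h => hp0 (Subtype.ext h), ((hPU p).1 hp).1, ((hPU p).1 hp).2⟩
      ⟨q, fun h => hq0 (Subtype.ext h), ((hQU q).1 hq).1, ((hQU q).1 hq).2⟩
  have hX₀i : Module.finrank ℂ (Up.map X₀) ≠ 0 := fun h0 => by
    have hmem : X₀ c₀ ∈ Up.map X₀ := Submodule.mem_map_of_mem ((hUp c₀).2 hιc₀)
    rw [Submodule.finrank_eq_zero.1 h0, Submodule.mem_bot] at hmem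
    exact hX₀c0 hmem
  have hnotboth : ∀ X ∈ 𝔊, Θ * X = X → X * Θ = -X → X * ι = ι * X → ∀ X' ∈ 𝔊, Θ * X' = X' → X' * Θ = -X' →
      X' * ι = ι * X' → 14 < Module.finrank ℂ (Up.map X') + Module.finrank ℂ (Um.map X) → False := by
    intro X hX hΘX hXΘ hXc X' hX' hΘX' hX'Θ hX'c hgt
    obtain ⟨c, hc1, hc2⟩ := UnitaryGenericRank.exists_finrank_le_and_finrank_le (X'.restrict (hcp X' hX'c))
      (X.restrict (hcp X hXc)) (X.restrict (hcm X hXc)) (X'.restrict (hcm X' hX'c))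
    obtain ⟨hX₁, hΘX₁, hX₁Θ, hX₁c⟩ := UnitaryLeviSetup.add_smul_raise X hX hΘX hXΘ hXc X' hX' hΘX' hX'Θ hX'c c
    have hi₁ := UnitaryLeviSetup.finrank_map_add_smul hcp X X' hXc hX'c c hX₁c
    have hj₁ := UnitaryLeviSetup.finrank_map_add_smul hcm X X' hXc hX'c c hX₁c
    rw [UnitaryLeviRank.finrank_range_restrict] at hc1 hc2
    have hp := hprof (X + c • X') hX₁ hΘX₁ hX₁Θ hX₁c
    rw [hi₁, hj₁] at hp
    omega
  have hzero : ∀ X ∈ 𝔊, Θ * X = X → X * Θ = -X → X * ι = ι * X → Module.finrank ℂ (Up.map X) = 0 → Module.finrank ℂ (Um.map X) = 0 → X = 0 := by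
    intro X hX hΘX hXΘ hXc hi hj
    obtain ⟨hs, -, -, -, -⟩ := hsplit X hΘX hXΘ hXc
    rw [hi, hj, add_zero] at hs
    exact LinearMap.range_eq_bot.1 (Submodule.finrank_eq_zero.1 hs)
  rcases hprof X₀ hX₀ hΘX₀ hX₀Θ hX₀c with ⟨h0i, h0j⟩ | ⟨h0i, h0j⟩ | ⟨h0i, h0j⟩
  · exact hX₀i h0i
  · exact hX₀i h0i
  · -- constant profile `(2, 12)`
    have hprofc : ∀ X ∈ 𝔊, Θ * X = X → X * Θ = -X → X * ι = ι * X → X ≠ 0 →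
        Module.finrank ℂ (Up.map X) = 2 ∧ Module.finrank ℂ (Um.map X) = 12 := by
      intro X hX hΘX hXΘ hXc hX0
      rcases hprof X hX hΘX hXΘ hXc with ⟨hi, hj⟩ | ⟨hi, hj⟩ | ⟨hi, hj⟩
      · exact (hX0 (hzero X hX hΘX hXΘ hXc hi hj)).elim
      · exact (hnotboth X hX hΘX hXΘ hXc X₀ hX₀ hΘX₀ hX₀Θ hX₀c (by omega)).elim
      · exact ⟨hi, hj⟩
    obtain ⟨hxmem, hιmx, hxιm, hxrk⟩ := UnitaryLeviSetup.restrict_mem hcm hLm hιmapply X₀ hX₀ hΘX₀ hX₀Θ hX₀c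
    have hSm : ∀ A ∈ Lm, ιm * A = A → A * ιm = -A →
        Module.finrank ℂ (LinearMap.range A) = 0 ∨ Module.finrank ℂ (LinearMap.range A) = 12 := by
      intro A hA hιA hAι
      by_cases hA0 : A = 0
      · left; rw [hA0, LinearMap.range_zero, finrank_bot]
      · obtain ⟨XA, hXA, hΘXA, hXAΘ, hXAc, hXAUm⟩ :=
          UnitaryLeviSetup.exists_lift hbr hΘ hΘΘ hcm hιΘ hLm hιmapply A hA hιA hAι
        have hXA0 : XA ≠ 0 := fun h0 => hA0 (LinearMap.range_eq_bot.1 (Submodule.finrank_eq_zero.1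
          (by rw [← hXAUm, h0, Submodule.map_zero, finrank_bot])))
        right; rw [← hXAUm]; exact (hprofc XA hXA hΘXA hXAΘ hXAc hXA0).2
    exact UnitaryEighteenSixtyFive.subFourteenThirtyFive_rank12 hbrLm hirrLm hιmmem hιmιm hPm hQm (by omega) (by omega)
      (s := fun v w : Um => s (v : W) w) (hsU Um) (hsmU Um) (fun v w => hsymm v w) hPmQm hdefPm hdefQm hadjLm hSm
      hxmem hιmx hxιm (by rw [hxrk, h0j])

/-- Sub-Levi configuration for the `(18 | 65)` cell: a `Θ`-algebra of type `(17 | 48)` whose non-zero raising ranks are all `16` is impossible (`L⁺` of type `(1 | 16)` is full and a lift with `i = 1` has `j ∈ {15}`, killed in `L⁻` (type `(16 | 32)`)). [cite: Ribet1983, Thm. 3] [cite: Gordon1997, Thm. 6.3 (3)]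
[cite: Deligne1982HodgeCycles, I §3 Prop. 3.4, 3.6] [cite: GoodmanWallachGTM255, §4.1.1] -/
theorem UnitaryEighteenSixtyFive.subSeventeenFortyEight_rank16 [FiniteDimensional ℂ W] {𝔊 : Submodule ℂ (Module.End ℂ W)}
    (hbr : ∀ Y ∈ 𝔊, ∀ Z ∈ 𝔊, Y * Z - Z * Y ∈ 𝔊)
    (hirr : ∀ U : Submodule ℂ W, (∀ A ∈ 𝔊, ∀ u ∈ U, A u ∈ U) → U = ⊥ ∨ U = ⊤)
    {Θ : Module.End ℂ W} (hΘ : Θ ∈ 𝔊) (hΘΘ : Θ * Θ = 1)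
    {P Q : Submodule ℂ W} (hP : ∀ x, x ∈ P ↔ Θ x = x) (hQ : ∀ x, x ∈ Q ↔ Θ x = -x)
    (hP17 : Module.finrank ℂ P = 17) (hQ48 : Module.finrank ℂ Q = 48)
    {s : W → W → ℂ} (hadd : ∀ x y z, s (x + y) z = s x z + s y z)
    (hsmul : ∀ (c : ℂ) (x y : W), s (c • x) y = c * s x y) (hsymm : ∀ x y, s y x = starRingEnd ℂ (s x y))
    (hPQ : ∀ p ∈ P, ∀ q ∈ Q, s p q = 0) (hdefP : ∀ p ∈ P, s p p = 0 → p = 0) (hdefQ : ∀ q ∈ Q, s q q = 0 → q = 0)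
    (hadj : ∀ X ∈ 𝔊, ∃ Y ∈ 𝔊, ∀ x y, s (X x) y = s x (Y y))
    (hS : ∀ B' ∈ 𝔊, Θ * B' = B' → B' * Θ = -B' →
      Module.finrank ℂ (LinearMap.range B') = 0 ∨ Module.finrank ℂ (LinearMap.range B') = 16)
    {B : Module.End ℂ W} (hB : B ∈ 𝔊) (hΘB : Θ * B = B) (hBΘ : B * Θ = -B)
    (hr : Module.finrank ℂ (LinearMap.range B) = 16) : False := by
  classical
  have hsU : ∀ U : Submodule ℂ W, ∀ x y z : U, s ((x + y : U) : W) z = s (x : W) z + s (y : W) z :=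
    fun U x y z => by simp only [Submodule.coe_add, hadd]
  have hsmU : ∀ U : Submodule ℂ W, ∀ (c : ℂ) (x y : U), s ((c • x : U) : W) y = c * s (x : W) y :=
    fun U c x y => by simp only [Submodule.coe_smul, hsmul]
  have hno1 : ∀ B' ∈ 𝔊, Θ * B' = B' → B' * Θ = -B' → Module.finrank ℂ (LinearMap.range B') ≠ 1 := by
    intro B' hB' hΘB' hB'Θ h1
    rcases hS B' hB' hΘB' hB'Θ with h | h <;> omega
  have hmin : ∀ Y ∈ 𝔊, Θ * Y = Y → Y * Θ = -Y → Y ≠ 0 → 16 ≤ Module.finrank ℂ (LinearMap.range Y) := by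
    intro Y hY hΘY hYΘ hY0
    have h0 : Module.finrank ℂ (LinearMap.range Y) ≠ 0 := fun h =>
      hY0 (LinearMap.range_eq_bot.1 (Submodule.finrank_eq_zero.1 h))
    rcases hS Y hY hΘY hYΘ with h | h <;> omega
  have hmin' : ∀ Z ∈ 𝔊, Θ * Z = Z → Z * Θ = -Z → Z ≠ 0 → Module.finrank ℂ (LinearMap.range B) ≤ Module.finrank ℂ (LinearMap.range Z) := by
    rw [hr]; exact hmin
  obtain ⟨ι, Um, Up, PU, QU, Lm, ιm, Pm, Qm, Lp, ιp, Pp, Qp, hιmem, hιι, hιΘ, hιs, hUm, hUp, hfinUm, hfinUp,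
    hPM, hQM, hPU, hQU, hrangeP, hPUP, hQUQ, hfinQM, hfinPU, hfinQU, hLm, hLp,
    hιmapply, hPmmem, hQmmem, hbrLm, hirrLm, hιmmem, hιmιm, hPm, hQm, hfinPm, hfinQm, hPmQm, hdefPm, hdefQm, hadjLm,
    hιpapply, hPpmem, hQpmem, hbrLp, hirrLp, hιpmem, hιpιp, hPp, hQp, hfinPp, hfinQp, hPpQp, hdefPp, hdefQp, hadjLp,
    hsplit⟩ :=
    UnitaryLeviSetup.exists_levi_pair hbr hirr hΘ hΘΘ hP hQ hadd hsymm hPQ hdefP hdefQ hadj hB hΘB hBΘ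
  have hdich : ∀ X ∈ 𝔊, Θ * X = X → X * Θ = -X → X * ι = ι * X →
      Module.finrank ℂ (Up.map X) + Module.finrank ℂ (Um.map X) ≤ Module.finrank ℂ (LinearMap.range B) ∨
        (16 ≤ Module.finrank ℂ (Up.map X) ∧ 16 ≤ Module.finrank ℂ (Um.map X)) := fun X hX hΘX hXΘ hXc =>
    UnitaryLeviSetup.profile_dichotomy hbr hΘΘ hP hQ hadd hsymm hPQ hdefP hdefQ hadj hmin hB hΘB hBΘ hιι hιΘ hιs hUm hUp
      hPM hQM hQU hfinQU hrangeP hX hΘX hXΘ hXc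
  have hfinQU' := hfinQU
  rw [hr] at hfinQM hfinPU hfinQU hfinPm hfinQm hfinPp hfinQp hsplit hdich
  rw [hQ48] at hfinQM hfinQm hfinUm
  rw [hP17] at hfinPU hfinPp hfinUp
  have hcm : ∀ Z : Module.End ℂ W, Z * ι = ι * Z → ∀ x ∈ Um, Z x ∈ Um := fun Z hZ x hx =>
    (hUm _).2 (by rw [← Module.End.mul_apply, ← hZ, Module.End.mul_apply, (hUm x).1 hx, map_neg])
  have hcp : ∀ Z : Module.End ℂ W, Z * ι = ι * Z → ∀ x ∈ Up, Z x ∈ Up := fun Z hZ x hx =>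
    (hUp _).2 (by rw [← Module.End.mul_apply, ← hZ, Module.End.mul_apply, (hUp x).1 hx])
  have hfullm_of : Lm = ⊤ → False := fun h =>
    UnitaryLeviSetup.false_of_full_larger hbr hΘΘ hno1 hιι hιΘ hUm hUp (by omega) (by omega) hPM hQM (by omega)
      (by omega) hLm h
  have hkillm15 : ∀ X ∈ 𝔊, Θ * X = X → X * Θ = -X → X * ι = ι * X → Module.finrank ℂ (Um.map X) ≠ 15 := by
    intro X hX hΘX hXΘ hXc h15
    obtain ⟨hxmem, hιmx, hxιm, hxrk⟩ := UnitaryLeviSetup.restrict_mem hcm hLm hιmapply X hX hΘX hXΘ hXc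
    rw [h15] at hxrk
    refine hfullm_of (UnitaryDoubleLevi.eq_top_of_raise_of_core hbrLm hirrLm hιmmem hιmιm hPm hQm
      (s := fun v w : Um => s (v : W) w) (hsU Um) (fun v w => hsymm v w) hPmQm hdefPm hdefQm hadjLm hxmem hιmx hxιm
      (by rw [hxrk]; omega) (by omega) (by omega)
      fun U' 𝔩' ι' P' Q' hbr𝔩' hirr𝔩' hι' hι'ι' hP' hQ' hfinP' hfinQ' hP'Q' hdefP' hdefQ' hadj𝔩' => ?_)
    rw [hxrk] at hfinP' hfinQ'
    exact UnitarySeventeen.eq_top_of_smul hbr𝔩' hirr𝔩' hι' hι'ι' hP' hQ' (by omega) (by omega) (by omega) (s := fun x y : U' => s ((x : Um) : W) y) (fun x y z => by simp only [Submodule.coe_add, hadd]) (fun c x y => by simp only [Submodule.coe_smul, hsmul]) (fun x y => hsymm _ _) hP'Q' hdefP' hdefQ' hadj𝔩'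
  have hLptop : Lp = ⊤ :=
    UnitaryThreeCoprime.eq_top_of_finrank_eq_one hbrLp hirrLp (Submodule.neg_mem _ hιpmem) ((neg_mul_neg ιp ιp).trans hιpιp) (P := Qp) (Q := Pp) (fun x => by rw [hQp, LinearMap.neg_apply, neg_eq_iff_eq_neg]) (fun x => by rw [hPp, LinearMap.neg_apply, neg_inj]) (by omega) (by omega)
  obtain ⟨T1, hιT1, hT1ι, hT1r⟩ := UnitaryRaisingSpace.exists_raise_finrank_range_eq hιpιp hPp hQp (k := 1)
    (by omega) (by omega)
  obtain ⟨X1, hX1, hΘX1, hX1Θ, hX1c, hX1Up⟩ := UnitaryLeviSetup.exists_lift hbr hΘ hΘΘ hcp hιΘ hLp hιpapply T1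
    (by rw [hLptop]; exact Submodule.mem_top) hιT1 hT1ι
  rw [hT1r] at hX1Up
  obtain ⟨hs1, hi1, hi1', hj1, hj1'⟩ := hsplit X1 hΘX1 hX1Θ hX1c
  have hrk1 := hS X1 hX1 hΘX1 hX1Θ
  have hd1 := hdich X1 hX1 hΘX1 hX1Θ hX1c
  rw [hs1] at hrk1
  rw [hX1Up] at hrk1 hd1
  have hk_hkillm15 := hkillm15 X1 hX1 hΘX1 hX1Θ hX1c
  omega

/-! ### §2 The minimal-rank lemmas -/

/-- `(18 | 65)`, minimal rank `5`: `L⁺` of type `(13 | 5)` is full and a lift with `i = 4` has `j ∈ {1}`, killed in `L⁻` (type `(5 | 60)`). [cite: Ribet1983, Thm. 3] [cite: Gordon1997, Thm. 6.3 (3)]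
[cite: Deligne1982HodgeCycles, I §3 Prop. 3.4, 3.6] [cite: GoodmanWallachGTM255, §4.1.1] -/
theorem UnitaryEighteenSixtyFive.no_minRank_5 [FiniteDimensional ℂ W] {𝔊 : Submodule ℂ (Module.End ℂ W)}
    (hbr : ∀ Y ∈ 𝔊, ∀ Z ∈ 𝔊, Y * Z - Z * Y ∈ 𝔊)
    (hirr : ∀ U : Submodule ℂ W, (∀ A ∈ 𝔊, ∀ u ∈ U, A u ∈ U) → U = ⊥ ∨ U = ⊤)
    {Θ : Module.End ℂ W} (hΘ : Θ ∈ 𝔊) (hΘΘ : Θ * Θ = 1)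
    {P Q : Submodule ℂ W} (hP : ∀ x, x ∈ P ↔ Θ x = x) (hQ : ∀ x, x ∈ Q ↔ Θ x = -x)
    (hP18 : Module.finrank ℂ P = 18) (hQ65 : Module.finrank ℂ Q = 65)
    {s : W → W → ℂ} (hadd : ∀ x y z, s (x + y) z = s x z + s y z)
    (hsmul : ∀ (c : ℂ) (x y : W), s (c • x) y = c * s x y) (hsymm : ∀ x y, s y x = starRingEnd ℂ (s x y))
    (hPQ : ∀ p ∈ P, ∀ q ∈ Q, s p q = 0) (hdefP : ∀ p ∈ P, s p p = 0 → p = 0) (hdefQ : ∀ q ∈ Q, s q q = 0 → q = 0)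
    (hadj : ∀ X ∈ 𝔊, ∃ Y ∈ 𝔊, ∀ x y, s (X x) y = s x (Y y))
    (hS : ∀ B' ∈ 𝔊, Θ * B' = B' → B' * Θ = -B' →
      Module.finrank ℂ (LinearMap.range B') = 0 ∨ Module.finrank ℂ (LinearMap.range B') = 5 ∨ Module.finrank ℂ (LinearMap.range B') = 8 ∨ Module.finrank ℂ (LinearMap.range B') = 9 ∨ Module.finrank ℂ (LinearMap.range B') = 10 ∨ Module.finrank ℂ (LinearMap.range B') = 12 ∨ Module.finrank ℂ (LinearMap.range B') = 13 ∨ Module.finrank ℂ (LinearMap.range B') = 14 ∨ Module.finrank ℂ (LinearMap.range B') = 15 ∨ Module.finrank ℂ (LinearMap.range B') = 16 ∨ Module.finrank ℂ (LinearMap.range B') = 17 ∨ Module.finrank ℂ (LinearMap.range B') = 18)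
    {B : Module.End ℂ W} (hB : B ∈ 𝔊) (hΘB : Θ * B = B) (hBΘ : B * Θ = -B)
    (hr : Module.finrank ℂ (LinearMap.range B) = 5) : False := by
  classical
  have hsU : ∀ U : Submodule ℂ W, ∀ x y z : U, s ((x + y : U) : W) z = s (x : W) z + s (y : W) z :=
    fun U x y z => by simp only [Submodule.coe_add, hadd]
  have hsmU : ∀ U : Submodule ℂ W, ∀ (c : ℂ) (x y : U), s ((c • x : U) : W) y = c * s (x : W) y :=
    fun U c x y => by simp only [Submodule.coe_smul, hsmul]
  have hno1 : ∀ B' ∈ 𝔊, Θ * B' = B' → B' * Θ = -B' → Module.finrank ℂ (LinearMap.range B') ≠ 1 := by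
    intro B' hB' hΘB' hB'Θ h1
    rcases hS B' hB' hΘB' hB'Θ with h | h | h | h | h | h | h | h | h | h | h | h <;> omega
  have hmin : ∀ Y ∈ 𝔊, Θ * Y = Y → Y * Θ = -Y → Y ≠ 0 → 5 ≤ Module.finrank ℂ (LinearMap.range Y) := by
    intro Y hY hΘY hYΘ hY0
    have h0 : Module.finrank ℂ (LinearMap.range Y) ≠ 0 := fun h =>
      hY0 (LinearMap.range_eq_bot.1 (Submodule.finrank_eq_zero.1 h))
    rcases hS Y hY hΘY hYΘ with h | h | h | h | h | h | h | h | h | h | h | h <;> omega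
  have hmin' : ∀ Z ∈ 𝔊, Θ * Z = Z → Z * Θ = -Z → Z ≠ 0 → Module.finrank ℂ (LinearMap.range B) ≤ Module.finrank ℂ (LinearMap.range Z) := by
    rw [hr]; exact hmin
  obtain ⟨ι, Um, Up, PU, QU, Lm, ιm, Pm, Qm, Lp, ιp, Pp, Qp, hιmem, hιι, hιΘ, hιs, hUm, hUp, hfinUm, hfinUp,
    hPM, hQM, hPU, hQU, hrangeP, hPUP, hQUQ, hfinQM, hfinPU, hfinQU, hLm, hLp,
    hιmapply, hPmmem, hQmmem, hbrLm, hirrLm, hιmmem, hιmιm, hPm, hQm, hfinPm, hfinQm, hPmQm, hdefPm, hdefQm, hadjLm,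
    hιpapply, hPpmem, hQpmem, hbrLp, hirrLp, hιpmem, hιpιp, hPp, hQp, hfinPp, hfinQp, hPpQp, hdefPp, hdefQp, hadjLp,
    hsplit⟩ :=
    UnitaryLeviSetup.exists_levi_pair hbr hirr hΘ hΘΘ hP hQ hadd hsymm hPQ hdefP hdefQ hadj hB hΘB hBΘ
  have hdich : ∀ X ∈ 𝔊, Θ * X = X → X * Θ = -X → X * ι = ι * X →
      Module.finrank ℂ (Up.map X) + Module.finrank ℂ (Um.map X) ≤ Module.finrank ℂ (LinearMap.range B) ∨
        (5 ≤ Module.finrank ℂ (Up.map X) ∧ 5 ≤ Module.finrank ℂ (Um.map X)) := fun X hX hΘX hXΘ hXc =>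
    UnitaryLeviSetup.profile_dichotomy hbr hΘΘ hP hQ hadd hsymm hPQ hdefP hdefQ hadj hmin hB hΘB hBΘ hιι hιΘ hιs hUm hUp
      hPM hQM hQU hfinQU hrangeP hX hΘX hXΘ hXc
  have hfinQU' := hfinQU
  rw [hr] at hfinQM hfinPU hfinQU hfinPm hfinQm hfinPp hfinQp hsplit hdich
  rw [hQ65] at hfinQM hfinQm hfinUm
  rw [hP18] at hfinPU hfinPp hfinUp
  have hcm : ∀ Z : Module.End ℂ W, Z * ι = ι * Z → ∀ x ∈ Um, Z x ∈ Um := fun Z hZ x hx =>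
    (hUm _).2 (by rw [← Module.End.mul_apply, ← hZ, Module.End.mul_apply, (hUm x).1 hx, map_neg])
  have hcp : ∀ Z : Module.End ℂ W, Z * ι = ι * Z → ∀ x ∈ Up, Z x ∈ Up := fun Z hZ x hx =>
    (hUp _).2 (by rw [← Module.End.mul_apply, ← hZ, Module.End.mul_apply, (hUp x).1 hx])
  have hfullm_of : Lm = ⊤ → False := fun h =>
    UnitaryLeviSetup.false_of_full_larger hbr hΘΘ hno1 hιι hιΘ hUm hUp (by omega) (by omega) hPM hQM (by omega)
      (by omega) hLm h
  have hkillm1 : ∀ X ∈ 𝔊, Θ * X = X → X * Θ = -X → X * ι = ι * X → Module.finrank ℂ (Um.map X) ≠ 1 := by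
    intro X hX hΘX hXΘ hXc h1
    obtain ⟨hxmem, hιmx, hxιm, hxrk⟩ := UnitaryLeviSetup.restrict_mem hcm hLm hιmapply X hX hΘX hXΘ hXc
    rw [h1] at hxrk
    exact hfullm_of (UnitaryRankOneRaise.eq_top_of_rankOne_raise hbrLm hirrLm hιmmem hιmιm hPm hQm
      (s := fun v w : Um => s (v : W) w) (hsU Um) (fun v w => hsymm v w) hPmQm hdefPm hdefQm hadjLm hxmem hιmx hxιm
      hxrk (by omega) (by omega) (by omega))
  have hLptop : Lp = ⊤ :=
    UnitaryFive.eq_top_of_smul' hbrLp hirrLp hιpmem hιpιp hPp hQp (by omega) (by omega) (s := fun x y : Up => s (x : W) y) (fun x y z => by simp only [Submodule.coe_add, hadd]) (fun c x y => by simp only [Submodule.coe_smul, hsmul]) (fun x y => hsymm _ _) hPpQp hdefPp hdefQp hadjLp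
  obtain ⟨T4, hιT4, hT4ι, hT4r⟩ := UnitaryRaisingSpace.exists_raise_finrank_range_eq hιpιp hPp hQp (k := 4)
    (by omega) (by omega)
  obtain ⟨X4, hX4, hΘX4, hX4Θ, hX4c, hX4Up⟩ := UnitaryLeviSetup.exists_lift hbr hΘ hΘΘ hcp hιΘ hLp hιpapply T4
    (by rw [hLptop]; exact Submodule.mem_top) hιT4 hT4ι
  rw [hT4r] at hX4Up
  obtain ⟨hs4, hi4, hi4', hj4, hj4'⟩ := hsplit X4 hΘX4 hX4Θ hX4c
  have hrk4 := hS X4 hX4 hΘX4 hX4Θ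
  have hd4 := hdich X4 hX4 hΘX4 hX4Θ hX4c
  rw [hs4] at hrk4
  rw [hX4Up] at hrk4 hd4
  have hk_hkillm1 := hkillm1 X4 hX4 hΘX4 hX4Θ hX4c
  omega

/-- `(18 | 65)`, minimal rank `8`: after the Levi kills the profiles are [(0, 0), (0, 8), (2, 6), (5, 3), (8, 0), (8, 8)], so `L⁺` (type `(10 | 8)`) is a `Θ`-algebra with non-zero raising ranks in `{2, 5, 8}` — impossible by the sub-Levi lemmas. [cite: Ribet1983, Thm. 3] [cite: Gordon1997, Thm. 6.3 (3)]
[cite: Deligne1982HodgeCycles, I §3 Prop. 3.4, 3.6] [cite: GoodmanWallachGTM255, §4.1.1] -/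
theorem UnitaryEighteenSixtyFive.no_minRank_8 [FiniteDimensional ℂ W] {𝔊 : Submodule ℂ (Module.End ℂ W)}
    (hbr : ∀ Y ∈ 𝔊, ∀ Z ∈ 𝔊, Y * Z - Z * Y ∈ 𝔊)
    (hirr : ∀ U : Submodule ℂ W, (∀ A ∈ 𝔊, ∀ u ∈ U, A u ∈ U) → U = ⊥ ∨ U = ⊤)
    {Θ : Module.End ℂ W} (hΘ : Θ ∈ 𝔊) (hΘΘ : Θ * Θ = 1)
    {P Q : Submodule ℂ W} (hP : ∀ x, x ∈ P ↔ Θ x = x) (hQ : ∀ x, x ∈ Q ↔ Θ x = -x)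
    (hP18 : Module.finrank ℂ P = 18) (hQ65 : Module.finrank ℂ Q = 65)
    {s : W → W → ℂ} (hadd : ∀ x y z, s (x + y) z = s x z + s y z)
    (hsmul : ∀ (c : ℂ) (x y : W), s (c • x) y = c * s x y) (hsymm : ∀ x y, s y x = starRingEnd ℂ (s x y))
    (hPQ : ∀ p ∈ P, ∀ q ∈ Q, s p q = 0) (hdefP : ∀ p ∈ P, s p p = 0 → p = 0) (hdefQ : ∀ q ∈ Q, s q q = 0 → q = 0)
    (hadj : ∀ X ∈ 𝔊, ∃ Y ∈ 𝔊, ∀ x y, s (X x) y = s x (Y y))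
    (hS : ∀ B' ∈ 𝔊, Θ * B' = B' → B' * Θ = -B' →
      Module.finrank ℂ (LinearMap.range B') = 0 ∨ Module.finrank ℂ (LinearMap.range B') = 8 ∨ Module.finrank ℂ (LinearMap.range B') = 9 ∨ Module.finrank ℂ (LinearMap.range B') = 10 ∨ Module.finrank ℂ (LinearMap.range B') = 12 ∨ Module.finrank ℂ (LinearMap.range B') = 13 ∨ Module.finrank ℂ (LinearMap.range B') = 14 ∨ Module.finrank ℂ (LinearMap.range B') = 15 ∨ Module.finrank ℂ (LinearMap.range B') = 16 ∨ Module.finrank ℂ (LinearMap.range B') = 17 ∨ Module.finrank ℂ (LinearMap.range B') = 18)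
    {B : Module.End ℂ W} (hB : B ∈ 𝔊) (hΘB : Θ * B = B) (hBΘ : B * Θ = -B)
    (hr : Module.finrank ℂ (LinearMap.range B) = 8) : False := by
  classical
  have hsU : ∀ U : Submodule ℂ W, ∀ x y z : U, s ((x + y : U) : W) z = s (x : W) z + s (y : W) z :=
    fun U x y z => by simp only [Submodule.coe_add, hadd]
  have hsmU : ∀ U : Submodule ℂ W, ∀ (c : ℂ) (x y : U), s ((c • x : U) : W) y = c * s (x : W) y :=
    fun U c x y => by simp only [Submodule.coe_smul, hsmul]
  have hno1 : ∀ B' ∈ 𝔊, Θ * B' = B' → B' * Θ = -B' → Module.finrank ℂ (LinearMap.range B') ≠ 1 := by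
    intro B' hB' hΘB' hB'Θ h1
    rcases hS B' hB' hΘB' hB'Θ with h | h | h | h | h | h | h | h | h | h | h <;> omega
  have hmin : ∀ Y ∈ 𝔊, Θ * Y = Y → Y * Θ = -Y → Y ≠ 0 → 8 ≤ Module.finrank ℂ (LinearMap.range Y) := by
    intro Y hY hΘY hYΘ hY0
    have h0 : Module.finrank ℂ (LinearMap.range Y) ≠ 0 := fun h =>
      hY0 (LinearMap.range_eq_bot.1 (Submodule.finrank_eq_zero.1 h))
    rcases hS Y hY hΘY hYΘ with h | h | h | h | h | h | h | h | h | h | h <;> omega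
  have hmin' : ∀ Z ∈ 𝔊, Θ * Z = Z → Z * Θ = -Z → Z ≠ 0 → Module.finrank ℂ (LinearMap.range B) ≤ Module.finrank ℂ (LinearMap.range Z) := by
    rw [hr]; exact hmin
  obtain ⟨ι, Um, Up, PU, QU, Lm, ιm, Pm, Qm, Lp, ιp, Pp, Qp, hιmem, hιι, hιΘ, hιs, hUm, hUp, hfinUm, hfinUp,
    hPM, hQM, hPU, hQU, hrangeP, hPUP, hQUQ, hfinQM, hfinPU, hfinQU, hLm, hLp,
    hιmapply, hPmmem, hQmmem, hbrLm, hirrLm, hιmmem, hιmιm, hPm, hQm, hfinPm, hfinQm, hPmQm, hdefPm, hdefQm, hadjLm,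
    hιpapply, hPpmem, hQpmem, hbrLp, hirrLp, hιpmem, hιpιp, hPp, hQp, hfinPp, hfinQp, hPpQp, hdefPp, hdefQp, hadjLp,
    hsplit⟩ :=
    UnitaryLeviSetup.exists_levi_pair hbr hirr hΘ hΘΘ hP hQ hadd hsymm hPQ hdefP hdefQ hadj hB hΘB hBΘ
  have hdich : ∀ X ∈ 𝔊, Θ * X = X → X * Θ = -X → X * ι = ι * X →
      Module.finrank ℂ (Up.map X) + Module.finrank ℂ (Um.map X) ≤ Module.finrank ℂ (LinearMap.range B) ∨
        (8 ≤ Module.finrank ℂ (Up.map X) ∧ 8 ≤ Module.finrank ℂ (Um.map X)) := fun X hX hΘX hXΘ hXc =>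
    UnitaryLeviSetup.profile_dichotomy hbr hΘΘ hP hQ hadd hsymm hPQ hdefP hdefQ hadj hmin hB hΘB hBΘ hιι hιΘ hιs hUm hUp
      hPM hQM hQU hfinQU hrangeP hX hΘX hXΘ hXc
  have hfinQU' := hfinQU
  rw [hr] at hfinQM hfinPU hfinQU hfinPm hfinQm hfinPp hfinQp hsplit hdich
  rw [hQ65] at hfinQM hfinQm hfinUm
  rw [hP18] at hfinPU hfinPp hfinUp
  have hcm : ∀ Z : Module.End ℂ W, Z * ι = ι * Z → ∀ x ∈ Um, Z x ∈ Um := fun Z hZ x hx =>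
    (hUm _).2 (by rw [← Module.End.mul_apply, ← hZ, Module.End.mul_apply, (hUm x).1 hx, map_neg])
  have hcp : ∀ Z : Module.End ℂ W, Z * ι = ι * Z → ∀ x ∈ Up, Z x ∈ Up := fun Z hZ x hx =>
    (hUp _).2 (by rw [← Module.End.mul_apply, ← hZ, Module.End.mul_apply, (hUp x).1 hx])
  have hfullm_of : Lm = ⊤ → False := fun h =>
    UnitaryLeviSetup.false_of_full_larger hbr hΘΘ hno1 hιι hιΘ hUm hUp (by omega) (by omega) hPM hQM (by omega)
      (by omega) hLm h
  have hkillm1 : ∀ X ∈ 𝔊, Θ * X = X → X * Θ = -X → X * ι = ι * X → Module.finrank ℂ (Um.map X) ≠ 1 := by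
    intro X hX hΘX hXΘ hXc h1
    obtain ⟨hxmem, hιmx, hxιm, hxrk⟩ := UnitaryLeviSetup.restrict_mem hcm hLm hιmapply X hX hΘX hXΘ hXc
    rw [h1] at hxrk
    exact hfullm_of (UnitaryRankOneRaise.eq_top_of_rankOne_raise hbrLm hirrLm hιmmem hιmιm hPm hQm
      (s := fun v w : Um => s (v : W) w) (hsU Um) (fun v w => hsymm v w) hPmQm hdefPm hdefQm hadjLm hxmem hιmx hxιm
      hxrk (by omega) (by omega) (by omega))
  have hkillm2 : ∀ X ∈ 𝔊, Θ * X = X → X * Θ = -X → X * ι = ι * X → Module.finrank ℂ (Um.map X) ≠ 2 := by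
    intro X hX hΘX hXΘ hXc h2
    obtain ⟨hxmem, hιmx, hxιm, hxrk⟩ := UnitaryLeviSetup.restrict_mem hcm hLm hιmapply X hX hΘX hXΘ hXc
    rw [h2] at hxrk
    refine hfullm_of (UnitaryDoubleLevi.eq_top_of_raise_of_core hbrLm hirrLm hιmmem hιmιm hPm hQm
      (s := fun v w : Um => s (v : W) w) (hsU Um) (fun v w => hsymm v w) hPmQm hdefPm hdefQm hadjLm hxmem hιmx hxιm
      (by rw [hxrk]; omega) (by omega) (by omega)
      fun U' 𝔩' ι' P' Q' hbr𝔩' hirr𝔩' hι' hι'ι' hP' hQ' hfinP' hfinQ' hP'Q' hdefP' hdefQ' hadj𝔩' => ?_)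
    rw [hxrk] at hfinP' hfinQ'
    exact UnitaryTwoOdd.eq_top hbr𝔩' hirr𝔩' hι' hι'ι' hP' hQ' hfinP' ⟨27, by omega⟩ (s := fun x y : U' => s ((x : Um) : W) y) (fun x y z => by simp only [Submodule.coe_add, hadd]) (fun x y => hsymm _ _) hP'Q' hdefP' hdefQ' hadj𝔩'
  have hkillm4 : ∀ X ∈ 𝔊, Θ * X = X → X * Θ = -X → X * ι = ι * X → Module.finrank ℂ (Um.map X) ≠ 4 := by
    intro X hX hΘX hXΘ hXc h4
    obtain ⟨hxmem, hιmx, hxιm, hxrk⟩ := UnitaryLeviSetup.restrict_mem hcm hLm hιmapply X hX hΘX hXΘ hXc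
    rw [h4] at hxrk
    refine hfullm_of (UnitaryDoubleLevi.eq_top_of_raise_of_core hbrLm hirrLm hιmmem hιmιm hPm hQm
      (s := fun v w : Um => s (v : W) w) (hsU Um) (fun v w => hsymm v w) hPmQm hdefPm hdefQm hadjLm hxmem hιmx hxιm
      (by rw [hxrk]; omega) (by omega) (by omega)
      fun U' 𝔩' ι' P' Q' hbr𝔩' hirr𝔩' hι' hι'ι' hP' hQ' hfinP' hfinQ' hP'Q' hdefP' hdefQ' hadj𝔩' => ?_)
    rw [hxrk] at hfinP' hfinQ'
    exact UnitaryFourOdd.eq_top hbr𝔩' hirr𝔩' hι' hι'ι' hP' hQ' hfinP' ⟨26, by omega⟩ (s := fun x y : U' => s ((x : Um) : W) y) (fun x y z => by simp only [Submodule.coe_add, hadd]) (fun x y => hsymm _ _) hP'Q' hdefP' hdefQ' hadj𝔩'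
  have hkillm5 : ∀ X ∈ 𝔊, Θ * X = X → X * Θ = -X → X * ι = ι * X → Module.finrank ℂ (Um.map X) ≠ 5 := by
    intro X hX hΘX hXΘ hXc h5
    obtain ⟨hxmem, hιmx, hxιm, hxrk⟩ := UnitaryLeviSetup.restrict_mem hcm hLm hιmapply X hX hΘX hXΘ hXc
    rw [h5] at hxrk
    refine hfullm_of (UnitaryDoubleLevi.eq_top_of_raise_of_core hbrLm hirrLm hιmmem hιmιm hPm hQm
      (s := fun v w : Um => s (v : W) w) (hsU Um) (fun v w => hsymm v w) hPmQm hdefPm hdefQm hadjLm hxmem hιmx hxιm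
      (by rw [hxrk]; omega) (by omega) (by omega)
      fun U' 𝔩' ι' P' Q' hbr𝔩' hirr𝔩' hι' hι'ι' hP' hQ' hfinP' hfinQ' hP'Q' hdefP' hdefQ' hadj𝔩' => ?_)
    rw [hxrk] at hfinP' hfinQ'
    exact UnitaryFive.eq_top_of_smul hbr𝔩' hirr𝔩' hι' hι'ι' hP' hQ' hfinP' (by omega) (s := fun x y : U' => s ((x : Um) : W) y) (fun x y z => by simp only [Submodule.coe_add, hadd]) (fun c x y => by simp only [Submodule.coe_smul, hsmul]) (fun x y => hsymm _ _) hP'Q' hdefP' hdefQ' hadj𝔩'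
  have hkillm7 : ∀ X ∈ 𝔊, Θ * X = X → X * Θ = -X → X * ι = ι * X → Module.finrank ℂ (Um.map X) ≠ 7 := by
    intro X hX hΘX hXΘ hXc h7
    obtain ⟨hxmem, hιmx, hxιm, hxrk⟩ := UnitaryLeviSetup.restrict_mem hcm hLm hιmapply X hX hΘX hXΘ hXc
    rw [h7] at hxrk
    refine hfullm_of (UnitaryDoubleLevi.eq_top_of_raise_of_core hbrLm hirrLm hιmmem hιmιm hPm hQm
      (s := fun v w : Um => s (v : W) w) (hsU Um) (fun v w => hsymm v w) hPmQm hdefPm hdefQm hadjLm hxmem hιmx hxιm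
      (by rw [hxrk]; omega) (by omega) (by omega)
      fun U' 𝔩' ι' P' Q' hbr𝔩' hirr𝔩' hι' hι'ι' hP' hQ' hfinP' hfinQ' hP'Q' hdefP' hdefQ' hadj𝔩' => ?_)
    rw [hxrk] at hfinP' hfinQ'
    exact UnitarySeven.eq_top_of_smul hbr𝔩' hirr𝔩' hι' hι'ι' hP' hQ' hfinP' (by omega) (s := fun x y : U' => s ((x : Um) : W) y) (fun x y z => by simp only [Submodule.coe_add, hadd]) (fun c x y => by simp only [Submodule.coe_smul, hsmul]) (fun x y => hsymm _ _) hP'Q' hdefP' hdefQ' hadj𝔩'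
  have hfullp_of : Lp = ⊤ → False := by
    intro hLptop
    obtain ⟨T1, hιT1, hT1ι, hT1r⟩ := UnitaryRaisingSpace.exists_raise_finrank_range_eq hιpιp hPp hQp (k := 1)
      (by omega) (by omega)
    obtain ⟨X1, hX1, hΘX1, hX1Θ, hX1c, hX1Up⟩ := UnitaryLeviSetup.exists_lift hbr hΘ hΘΘ hcp hιΘ hLp hιpapply T1
      (by rw [hLptop]; exact Submodule.mem_top) hιT1 hT1ι
    rw [hT1r] at hX1Up
    obtain ⟨hs1, hi1, hi1', hj1, hj1'⟩ := hsplit X1 hΘX1 hX1Θ hX1c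
    have hrk1 := hS X1 hX1 hΘX1 hX1Θ
    have hd1 := hdich X1 hX1 hΘX1 hX1Θ hX1c
    rw [hs1] at hrk1
    rw [hX1Up] at hrk1 hd1
    have hk_hkillm7 := hkillm7 X1 hX1 hΘX1 hX1Θ hX1c
    omega
  have hprof : ∀ X ∈ 𝔊, Θ * X = X → X * Θ = -X → X * ι = ι * X →
      (Module.finrank ℂ (Up.map X) = 0 ∧ Module.finrank ℂ (Um.map X) = 0) ∨
        (Module.finrank ℂ (Up.map X) = 0 ∧ Module.finrank ℂ (Um.map X) = 8) ∨
        (Module.finrank ℂ (Up.map X) = 2 ∧ Module.finrank ℂ (Um.map X) = 6) ∨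
        (Module.finrank ℂ (Up.map X) = 5 ∧ Module.finrank ℂ (Um.map X) = 3) ∨
        (Module.finrank ℂ (Up.map X) = 8 ∧ Module.finrank ℂ (Um.map X) = 0) ∨
        (Module.finrank ℂ (Up.map X) = 8 ∧ Module.finrank ℂ (Um.map X) = 8) := by
    intro X hX hΘX hXΘ hXc
    obtain ⟨hs, hi, hi', hj, hj'⟩ := hsplit X hΘX hXΘ hXc
    have hkillm1' := hkillm1 X hX hΘX hXΘ hXc
    have hkillm2' := hkillm2 X hX hΘX hXΘ hXc
    have hkillm4' := hkillm4 X hX hΘX hXΘ hXc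
    have hkillm5' := hkillm5 X hX hΘX hXΘ hXc
    have hkillm7' := hkillm7 X hX hΘX hXΘ hXc
    have hrk := hS X hX hΘX hXΘ
    have hd := hdich X hX hΘX hXΘ hXc
    rw [hs] at hrk
    generalize Module.finrank ℂ ↥(Submodule.map X Um) = jj at *
    have hjle : jj ≤ 8 := by omega
    interval_cases jj
    · rcases (show Module.finrank ℂ (Up.map X) = 0 ∨ Module.finrank ℂ (Up.map X) = 8 by omega) with h | h
      · exact Or.inl ⟨h, rfl⟩
      · exact Or.inr (Or.inr (Or.inr (Or.inr (Or.inl ⟨h, rfl⟩))))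
    · exact (hkillm1' rfl).elim
    · exact (hkillm2' rfl).elim
    · exact Or.inr (Or.inr (Or.inr (Or.inl ⟨by omega, rfl⟩)))
    · exact (hkillm4' rfl).elim
    · exact (hkillm5' rfl).elim
    · exact Or.inr (Or.inr (Or.inl ⟨by omega, rfl⟩))
    · exact (hkillm7' rfl).elim
    · rcases (show Module.finrank ℂ (Up.map X) = 0 ∨ Module.finrank ℂ (Up.map X) = 8 by omega) with h | h
      · exact Or.inr (Or.inl ⟨h, rfl⟩)
      · exact Or.inr (Or.inr (Or.inr (Or.inr (Or.inr (⟨h, rfl⟩)))))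
  obtain ⟨⟨p, hp⟩, hp0⟩ := Module.finrank_pos_iff_exists_ne_zero.1 (show 0 < Module.finrank ℂ PU by omega)
  obtain ⟨⟨q, hq⟩, hq0⟩ := Module.finrank_pos_iff_exists_ne_zero.1 (show 0 < Module.finrank ℂ QU by omega)
  obtain ⟨X₀, hX₀, hΘX₀, hX₀Θ, hX₀c, c₀, hιc₀, -, hX₀c0⟩ :=
    UnitaryLeviFull.exists_raise_commute_apply_ne_zero hbr hirr hΘ hΘΘ hQ hιmem hιι hιΘ hUm hUp
      ⟨p, fun h => hp0 (Subtype.ext h), ((hPU p).1 hp).1, ((hPU p).1 hp).2⟩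
      ⟨q, fun h => hq0 (Subtype.ext h), ((hQU q).1 hq).1, ((hQU q).1 hq).2⟩
  have hX₀i : Module.finrank ℂ (Up.map X₀) ≠ 0 := fun h0 => by
    have hmem : X₀ c₀ ∈ Up.map X₀ := Submodule.mem_map_of_mem ((hUp c₀).2 hιc₀)
    rw [Submodule.finrank_eq_zero.1 h0, Submodule.mem_bot] at hmem
    exact hX₀c0 hmem
  -- the raising ranks of `L⁺` lie in {0, 2, 5, 8}
  have hSsub : ∀ A ∈ Lp, ιp * A = A → A * ιp = -A → Module.finrank ℂ (LinearMap.range A) = 0 ∨ Module.finrank ℂ (LinearMap.range A) = 2 ∨ Module.finrank ℂ (LinearMap.range A) = 5 ∨ Module.finrank ℂ (LinearMap.range A) = 8 := by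
    intro A hA hιA hAι
    by_cases hA0 : A = 0
    · exact Or.inl (by rw [hA0, LinearMap.range_zero, finrank_bot])
    · obtain ⟨XA, hXA, hΘXA, hXAΘ, hXAc, hXAU⟩ := UnitaryLeviSetup.exists_lift hbr hΘ hΘΘ hcp hιΘ hLp hιpapply A hA hιA hAι
      have hA0' : Module.finrank ℂ (LinearMap.range A) ≠ 0 := fun h =>
        hA0 (LinearMap.range_eq_bot.1 (Submodule.finrank_eq_zero.1 h))
      have hpA := hprof XA hXA hΘXA hXAΘ hXAc
      rw [← hXAU] at hA0' ⊢
      omega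
  obtain ⟨hymem, hιy, hyι, hyrk⟩ := UnitaryLeviSetup.restrict_mem hcp hLp hιpapply X₀ hX₀ hΘX₀ hX₀Θ hX₀c
  obtain ⟨A₀, hA₀, hιA₀, hA₀ι, hA₀0, hA₀min⟩ := UnitaryRaisingSpace.exists_minRank_raise Lp ιp
    ⟨_, hymem, hιy, hyι, fun h => by rw [h, LinearMap.range_zero, finrank_bot] at hyrk; omega⟩
  have hr0 : Module.finrank ℂ (LinearMap.range A₀) ≠ 0 := fun h =>
    hA₀0 (LinearMap.range_eq_bot.1 (Submodule.finrank_eq_zero.1 h))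
  rcases hSsub A₀ hA₀ hιA₀ hA₀ι with hrA | hrA | hrA | hrA
  · exact hr0 hrA
  · refine UnitaryEighteenSixtyFive.subTenEight_ranks2_5_8_min2 hbrLp hirrLp hιpmem hιpιp hPp hQp (by omega) (by omega)
      (s := fun v w : Up => s (v : W) w) (hsU Up) (hsmU Up) (fun v w => hsymm v w) hPpQp hdefPp hdefQp hadjLp
      (fun A hA hιA hAι => ?_) hA₀ hιA₀ hA₀ι hrA
    have h1 := hSsub A hA hιA hAι
    by_cases hA0 : A = 0
    · exact Or.inl (by rw [hA0, LinearMap.range_zero, finrank_bot])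
    · have h2 := hA₀min A hA hιA hAι hA0
      omega
  · refine UnitaryEighteenSixtyFive.subTenEight_ranks5_8_min5 hbrLp hirrLp hιpmem hιpιp hPp hQp (by omega) (by omega)
      (s := fun v w : Up => s (v : W) w) (hsU Up) (hsmU Up) (fun v w => hsymm v w) hPpQp hdefPp hdefQp hadjLp
      (fun A hA hιA hAι => ?_) hA₀ hιA₀ hA₀ι hrA
    have h1 := hSsub A hA hιA hAι
    by_cases hA0 : A = 0
    · exact Or.inl (by rw [hA0, LinearMap.range_zero, finrank_bot])
    · have h2 := hA₀min A hA hιA hAι hA0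
      omega
  · refine UnitaryEighteenSixtyFive.subTenEight_rank8 hbrLp hirrLp hιpmem hιpιp hPp hQp (by omega) (by omega)
      (s := fun v w : Up => s (v : W) w) (hsU Up) (hsmU Up) (fun v w => hsymm v w) hPpQp hdefPp hdefQp hadjLp
      (fun A hA hιA hAι => ?_) hA₀ hιA₀ hA₀ι hrA
    have h1 := hSsub A hA hιA hAι
    by_cases hA0 : A = 0
    · exact Or.inl (by rw [hA0, LinearMap.range_zero, finrank_bot])
    · have h2 := hA₀min A hA hιA hAι hA0
      omega

/-- `(18 | 65)`, minimal rank `9`: after the Levi kills the profiles are [(0, 0), (0, 9), (1, 8), (2, 7), (3, 6), (5, 4), (7, 2), (9, 0), (9, 9)], so `L⁻` (type `(9 | 56)`) is a `Θ`-algebra with non-zero raising ranks in `{2, 4, 6, 7, 8, 9}` — impossible by the sub-Levi lemmas. [cite: Ribet1983, Thm. 3] [cite: Gordon1997, Thm. 6.3 (3)]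
[cite: Deligne1982HodgeCycles, I §3 Prop. 3.4, 3.6] [cite: GoodmanWallachGTM255, §4.1.1] -/
theorem UnitaryEighteenSixtyFive.no_minRank_9 [FiniteDimensional ℂ W] {𝔊 : Submodule ℂ (Module.End ℂ W)}
    (hbr : ∀ Y ∈ 𝔊, ∀ Z ∈ 𝔊, Y * Z - Z * Y ∈ 𝔊)
    (hirr : ∀ U : Submodule ℂ W, (∀ A ∈ 𝔊, ∀ u ∈ U, A u ∈ U) → U = ⊥ ∨ U = ⊤)
    {Θ : Module.End ℂ W} (hΘ : Θ ∈ 𝔊) (hΘΘ : Θ * Θ = 1)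
    {P Q : Submodule ℂ W} (hP : ∀ x, x ∈ P ↔ Θ x = x) (hQ : ∀ x, x ∈ Q ↔ Θ x = -x)
    (hP18 : Module.finrank ℂ P = 18) (hQ65 : Module.finrank ℂ Q = 65)
    {s : W → W → ℂ} (hadd : ∀ x y z, s (x + y) z = s x z + s y z)
    (hsmul : ∀ (c : ℂ) (x y : W), s (c • x) y = c * s x y) (hsymm : ∀ x y, s y x = starRingEnd ℂ (s x y))
    (hPQ : ∀ p ∈ P, ∀ q ∈ Q, s p q = 0) (hdefP : ∀ p ∈ P, s p p = 0 → p = 0) (hdefQ : ∀ q ∈ Q, s q q = 0 → q = 0)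
    (hadj : ∀ X ∈ 𝔊, ∃ Y ∈ 𝔊, ∀ x y, s (X x) y = s x (Y y))
    (hS : ∀ B' ∈ 𝔊, Θ * B' = B' → B' * Θ = -B' →
      Module.finrank ℂ (LinearMap.range B') = 0 ∨ Module.finrank ℂ (LinearMap.range B') = 9 ∨ Module.finrank ℂ (LinearMap.range B') = 10 ∨ Module.finrank ℂ (LinearMap.range B') = 12 ∨ Module.finrank ℂ (LinearMap.range B') = 13 ∨ Module.finrank ℂ (LinearMap.range B') = 14 ∨ Module.finrank ℂ (LinearMap.range B') = 15 ∨ Module.finrank ℂ (LinearMap.range B') = 16 ∨ Module.finrank ℂ (LinearMap.range B') = 17 ∨ Module.finrank ℂ (LinearMap.range B') = 18)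
    {B : Module.End ℂ W} (hB : B ∈ 𝔊) (hΘB : Θ * B = B) (hBΘ : B * Θ = -B)
    (hr : Module.finrank ℂ (LinearMap.range B) = 9) : False := by
  classical
  have hsU : ∀ U : Submodule ℂ W, ∀ x y z : U, s ((x + y : U) : W) z = s (x : W) z + s (y : W) z :=
    fun U x y z => by simp only [Submodule.coe_add, hadd]
  have hsmU : ∀ U : Submodule ℂ W, ∀ (c : ℂ) (x y : U), s ((c • x : U) : W) y = c * s (x : W) y :=
    fun U c x y => by simp only [Submodule.coe_smul, hsmul]
  have hno1 : ∀ B' ∈ 𝔊, Θ * B' = B' → B' * Θ = -B' → Module.finrank ℂ (LinearMap.range B') ≠ 1 := by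
    intro B' hB' hΘB' hB'Θ h1
    rcases hS B' hB' hΘB' hB'Θ with h | h | h | h | h | h | h | h | h | h <;> omega
  have hmin : ∀ Y ∈ 𝔊, Θ * Y = Y → Y * Θ = -Y → Y ≠ 0 → 9 ≤ Module.finrank ℂ (LinearMap.range Y) := by
    intro Y hY hΘY hYΘ hY0
    have h0 : Module.finrank ℂ (LinearMap.range Y) ≠ 0 := fun h =>
      hY0 (LinearMap.range_eq_bot.1 (Submodule.finrank_eq_zero.1 h))
    rcases hS Y hY hΘY hYΘ with h | h | h | h | h | h | h | h | h | h <;> omega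
  have hmin' : ∀ Z ∈ 𝔊, Θ * Z = Z → Z * Θ = -Z → Z ≠ 0 → Module.finrank ℂ (LinearMap.range B) ≤ Module.finrank ℂ (LinearMap.range Z) := by
    rw [hr]; exact hmin
  obtain ⟨ι, Um, Up, PU, QU, Lm, ιm, Pm, Qm, Lp, ιp, Pp, Qp, hιmem, hιι, hιΘ, hιs, hUm, hUp, hfinUm, hfinUp,
    hPM, hQM, hPU, hQU, hrangeP, hPUP, hQUQ, hfinQM, hfinPU, hfinQU, hLm, hLp,
    hιmapply, hPmmem, hQmmem, hbrLm, hirrLm, hιmmem, hιmιm, hPm, hQm, hfinPm, hfinQm, hPmQm, hdefPm, hdefQm, hadjLm,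
    hιpapply, hPpmem, hQpmem, hbrLp, hirrLp, hιpmem, hιpιp, hPp, hQp, hfinPp, hfinQp, hPpQp, hdefPp, hdefQp, hadjLp,
    hsplit⟩ :=
    UnitaryLeviSetup.exists_levi_pair hbr hirr hΘ hΘΘ hP hQ hadd hsymm hPQ hdefP hdefQ hadj hB hΘB hBΘ
  have hdich : ∀ X ∈ 𝔊, Θ * X = X → X * Θ = -X → X * ι = ι * X →
      Module.finrank ℂ (Up.map X) + Module.finrank ℂ (Um.map X) ≤ Module.finrank ℂ (LinearMap.range B) ∨
        (9 ≤ Module.finrank ℂ (Up.map X) ∧ 9 ≤ Module.finrank ℂ (Um.map X)) := fun X hX hΘX hXΘ hXc =>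
    UnitaryLeviSetup.profile_dichotomy hbr hΘΘ hP hQ hadd hsymm hPQ hdefP hdefQ hadj hmin hB hΘB hBΘ hιι hιΘ hιs hUm hUp
      hPM hQM hQU hfinQU hrangeP hX hΘX hXΘ hXc
  have hfinQU' := hfinQU
  rw [hr] at hfinQM hfinPU hfinQU hfinPm hfinQm hfinPp hfinQp hsplit hdich
  rw [hQ65] at hfinQM hfinQm hfinUm
  rw [hP18] at hfinPU hfinPp hfinUp
  have hcm : ∀ Z : Module.End ℂ W, Z * ι = ι * Z → ∀ x ∈ Um, Z x ∈ Um := fun Z hZ x hx =>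
    (hUm _).2 (by rw [← Module.End.mul_apply, ← hZ, Module.End.mul_apply, (hUm x).1 hx, map_neg])
  have hcp : ∀ Z : Module.End ℂ W, Z * ι = ι * Z → ∀ x ∈ Up, Z x ∈ Up := fun Z hZ x hx =>
    (hUp _).2 (by rw [← Module.End.mul_apply, ← hZ, Module.End.mul_apply, (hUp x).1 hx])
  have hfullm_of : Lm = ⊤ → False := fun h =>
    UnitaryLeviSetup.false_of_full_larger hbr hΘΘ hno1 hιι hιΘ hUm hUp (by omega) (by omega) hPM hQM (by omega)
      (by omega) hLm h
  have hkillm1 : ∀ X ∈ 𝔊, Θ * X = X → X * Θ = -X → X * ι = ι * X → Module.finrank ℂ (Um.map X) ≠ 1 := by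
    intro X hX hΘX hXΘ hXc h1
    obtain ⟨hxmem, hιmx, hxιm, hxrk⟩ := UnitaryLeviSetup.restrict_mem hcm hLm hιmapply X hX hΘX hXΘ hXc
    rw [h1] at hxrk
    exact hfullm_of (UnitaryRankOneRaise.eq_top_of_rankOne_raise hbrLm hirrLm hιmmem hιmιm hPm hQm
      (s := fun v w : Um => s (v : W) w) (hsU Um) (fun v w => hsymm v w) hPmQm hdefPm hdefQm hadjLm hxmem hιmx hxιm
      hxrk (by omega) (by omega) (by omega))
  have hkillm3 : ∀ X ∈ 𝔊, Θ * X = X → X * Θ = -X → X * ι = ι * X → Module.finrank ℂ (Um.map X) ≠ 3 := by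
    intro X hX hΘX hXΘ hXc h3
    obtain ⟨hxmem, hιmx, hxιm, hxrk⟩ := UnitaryLeviSetup.restrict_mem hcm hLm hιmapply X hX hΘX hXΘ hXc
    rw [h3] at hxrk
    refine hfullm_of (UnitaryDoubleLevi.eq_top_of_raise_of_core hbrLm hirrLm hιmmem hιmιm hPm hQm
      (s := fun v w : Um => s (v : W) w) (hsU Um) (fun v w => hsymm v w) hPmQm hdefPm hdefQm hadjLm hxmem hιmx hxιm
      (by rw [hxrk]; omega) (by omega) (by omega)
      fun U' 𝔩' ι' P' Q' hbr𝔩' hirr𝔩' hι' hι'ι' hP' hQ' hfinP' hfinQ' hP'Q' hdefP' hdefQ' hadj𝔩' => ?_)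
    rw [hxrk] at hfinP' hfinQ'
    exact UnitaryThreeCoprime.eq_top hbr𝔩' hirr𝔩' hι' hι'ι' hP' hQ' hfinP' (by omega) (s := fun x y : U' => s ((x : Um) : W) y) (fun x y z => by simp only [Submodule.coe_add, hadd]) (fun x y => hsymm _ _) hP'Q' hdefP' hdefQ' hadj𝔩'
  have hkillm5 : ∀ X ∈ 𝔊, Θ * X = X → X * Θ = -X → X * ι = ι * X → Module.finrank ℂ (Um.map X) ≠ 5 := by
    intro X hX hΘX hXΘ hXc h5
    obtain ⟨hxmem, hιmx, hxιm, hxrk⟩ := UnitaryLeviSetup.restrict_mem hcm hLm hιmapply X hX hΘX hXΘ hXc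
    rw [h5] at hxrk
    refine hfullm_of (UnitaryDoubleLevi.eq_top_of_raise_of_core hbrLm hirrLm hιmmem hιmιm hPm hQm
      (s := fun v w : Um => s (v : W) w) (hsU Um) (fun v w => hsymm v w) hPmQm hdefPm hdefQm hadjLm hxmem hιmx hxιm
      (by rw [hxrk]; omega) (by omega) (by omega)
      fun U' 𝔩' ι' P' Q' hbr𝔩' hirr𝔩' hι' hι'ι' hP' hQ' hfinP' hfinQ' hP'Q' hdefP' hdefQ' hadj𝔩' => ?_)
    rw [hxrk] at hfinP' hfinQ'
    exact UnitaryFive.eq_top_of_smul hbr𝔩' hirr𝔩' hι' hι'ι' hP' hQ' hfinP' (by omega) (s := fun x y : U' => s ((x : Um) : W) y) (fun x y z => by simp only [Submodule.coe_add, hadd]) (fun c x y => by simp only [Submodule.coe_smul, hsmul]) (fun x y => hsymm _ _) hP'Q' hdefP' hdefQ' hadj𝔩'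
  have hfullp_of : Lp = ⊤ → False := by
    intro hLptop
    obtain ⟨T4, hιT4, hT4ι, hT4r⟩ := UnitaryRaisingSpace.exists_raise_finrank_range_eq hιpιp hPp hQp (k := 4)
      (by omega) (by omega)
    obtain ⟨X4, hX4, hΘX4, hX4Θ, hX4c, hX4Up⟩ := UnitaryLeviSetup.exists_lift hbr hΘ hΘΘ hcp hιΘ hLp hιpapply T4
      (by rw [hLptop]; exact Submodule.mem_top) hιT4 hT4ι
    rw [hT4r] at hX4Up
    obtain ⟨hs4, hi4, hi4', hj4, hj4'⟩ := hsplit X4 hΘX4 hX4Θ hX4c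
    have hrk4 := hS X4 hX4 hΘX4 hX4Θ
    have hd4 := hdich X4 hX4 hΘX4 hX4Θ hX4c
    rw [hs4] at hrk4
    rw [hX4Up] at hrk4 hd4
    have hk_hkillm5 := hkillm5 X4 hX4 hΘX4 hX4Θ hX4c
    omega
  have hprof : ∀ X ∈ 𝔊, Θ * X = X → X * Θ = -X → X * ι = ι * X →
      (Module.finrank ℂ (Up.map X) = 0 ∧ Module.finrank ℂ (Um.map X) = 0) ∨
        (Module.finrank ℂ (Up.map X) = 0 ∧ Module.finrank ℂ (Um.map X) = 9) ∨
        (Module.finrank ℂ (Up.map X) = 1 ∧ Module.finrank ℂ (Um.map X) = 8) ∨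
        (Module.finrank ℂ (Up.map X) = 2 ∧ Module.finrank ℂ (Um.map X) = 7) ∨
        (Module.finrank ℂ (Up.map X) = 3 ∧ Module.finrank ℂ (Um.map X) = 6) ∨
        (Module.finrank ℂ (Up.map X) = 5 ∧ Module.finrank ℂ (Um.map X) = 4) ∨
        (Module.finrank ℂ (Up.map X) = 7 ∧ Module.finrank ℂ (Um.map X) = 2) ∨
        (Module.finrank ℂ (Up.map X) = 9 ∧ Module.finrank ℂ (Um.map X) = 0) ∨
        (Module.finrank ℂ (Up.map X) = 9 ∧ Module.finrank ℂ (Um.map X) = 9) := by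
    intro X hX hΘX hXΘ hXc
    obtain ⟨hs, hi, hi', hj, hj'⟩ := hsplit X hΘX hXΘ hXc
    have hkillm1' := hkillm1 X hX hΘX hXΘ hXc
    have hkillm3' := hkillm3 X hX hΘX hXΘ hXc
    have hkillm5' := hkillm5 X hX hΘX hXΘ hXc
    have hrk := hS X hX hΘX hXΘ
    have hd := hdich X hX hΘX hXΘ hXc
    rw [hs] at hrk
    generalize Module.finrank ℂ ↥(Submodule.map X Um) = jj at *
    have hjle : jj ≤ 9 := by omega
    interval_cases jj
    · rcases (show Module.finrank ℂ (Up.map X) = 0 ∨ Module.finrank ℂ (Up.map X) = 9 by omega) with h | h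
      · exact Or.inl ⟨h, rfl⟩
      · exact Or.inr (Or.inr (Or.inr (Or.inr (Or.inr (Or.inr (Or.inr (Or.inl ⟨h, rfl⟩)))))))
    · exact (hkillm1' rfl).elim
    · exact Or.inr (Or.inr (Or.inr (Or.inr (Or.inr (Or.inr (Or.inl ⟨by omega, rfl⟩))))))
    · exact (hkillm3' rfl).elim
    · exact Or.inr (Or.inr (Or.inr (Or.inr (Or.inr (Or.inl ⟨by omega, rfl⟩)))))
    · exact (hkillm5' rfl).elim
    · exact Or.inr (Or.inr (Or.inr (Or.inr (Or.inl ⟨by omega, rfl⟩))))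
    · exact Or.inr (Or.inr (Or.inr (Or.inl ⟨by omega, rfl⟩)))
    · exact Or.inr (Or.inr (Or.inl ⟨by omega, rfl⟩))
    · rcases (show Module.finrank ℂ (Up.map X) = 0 ∨ Module.finrank ℂ (Up.map X) = 9 by omega) with h | h
      · exact Or.inr (Or.inl ⟨h, rfl⟩)
      · exact Or.inr (Or.inr (Or.inr (Or.inr (Or.inr (Or.inr (Or.inr (Or.inr (⟨h, rfl⟩))))))))
  obtain ⟨⟨pm₀, hpm₀⟩, hpm₀0⟩ := Module.finrank_pos_iff_exists_ne_zero.1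
    (show 0 < Module.finrank ℂ (LinearMap.range B) by omega)
  obtain ⟨⟨qm₀, hqm₀⟩, hqm₀0⟩ := Module.finrank_pos_iff_exists_ne_zero.1
    (show 0 < Module.finrank ℂ ↥(Q ⊓ LinearMap.ker B) by omega)
  obtain ⟨X₁, hX₁, hΘX₁, hX₁Θ, hX₁c, c₁, hιc₁, -, hX₁c0⟩ :=
    UnitaryLeviFull.exists_raise_commute_apply_ne_zero_lower hbr hirr hΘ hΘΘ hQ hιmem hιι hιΘ hUm hUp
      ⟨pm₀, fun h => hpm₀0 (Subtype.ext h), ((hPM pm₀).1 hpm₀).1, ((hPM pm₀).1 hpm₀).2⟩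
      ⟨qm₀, fun h => hqm₀0 (Subtype.ext h), ((hQM qm₀).1 hqm₀).1, ((hQM qm₀).1 hqm₀).2⟩
  have hX₁j : Module.finrank ℂ (Um.map X₁) ≠ 0 := fun h0 => by
    have hmem : X₁ c₁ ∈ Um.map X₁ := Submodule.mem_map_of_mem ((hUm c₁).2 hιc₁)
    rw [Submodule.finrank_eq_zero.1 h0, Submodule.mem_bot] at hmem
    exact hX₁c0 hmem
  -- the raising ranks of `L⁻` lie in {0, 2, 4, 6, 7, 8, 9}
  have hSsub : ∀ A ∈ Lm, ιm * A = A → A * ιm = -A → Module.finrank ℂ (LinearMap.range A) = 0 ∨ Module.finrank ℂ (LinearMap.range A) = 2 ∨ Module.finrank ℂ (LinearMap.range A) = 4 ∨ Module.finrank ℂ (LinearMap.range A) = 6 ∨ Module.finrank ℂ (LinearMap.range A) = 7 ∨ Module.finrank ℂ (LinearMap.range A) = 8 ∨ Module.finrank ℂ (LinearMap.range A) = 9 := by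
    intro A hA hιA hAι
    by_cases hA0 : A = 0
    · exact Or.inl (by rw [hA0, LinearMap.range_zero, finrank_bot])
    · obtain ⟨XA, hXA, hΘXA, hXAΘ, hXAc, hXAU⟩ := UnitaryLeviSetup.exists_lift hbr hΘ hΘΘ hcm hιΘ hLm hιmapply A hA hιA hAι
      have hA0' : Module.finrank ℂ (LinearMap.range A) ≠ 0 := fun h =>
        hA0 (LinearMap.range_eq_bot.1 (Submodule.finrank_eq_zero.1 h))
      have hpA := hprof XA hXA hΘXA hXAΘ hXAc
      rw [← hXAU] at hA0' ⊢
      omega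
  obtain ⟨hymem, hιy, hyι, hyrk⟩ := UnitaryLeviSetup.restrict_mem hcm hLm hιmapply X₁ hX₁ hΘX₁ hX₁Θ hX₁c
  obtain ⟨A₀, hA₀, hιA₀, hA₀ι, hA₀0, hA₀min⟩ := UnitaryRaisingSpace.exists_minRank_raise Lm ιm
    ⟨_, hymem, hιy, hyι, fun h => by rw [h, LinearMap.range_zero, finrank_bot] at hyrk; omega⟩
  have hr0 : Module.finrank ℂ (LinearMap.range A₀) ≠ 0 := fun h =>
    hA₀0 (LinearMap.range_eq_bot.1 (Submodule.finrank_eq_zero.1 h))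
  rcases hSsub A₀ hA₀ hιA₀ hA₀ι with hrA | hrA | hrA | hrA | hrA | hrA | hrA
  · exact hr0 hrA
  · refine UnitaryEighteenSixtyFive.subNineFiftySix_ranks2_4_6_7_8_9_min2 hbrLm hirrLm hιmmem hιmιm hPm hQm (by omega) (by omega)
      (s := fun v w : Um => s (v : W) w) (hsU Um) (hsmU Um) (fun v w => hsymm v w) hPmQm hdefPm hdefQm hadjLm
      (fun A hA hιA hAι => ?_) hA₀ hιA₀ hA₀ι hrA
    have h1 := hSsub A hA hιA hAι
    by_cases hA0 : A = 0
    · exact Or.inl (by rw [hA0, LinearMap.range_zero, finrank_bot])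
    · have h2 := hA₀min A hA hιA hAι hA0
      omega
  · refine UnitaryEighteenSixtyFive.subNineFiftySix_ranks4_6_7_8_9_min4 hbrLm hirrLm hιmmem hιmιm hPm hQm (by omega) (by omega)
      (s := fun v w : Um => s (v : W) w) (hsU Um) (hsmU Um) (fun v w => hsymm v w) hPmQm hdefPm hdefQm hadjLm
      (fun A hA hιA hAι => ?_) hA₀ hιA₀ hA₀ι hrA
    have h1 := hSsub A hA hιA hAι
    by_cases hA0 : A = 0
    · exact Or.inl (by rw [hA0, LinearMap.range_zero, finrank_bot])
    · have h2 := hA₀min A hA hιA hAι hA0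
      omega
  · refine UnitaryEighteenSixtyFive.subNineFiftySix_ranks6_7_8_9_min6 hbrLm hirrLm hιmmem hιmιm hPm hQm (by omega) (by omega)
      (s := fun v w : Um => s (v : W) w) (hsU Um) (hsmU Um) (fun v w => hsymm v w) hPmQm hdefPm hdefQm hadjLm
      (fun A hA hιA hAι => ?_) hA₀ hιA₀ hA₀ι hrA
    have h1 := hSsub A hA hιA hAι
    by_cases hA0 : A = 0
    · exact Or.inl (by rw [hA0, LinearMap.range_zero, finrank_bot])
    · have h2 := hA₀min A hA hιA hAι hA0
      omega
  · refine UnitaryEighteenSixtyFive.subNineFiftySix_ranks7_8_9_min7 hbrLm hirrLm hιmmem hιmιm hPm hQm (by omega) (by omega)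
      (s := fun v w : Um => s (v : W) w) (hsU Um) (hsmU Um) (fun v w => hsymm v w) hPmQm hdefPm hdefQm hadjLm
      (fun A hA hιA hAι => ?_) hA₀ hιA₀ hA₀ι hrA
    have h1 := hSsub A hA hιA hAι
    by_cases hA0 : A = 0
    · exact Or.inl (by rw [hA0, LinearMap.range_zero, finrank_bot])
    · have h2 := hA₀min A hA hιA hAι hA0
      omega
  · refine UnitaryEighteenSixtyFive.subNineFiftySix_ranks8_9_min8 hbrLm hirrLm hιmmem hιmιm hPm hQm (by omega) (by omega)
      (s := fun v w : Um => s (v : W) w) (hsU Um) (hsmU Um) (fun v w => hsymm v w) hPmQm hdefPm hdefQm hadjLm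
      (fun A hA hιA hAι => ?_) hA₀ hιA₀ hA₀ι hrA
    have h1 := hSsub A hA hιA hAι
    by_cases hA0 : A = 0
    · exact Or.inl (by rw [hA0, LinearMap.range_zero, finrank_bot])
    · have h2 := hA₀min A hA hιA hAι hA0
      omega
  · refine UnitaryEighteenSixtyFive.subNineFiftySix_rank9 hbrLm hirrLm hιmmem hιmιm hPm hQm (by omega) (by omega)
      (s := fun v w : Um => s (v : W) w) (hsU Um) (hsmU Um) (fun v w => hsymm v w) hPmQm hdefPm hdefQm hadjLm
      (fun A hA hιA hAι => ?_) hA₀ hιA₀ hA₀ι hrA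
    have h1 := hSsub A hA hιA hAι
    by_cases hA0 : A = 0
    · exact Or.inl (by rw [hA0, LinearMap.range_zero, finrank_bot])
    · have h2 := hA₀min A hA hιA hAι hA0
      omega


end HodgeStructure

end Literature.AlgebraicGeometry.Motives

end
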